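import Mathlib
import Literature.MathematicalPhysics.QuantumFieldTheory.Dimock2011to13.FreeFlowSingleStep
import Literature.MathematicalPhysics.QuantumFieldTheory.Dimock2011to13.LocalizedStepAssembly
import Literature.MathematicalPhysics.QuantumFieldTheory.Dimock2011to13.RGStepNormalization

/-!
# Dimock, *The renormalization group according to Balaban* I §2.3 LEMMA 5 (scaling), second claim
# `φ⁰_{k+1}(Φ_{k+1,L}) = [φ_{k+1}(Φ_{k+1})]_L`, and II §2.3 (lumpy)∕(oooo): *"(−Δ + μ̄_k + L⁻²Qᵀ𝐚Q)f_L =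
# L⁻²((−Δ + μ̄_{k+1} + Qᵀ𝐚Q)f)_L"*, *"G⁰f_L = L²[Gf]_L"*, `φ⁰_{k+1,L𝛀⁺}([φ_{Ω₁ᶜ}]_L, [Φ_{k+1,𝛀⁺}]_L) =
# [φ_{k+1,𝛀⁺}(φ_{Ω₁ᶜ}, Φ_{k+1,𝛀⁺})]_L`, `S⁰_{k+1}(LΩ₁, [Φ]_L, [φ]_L) = S_{k+1}(Ω₁, Φ, φ)` — THE MINIMIZER IS SCALE
# COVARIANT, PROVED as reindexing-and-scaling of matrices, with the scaling hypotheses DISCHARGED for the lattice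
# operators; and (v1.2–v1.5) LEMMA 5 ITSELF: the free-flow RG step *"ρ_k = Z_ke^{−S_k(Φ_k,φ_k)} ⟹ ρ_{k+1} =
# Z_{k+1}e^{−S_{k+1}(Φ_{k+1},φ_{k+1})}"* for gen 43's `rgStep`, LEMMA `tiny` supplied by gen 30 BY NAME, iterated along
# gen 43's `densitySeq` from the Gaussian start (def2): (only) for every `k ≥ 1`

**Citation header (reproduction of PUBLISHED work; template of the Bałaban lattice Yang–Mills cell).**
J. Dimock, *The renormalization group according to Balaban. I. Small fields*, Rev. Math. Phys. **25** (2013) 1330010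
(= arXiv:1108.1335v2) [Dimock2013]: §1.2 (three0)∕(lattice1) L205–215 (the weighted inner product and *"(∂_μφ)(x) =
(φ(x + L^{−N}e_μ) − φ(x))/L^{−N} … and the Laplacian is Δ = −∂*∂"*); §2.2 L589–602 (*"The minimizer satisfies the
equation (−Δ + μ̄_k + a_kQ_kᵀQ_k)φ = a_kQ_kᵀΦ_k  The solution involves the inverse G_k = (−Δ + μ̄_k + a_kQ_kᵀQ_k)⁻¹ and has
the form φ = φ_k(Φ_k) defined by φ_k(Φ_k) = a_kG_kQ_kᵀΦ_k"*); §2.3 L673–677 (*"For the next lemma we need the operator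
G⁰_{k+1} = (−Δ + μ̄_k + a_{k+1}L⁻²Qᵀ_{k+1}Q_{k+1})⁻¹ defined on functions on 𝕋^{−k}_{M+N−k}. This scales to G_{k+1} as we
will see."*), LEMMA `tungsten` (hunger) L683–685 (*"φ⁰_{k+1} = φ⁰_{k+1}(Φ_{k+1}) = L⁻²a_{k+1}G⁰_{k+1}Qᵀ_{k+1}Φ_{k+1}"*), LEMMA 5
= the `(scaling)` lemma L797–808 with its proof L814–848 — second claim L800–803 *"Furthermore φ⁰_{k+1}(Φ_{k+1,L}) =
[φ_{k+1}(Φ_{k+1})]_L"*, proof L814–828 and (71) L831–842.  J. Dimock, *The renormalization group according to Balaban.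
II. Large fields*, J. Math. Phys. **54** (2013) 092301 (= arXiv:1212.5562v2) [Dimock2013BalabanII]: §2.2 L588–590
(*"[−Δ]_Ω ≡ 1_Ω[−Δ]1_Ω is the Laplacian with Dirichlet boundary conditions, and [−Δ]_{Ω,Ωᶜ} ≡ 1_Ω[−Δ]1_{Ωᶜ}"*), THEOREM 2.1
(unknown) L603–613 (the minimizer `φ_{k,𝛀} = G_{k,𝛀}(Qᵀ_{k,𝛀}𝐚Φ_{k,𝛀} + [Δ]_{Ω₁,Ω₁ᶜ}φ_{Ω₁ᶜ})`), §2.3 LEMMA 2.3 (eddie)∕(eddie1)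
L746–756, (nono) and `S⁰_{k+1}(Ω₁, Φ_{k+1,𝛀⁺}, φ)` L777–792, and the scaling check L920–951: the sentence L920–922, the
operator identity L923–929, *"It follows that G⁰_{k,L𝛀⁺}f_L = L²[G_{k,𝛀⁺}f]_L"* L930–933, (lumpy) L935–938, (oooo) L940–943,
*"The other terms in the exponent in (cloudy3) scale similarly"* L944–951.  TeX line numbers refer to the arXiv sources
held by the cell (`inputs/files/dimock/src/1108.1335/1108.1335.tex`, sha256[:16] 7382e6540dded9be;
`…/1212.5562/1212.5562.tex`, 75c5792fc48eacbc); every quotation below was read there this session.  Dimock's papers are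
published and refereed and are the cell's TEMPLATE, not manuscripts under audit; no quantity of the Bałaban series is
touched.

**What the papers print (verbatim).**  I §2.3 L644–662: *"Now we rederive the identity ρ_k(Φ_k) = Z_k exp(−S_k(Φ_k, φ_k))
for the free case by an inductive procedure. We assume that the identity holds for for ρ_k and show it holds for ρ_{k+1}. …
Starting with the identity for k we have ρ̃_{k+1}(Φ_{k+1}) = 𝒩^{−1}_{aL,𝕋¹_{M+N−k}}Z_k∫exp(−(a/2L²)‖Φ_{k+1} − QΦ_k‖² − S_k(Φ_k,
φ_k))dΦ_k = 𝒩^{−1}_{aL,𝕋¹_{M+N−k}}Z_k∫exp(−J(Φ_{k+1}, Φ_k, φ_k))dΦ_k  (manx)"*; I LEMMA `tiny` L748–759: *"Let ρ_k(Φ_k) = Z_k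
exp(−S_k(Φ_k, φ_k)). Then ρ̃_{k+1} is given by ρ̃_{k+1}(Φ_{k+1}) = Z_k𝒩^{−1}_{aL,𝕋¹_{N+M−k}}(2π)^{|𝕋⁰_{M+N−k}|/2}(det C_k)^{1/2}
exp(−S⁰_{k+1}(Φ_{k+1}, φ⁰_{k+1}))  (understand)  where C_k = (Δ_k + (a/L²)QᵀQ)⁻¹"*; I (Ziterate) L805–807: *"Z_{k+1} = Z_k
𝒩^{−1}_{a,𝕋¹_{M+N−k}}(2π)^{|𝕋⁰_{M+N−k}|/2}(det C_k)^{1/2}"*.  I L797–803: *"Lemma (scaling) With ρ̃_{k+1} given by (understand), the scaled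
density ρ_{k+1} as defined by (scaleddensity) is for Φ_{k+1} : 𝕋⁰_{M+N−k−1} → ℝ  ρ_{k+1}(Φ_{k+1}) = Z_{k+1}exp(−S_{k+1}(Φ_{k+1},
φ_{k+1}))  Furthermore φ⁰_{k+1}(Φ_{k+1,L}) = [φ_{k+1}(Φ_{k+1})]_L"*; I L814–828: *"Proof. We scale by f_L(x) =
L^{−1/2}f(x/L). The averaging operator Q is scale invariant and μ̄_k = L^{−2}μ̄_{k+1} so we compute (−Δ + μ̄_k +
a_{k+1}L^{−2}Qᵀ_{k+1}Q_{k+1})f_L = L^{−2}[(−Δ + μ̄_{k+1} + a_{k+1}Qᵀ_{k+1}Q_{k+1})f]_L  It follows that the inverses satisfy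
G⁰_{k+1}f_L = L²[G_{k+1}f]_L and so φ⁰_{k+1}(Φ_{k+1,L}) = L^{−2}a_{k+1}G⁰_{k+1}Qᵀ_{k+1}Φ_{k+1,L} = [a_{k+1}G_{k+1}Qᵀ_{k+1}Φ_{k+1}]_L =
[φ_{k+1}(Φ_{k+1})]_L"*; I (71) L831–840: *"Now in ρ_{k+1}(Φ_{k+1}) we have S⁰_{k+1}(Φ_{k+1,L}, φ_{k+1,L}) = ½(a_{k+1}/L²)‖Φ_{k+1,L} −
Q_{k+1}φ_{k+1,L}‖² + ½‖∂φ_{k+1,L}‖² + ½μ̄_k‖φ_{k+1,L}‖² = ½a_{k+1}‖Φ_{k+1} − Q_{k+1}φ_{k+1}‖² + ½‖∂φ_{k+1}‖² + ½μ̄_{k+1}‖φ_{k+1}‖² =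
S_{k+1}(Φ_{k+1}, φ_{k+1})"*.  II L920–951: *"Let us also check that this scales the way we expect. As in section
averaging we replace each Ω_j by LΩ_j and each field like Φ_{j,δΩ_j} by [Φ_{j,L}]_{LδΩ_j} = [Φ_{j,δΩ_j}]_L. Since μ̄_k =
L^{−2}μ̄_{k+1} and a^{(k)}_j = L^{−2}a^{(k+1)}_j and Q_j is scale invariant we have (−Δ + μ̄_k + L^{−2}Qᵀ_{k+1,𝛀⁺}𝐚^{(k+1)}
Q_{k+1,𝛀⁺})f_L = L^{−2}((−Δ + μ̄_{k+1} + Qᵀ_{k+1,𝛀⁺}𝐚^{(k+1)}Q_{k+1,𝛀⁺})f)_L  It follows that G⁰_{k,L𝛀⁺}f_L = L²[G_{k,𝛀⁺}f]_L and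
hence from (eddie) φ⁰_{k+1,L𝛀⁺}([φ_{Ω₁ᶜ}]_L, [Φ_{k+1,𝛀⁺}]_L) = [φ_{k+1,𝛀⁺}(φ_{Ω₁ᶜ}, Φ_{k+1,𝛀⁺})]_L  (lumpy)  Then S⁰_{k+1}(LΩ₁,
[Φ_{k+1,𝛀⁺}]_L, [φ_{k+1,𝛀⁺}]_L) = S_{k+1}(Ω₁, Φ_{k+1,𝛀⁺}, φ_{k+1,𝛀⁺})  (oooo)  The other terms in the exponent in (cloudy3)
scale similarly, and thus they become exp(−½⟨φ_{Ω₁ᶜ}, [−Δ + μ̄_{k+1}]_{Ω₁ᶜ}φ_{Ω₁ᶜ}⟩ − ⟨φ_{Ω₁ᶜ}, [−Δ]_{Ω₁,Ω₁ᶜ}φ_{k+1,𝛀⁺}⟩ −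
S_{k+1}(Ω₁, Φ_{k+1,𝛀⁺}, φ_{k+1,𝛀⁺})) as expected."*; (eddie)∕(eddie1) L746–756: *"φ⁰_{k+1,𝛀⁺}(φ_{Ω₁ᶜ}, Φ_{k+1,𝛀⁺}) =
G⁰_{k+1,𝛀⁺}(L^{−2}Qᵀ_{k+1,𝛀⁺}𝐚^{(k+1)}Φ_{k+1,𝛀⁺} + [Δ]_{Ω₁,Ω₁ᶜ}φ_{Ω₁ᶜ})  with  G⁰_{k+1,𝛀⁺} = [−Δ + μ̄_k + L^{−2}Qᵀ_{k+1,𝛀⁺}𝐚^{(k+1)}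
Q_{k+1,𝛀⁺}]^{−1}_{Ω₁}"*; the next-level minimizer is THEOREM 2.1's (unknown) L603–613 one level up: *"φ_{k,𝛀} =
φ_{k,𝛀}(φ_{Ω₁ᶜ}, Φ_{k,𝛀}) = G_{k,𝛀}(Q_{k,𝛀}ᵀ𝐚Φ_{k,𝛀} + [Δ]_{Ω₁,Ω₁ᶜ}φ_{Ω₁ᶜ})  where  G_{k,𝛀} = [−Δ + μ̄_k + Q_{k,𝛀}ᵀ𝐚Q_{k,𝛀}]_{Ω₁}^{−1}"*.

**Why this file (cell TEMPLATE.md §4.2 row «D2 §2.3 Lemmas 2.3, 2.5», §4.1 row «D1 §2.2–2.3 free flow»).**  Both kernels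
of the free flow declare the scaling identities out of scope: `FreeFlowSingleStep` (*"NOT claimed. The Gaussian
integrals/constants, the scaling identities (lumpy)/(oooo) L920–948 …"*) and `GaussianSingleStep` (*"I's scaling lemma
L797–848 ((lumpy)/(oooo), Z_{k+1} (Ziterate)) and LEMMA tungsten beyond what FreeFlowSingleStep has"*); gen 42's
`LocalizedStepAssembly` proved (oooo)∕(71) at the level of the ACTION with the scaled fine field `φ_{k+1,L}` GIVEN
(`Qterm_scale`, `Sstar0_scale`, `S0_scale`) and *"Q is scale invariant"* (`blockAvg_scale`), and gen 43's
`RGStepNormalization` proved (Ziterate).  What no module has is the statement about the MINIMIZER itself: that the fine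
field sitting inside `ρ_{k+1}` after the rescaling IS the next-level minimizer — the second claim of LEMMA 5 and (lumpy) —
which rests on the operator identity L816–819 ∕ L923–929 and *"G⁰f_L = L²[Gf]_L"*.  This module proves them on the
carriers where the minimizers live: `MultiRegionFreeFlow` (`gInvO`, `GkO`, `minimizer` = (unknown)∕(eddie), `action` =
`S_k(Ω₁, Φ, φ)`, `energy` = the exponent with its boundary source, `DeltakO` = `Δ_{k,𝛀}`), `FreeFlowSingleStep` (`phi0` =
`φ⁰_{k+1,𝛀⁺}`, `energyNext` = `S⁰_{k+1} − ⟨φ, src⟩`) and `FluctuationCovarianceIdentity` (`Gk` = `G_k`, `Deltak` = `Δ_k`),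
with gen 42's `LocalizedStepAssembly.scaleField c σ` (imported, not re-declared) as the scaling `f ↦ f_L`.

**What is reproduced here (kernel-checked, zero `sorry`; imports `FreeFlowSingleStep` and `LocalizedStepAssembly`, (v1.2)
gen 43's `RGStepNormalization`, hence Mathlib).**  Scaling relates TWO copies of every carrier: the sites `κ₁` of the fine lattice `𝕋^{−(k+1)}_{M+N−k−1}` (print: the
unscaled, next-level problem) and `κ₀` of `𝕋^{−k}_{M+N−k}` (the scaled one), identified by the relabelling `σ : κ₁ ≃ κ₀` (print
`y ↦ Ly`), and likewise `τ : m₁ ≃ m₀` for the block variables; `Matrix.reindex` transports matrices (`M^{τσ}`), and an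
operator "scales with `L⁻²`" when the level-`k` matrix is `s • M^{σσ}` of the level-`(k+1)` matrix, `s = L⁻²`.
* Part 1 — THE FRAME.  `scaleField_eq_smul_comp` (`φ_c = c·(φ ∘ σ⁻¹)`), additivity∕homogeneity∕injectivity of `f ↦ f_c`,
  **`reindex_mulVec_scaleField`** (`M^{σ′σ}φ_c = (Mφ)_c` — a transported matrix acts on scaled fields by scaling its
  action: the algebraic content of *"Q is scale invariant: Qφ_L = (Qφ)_L"*), `scaleField_dotProduct` (`φ_c·ψ_{c′} = cc′ φ·ψ`).
* Part 2 — THE OPERATOR SCALING ([Dimock2013BalabanII] L923–933; [Dimock2013] L816–820).  **`gInvO_scale`** (`[s·D^σ +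
  (Q^{τσ})ᵀ(s·𝐚^τ)Q^{τσ}] = s·[D + Qᵀ𝐚Q]^σ`), **`gInvO_mulVec_scaleField`** (THE PRINTED IDENTITY on fields: the bracket at a
  scaled field is `s` times the scaled image of the bracket), private folklore (transport commutes with products, sums,
  inverses; `(s·M)⁻¹ = s⁻¹·M⁻¹` over a field), **`GkO_scale`**
  ∕ **`GkO_mulVec_scaleField`** (*"G⁰f_L = L²[Gf]_L"*: `G(scaled) = s⁻¹·G^σ`), **`minimizer_scale`** (THE CORE OF (lumpy): for
  every `c` and `s ≠ 0`, `φ(scaled data; Φ_c, src_{sc}) = [φ(data; Φ, src)]_c` — the source carries the extra `s` because it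
  is `[Δ]_{Ω₁,Ω₁ᶜ}φ_{Ω₁ᶜ}` and `Δ` scales with `s`), **`DeltakO_scale`** (`Δ_{k,𝛀}(scaled) = s·Δ_{k,𝛀}^τ`).
* Part 3 — (oooo) ([Dimock2013BalabanII] L940–951; [Dimock2013] (71) L831–840).  **`bilinear_scale`** (`ψ_c·(s·M^{ρσ})φ_c =
  s·c²·ψ·Mφ` — every bilinear term of the exponent, *"The other terms … scale similarly"*), **`action_scale`**∕**`action_scale_eq`**
  (`S(scaled; Φ_c, φ_c) = s·c²·S(Φ, φ)`, `=` for `s·c² = 1`), **`energy_scale`**∕**`energy_scale_eq`** (the exponent WITH its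
  boundary source), **`energy_minimizer_scale_eq`** ((lumpy) inside (oooo): the minimum VALUES agree), `dot_DeltakO_scale`
  (LEMMA 2.2 (rain)'s `½⟨Φ, Δ_{k,𝛀}Φ⟩`).
* Part 4 — PART I'S OBJECTS ([Dimock2013] L589–602, L673–677, L814–828).  `gkInv_scale`∕`gkInv_mulVec_scaleField` (L816–819 as
  printed, single region), **`Gk_scale`**∕**`Gk_mulVec_scaleField`** (L820 *"G⁰_{k+1}f_L = L²[G_{k+1}f]_L"*), **`phik_scale`**
  (LEMMA 5's second claim L800–803∕L823–828: `(s·a)·G_k(scaled)(Q^{τσ})ᵀΦ_c = [a·G_kQ_kᵀΦ]_c`, i.e. `φ⁰_{k+1}(Φ_{k+1,L}) =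
  L⁻²a_{k+1}G⁰_{k+1}Qᵀ_{k+1}Φ_{k+1,L} = [a_{k+1}G_{k+1}Qᵀ_{k+1}Φ_{k+1}]_L`), **`Deltak_scale`**∕`dot_Deltak_scale` ((spiffy)'s `Δ_k`
  scales like `a_k`, so `½⟨Φ_{k,L}, Δ⁰Φ_{k,L}⟩ = ½⟨Φ_k, Δ_kΦ_k⟩` in the invariant frame).
* Part 5 — (lumpy) AND (oooo) AS PRINTED ([Dimock2013BalabanII] L920–943).  `weightO_scale`∕`rowsO_scale`∕`sumElim_scaleField`
  (the split weight `a′ ⊕ 𝐚_τ` and the rows `(QQ_k, Q_τ)` transport blockwise), **`lumpy`** (for `FreeFlowSingleStep.phi0` =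
  (eddie) with `G⁰ = [−Δ + μ̄_k + L⁻²Qᵀ𝐚^{(k+1)}Q]⁻¹` against `MultiRegionFreeFlow.minimizer` with the next-level weight
  `a_{k+1} ⊕ 𝐚^{(k+1)}_τ`: `φ⁰_{k+1,L𝛀⁺}([φ_{Ω₁ᶜ}]_L, [Φ_{k+1,𝛀⁺}]_L) = [φ_{k+1,𝛀⁺}(φ_{Ω₁ᶜ}, Φ_{k+1,𝛀⁺})]_L`, the HYPOTHESES being
  exactly the printed sentence L921–922: `hD` (*"μ̄_k = L^{−2}μ̄_{k+1}"* and the Laplacian: `[−Δ + μ̄_k]_{LΩ₁} = s·[−Δ +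
  μ̄_{k+1}]_{Ω₁}^σ`), `ha`∕`haτ` (*"a^{(k)}_j = L^{−2}a^{(k+1)}_j"*, with `a′ = aNext a_k aL = L⁻²a_{k+1}`), `hQn`∕`hQτ` (*"Q_j is
  scale invariant"*: `QQ_k` and `Q_τ` are the transported next-level rows)), **`oooo`** (for `FreeFlowSingleStep.energyNext`:
  `S⁰_{k+1}(LΩ₁, [Φ]_L, [φ]_L) − ⟨[φ]_L, src_L⟩ = S_{k+1}(Ω₁, Φ, φ) − ⟨φ, src⟩` for EVERY `φ`, frame `s·c² = 1`).
* Part 6 — THE HYPOTHESES DISCHARGED FOR THE LATTICE OPERATORS ([Dimock2013] (lattice1) L212–215; [Dimock2013BalabanII]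
  L588–590).  `shiftMat t` (the pull-back `φ ↦ φ ∘ t` by a successor map `t = (· + ηe_μ)`), **`negLap t η`** (`−Δ_η =
  η⁻²Σ_e(1 − P_{t_e})ᵀ(1 − P_{t_e})` = `−∂*∂` in the unweighted frame), **`dot_negLap_mulVec`** (`⟨φ, (−Δ_η)φ⟩ = η⁻²Σ_eΣ_y(φ(t_ey)
  − φ(y))²`), `negLap_transpose`, **`negLap_posSemidef`**, **`negLap_add_mass_posDef`** (`−Δ_η + μ̄ > 0` for `μ̄ > 0`: the
  hypothesis `D > 0` of `MultiRegionFreeFlow` MET by the massive free operator), **`sum_gradsq_eq`** (FRAME CHECK: gen 42's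
  weighted `Σ_μ gradsq = ‖∂φ‖²` is `η³·⟨φ, (−Δ_η)φ⟩`), **`shiftMat_scale`**∕`one_sub_shiftMat_scale` (successor maps
  intertwined by `σ` — the scaled lattice is the same graph — have transported pull-backs), **`negLap_scale`** (`−Δ_{η₀} =
  L⁻²·(−Δ_{η₁})^σ` for `η₀ = Lη₁`: SCALING PRODUCES `L⁻²` ON THE DIFFERENCE OPERATOR), **`negLap_add_mass_scale`** (`[−Δ_{η₀} +
  μ̄_k] = L⁻²·[−Δ_{η₁} + μ̄_{k+1}]^σ` — `hD` DISCHARGED), **`block_scale`** (Dirichlet restriction `[·]_{Ω₁}` and the couplings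
  `[·]_{Ω₁,Ω₁ᶜ}` to TRANSPORTED regions `LΩ₁ = σ(Ω₁)` commute with the scaling), **`source_scale`** (the boundary source
  `[Δ]_{Ω₁,Ω₁ᶜ}φ_{Ω₁ᶜ}` at the scaled outside field is the `(s·c)`-scaled source — the input of `minimizer_scale`), `blockAvgMat`
  ∕`blockAvgMat_mulVec` (gen 42's `blockAvg B w` as a matrix) and **`blockAvgMat_scale`** (*"Q is scale invariant"* AS A MATRIX
  IDENTITY under gen 42's transported-blocks hypothesis — `hQn`∕`hQτ` DISCHARGED for block averages).
* Part 7 — THE PRINTED STATEMENTS WITH NO HYPOTHESIS LEFT BUT THE GEOMETRY.  **`phik_lattice`** (LEMMA 5's second claim for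
  `G_{k+1} = (−Δ_{η₁} + μ̄_{k+1} + a_{k+1}QᵀQ)⁻¹`, `G⁰_{k+1} = (−Δ_{η₀} + μ̄_k + a_{k+1}L⁻²QᵀQ)⁻¹`: lattices the same graph, `η₀ =
  Lη₁`, `μ̄_k = L⁻²μ̄_{k+1}`, `Q_{k+1}` transported), **`Gk_lattice`** (L820 literally: `G⁰_{k+1}f_L = L²[G_{k+1}f]_L`),
  **`lumpy_lattice`** ((lumpy) for the Dirichlet operators `[−Δ_η + μ̄]_{Ω₁}` and the sources `[Δ_η]_{Ω₁,Ω₁ᶜ}φ_{Ω₁ᶜ}` of Part 6,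
  the region and its complement transported by `σ`, the weights `L⁻²𝐚^τ` and rows `Q^{τσ}`), **`oooo_lattice`** ((oooo) at
  the two minimizers, frame `L⁻²c² = 1`).
* Part 8 — non-vacuity (`−Δ = 0` on one site; `⟨φ, (−Δ)φ⟩ = 2(φ₀ − φ₁)²` on two sites; `minimizer_scale` along the identity).
* Part 9 (v1.1) — THE SAME INDEX SET.  On the torus the two lattices ARE one index set (`(ℤ/L^{M+N}ℤ)³`, `y ↦ Ly` the
  identity, the same successor maps), every transport is `rfl`, and the statements become scalar identities:
  `scaleField_refl` (`f_L = c·f`), **`negLap_scale_self`** (`−Δ_{Lη} = L⁻²·(−Δ_η)`), `negLap_add_mass_scale_self`, **`Gk_self`**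
  (*"G⁰_{k+1} = L²G_{k+1}"* AS MATRICES: `(−Δ_{η₀} + μ̄_k + a_{k+1}L⁻²QᵀQ)⁻¹ = L²·(−Δ_{η₁} + μ̄_{k+1} + a_{k+1}QᵀQ)⁻¹`),
  **`phik_self`**, **`lumpy_self`** (the minimizer at `cΦ`, `cφ_{Ω₁ᶜ}` of the `η₀`-problem is `c` times the minimizer of the
  `η₁`-problem).
* Part 10 (v1.1) — *"The other terms in the exponent in (cloudy3) scale similarly, and thus they become …"* (II L944–951) IN
  ONE STATEMENT: `nonoExponent` (the three-term exponent of (nono)∕(cloudy3): `½⟨φᶜ, [−Δ_η + μ̄]_{Ω₁ᶜ}φᶜ⟩ + ⟨φᶜ,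
  [−Δ_η]_{Ω₁ᶜ,Ω₁}φ⟩ + S(Ω₁, Φ, φ)` on the lattice operators of Part 6), **`nonoExponent_scale`** (at the scaled fields it is
  `L⁻²c²` times the unscaled one — lattices the same graph, `η₀ = Lη₁`, `μ̄_k = L⁻²μ̄_{k+1}`, region transported, weights
  `L⁻²𝐚^τ`, rows `Q^{τσ}`), `nonoExponent_scale_eq` (frame `L⁻²c² = 1`), **`nonoExponent_minimizer_scale_eq`** (at the two
  minimizers, via `lumpy_lattice`: (nono)'s value for the scaled problem IS the next-level value L946–949).
* Part 14 (v1.5) — **THE FREE FLOW ALONG THE WHOLE TRAJECTORY**: `kth_exponent_eq` (the two frames of (first0) L340–355),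
  `blockKernel_mul_gaussianStart`, **`rgStep_gaussianStart`** ((first) → (third) → (only) at `k = 1` from (def2) `ρ₀ =
  exp(−½⟨Φ₀, (−Δ + μ̄₀)Φ₀⟩)`: `rgStep a L Q τ ρ₀ = freeDensity D₁ Q₁ a Z₁`, `Z₁ = 𝒩^{−1}_{a,|𝕋¹|}·GaussianSingleStep.fineConst …` —
  gen 30's `integral_exp_neg_energy` BY NAME), **`freeFlow_densitySeq`** (*"ρ_k(Φ_k) = Z_k exp(−S_k(Φ_k, φ_k))"* (only) FOR
  EVERY `k ≥ 1` of gen 43's `densitySeq` from the Gaussian start, `a_k = aK a L k`, `Z_k` = gen 42's `Zseq` of the one-step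
  factors — induction `Nat.le_induction`: base `rgStep_gaussianStart`, step Part 13's `lemma5_rgStep`; hypotheses = the
  geometry at every level).
* Part 13 (v1.4) — **LEMMA 5 ASSEMBLED: THE FREE-FLOW RG STEP ON DENSITIES** (I §2.3 L641–848 end to end, *"We assume that
  the identity holds for ρ_k and show it holds for ρ_{k+1}"* L644–646).  `freeDensity D Q_k a_k Z_k` = (only)'s
  `Z_k exp(−S_k(Φ_k, φ_k(Φ_k)))`; `energy_emptyLayers`∕`minimizer_emptyLayers`∕`GkO_smul_one`∕`minimizer_smul_one` (part I inside
  part II's carrier: no layers `τ`, scalar weight); **`blockKernel_mul_freeDensity`** ((manx): the integrand of (kth) against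
  `ρ_k` is `Z_k e^{−J}` with gen 30's `FreeFlowSingleStep.J`, the literal `Q = (L√L)⁻¹Q̂` and width `aL` read as `J`'s `a/L²` at
  the isometric `𝕋¹`-coordinates `(L√L)Ψ`); **`blockDensity_freeDensity`** (LEMMA `tiny` (understand) for gen 43's
  `blockDensity`, by gen 30's `GaussianSingleStep.integral_exp_neg_J_minimizer'` BY NAME: `ρ̃_{k+1}(Ψ) =
  𝒩^{−1}_{aL}Z_k(2π)^{|𝕋⁰|/2}(det C_{k,0})^{1/2}e^{−S⁰_{k+1}(Ψ̂, φ⁰_{k+1}(Ψ̂))}`, `C_{k,0} = FluctuationCovarianceIdentity.Ckr … 0`);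
  **`lemma5_rgStep`** (`rgStep a L Q τ (freeDensity D Q_k a_k Z_k) = freeDensity D₁ Q_{k+1} a_{k+1} Z_{k+1}`, `Z_{k+1} =
  Z_k·𝒩^{−1}_{a,n}·(2π)^{|𝕋⁰|/2}(det C_k)^{1/2}` — (Ziterate) — given the scaled data `hD1`∕`hQn`∕`ha1`); the hypotheses
  discharged: **`lemma5_rgStep_lattice`** (`−Δ_η + μ̄`: `hD`, `hD1`), **`lemma5_rgStep_avg`** (the printed `Q = L⁻³Σ_{B(y)}` = gen
  43's `avgMat`, `N = L³`: `hQ`), `aNext_aK_div` ((ak) for the printed widths `aK`), **`lemma5_printed`** (all three: only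
  the geometry `ht`∕`hb`∕`hQn` remains hypothesis).
* Part 12 (v1.3) — THE DIRICHLET OPERATOR IS POSITIVE DEFINITE: **`dirichlet_negLap_add_mass_posDef`** (`[−Δ_η + μ̄]_{Ω₁} > 0`
  for `μ̄ > 0` — the standing hypothesis `hD : D.PosDef` of `MultiRegionFreeFlow`∕`FreeFlowSingleStep`∕`GaussianSingleStep` MET by
  the operator the print means, II L588–590 + I L216), `dirichlet_negLap_posSemidef`, and `nonoCross_comm` (the two
  orientations of (nono)'s cross term agree — an outside reader's INFO folded).
* Part 11 (v1.2) — LEMMA 5 (scaling), FIRST CLAIM `ρ_{k+1}(Φ_{k+1}) = Z_{k+1}exp(−S_{k+1}(Φ_{k+1}, φ_{k+1}))` (I L797–799,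
  L843–848) FOR GEN 43'S (scaleddensity): `frame_smul_scaleField` (`(L√L)·Φ_{L^{−1/2}} = Φ_L`: the print-frame scaling of
  `RGStepNormalization.scaledDensity` ∕ gen 42's `scaleConst` vs the isometric `c = L`, reading (ii)),
  **`lemma5_scaledDensity`** (if `ρ̃_{k+1}(Ψ) = K·exp(−E⁰(Ψ̂, φ⁰(Ψ̂)))`, `Ψ̂ = (L√L)Ψ`, `E⁰` the scaled exponent at its minimizer
  — the form LEMMA `tiny` (understand) delivers — then `scaledDensity L τ ρ̃ Φ = K·L^{−n/2}·exp(−E(Φ, φ(Φ)))` with the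
  UNSCALED exponent at ITS minimizer), **`lemma5_scaledDensity_Z`** (with `K = Z⁰_{k+1} =` gen 43's `Z0next`: the constant is
  `Z_k·(𝒩^{−1}_{a,n}·g)` — (Ziterate) BY NAME), **`lemma5_scaledDensity_partI`** (part I's literal form: scalar weight
  `a_{k+1}·1`, source `0`, `φ_{k+1} = a_{k+1}G_{k+1}Qᵀ_{k+1}Φ`, `S_{k+1} = MultiRegionFreeFlow.action`).

**Readings (declared).**  (i) LATTICES ARE FINITE TYPES; the relabelling `σ : κ₁ ≃ κ₀` is the print's `y ↦ Ly` between
`𝕋^{−(k+1)}_{M+N−k−1}` and `𝕋^{−k}_{M+N−k}` (same number of sites), `τ`, `ν`, `ρ` the same for the block variables; *"replace each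
Ω_j by LΩ_j"* is a pair of predicates with `p₁ = p₀ ∘ σ` (`block_scale`, `Equiv.subtypeEquiv`).  (ii) FRAME.  The carriers
of `MultiRegionFreeFlow`∕`FreeFlowSingleStep`∕`FluctuationCovarianceIdentity` use UNWEIGHTED dot products on every lattice
(the isometric normalisation of `FreeFlowSingleStep`'s header and `RGStepNormalization`'s reading (vi): a field `f` on a
lattice of spacing `η` is represented by `η^{3/2}f`).  In that frame the print's `f_L(x) = L^{−1/2}f(x/L)` (I L814), which
maps spacing-`η₁` fields to spacing-`η₀ = Lη₁` fields, reads `scaleField c σ` with `c = L^{−1/2}·(η₀/η₁)^{3/2} = L` — the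
same `c` for the fine field and for every block variable `Φ_{j,δΩ_j}` (spacings `L^{−(k+1−j)}` and `L^{−(k−j)}`) — while the
operators and weights scale with `s = L⁻²`; (lumpy), the operator identity and `G⁰f_L = L²[Gf]_L` hold for EVERY `c`
(linearity: `minimizer_scale`, `GkO_mulVec_scaleField`, `lumpy`, `lumpy_lattice` carry `c` free), and (oooo) holds exactly
when `s·c² = 1` (`action_scale` gives the factor `s·c²` for any frame; in the print's weighted frame the same bookkeeping is
gen 42's `Qterm_scale`∕`gradsq_scale`∕`mass_scale` with `c²L = 1` and the `η³` weights — `sum_gradsq_eq` is the bridge).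
(iii) `−Δ` is built from abstract successor maps `t_e : S → S` (print `x ↦ x + ηe_μ` on the torus, `e` ranging over the
`d = 3` directions; any finite direction type here), as gen 42's `latDeriv`∕`gradsq`; *"the scaled lattice is the same
graph"* is the intertwining `σ(t₁y) = t₀(σy)` (`L(y + η₁e) = Ly + η₀e`), the hypothesis of gen 42's `latDeriv_scale`.  (iv)
`[Δ]_{Ω₁,Ω₁ᶜ}φ_{Ω₁ᶜ}` is carried as `MultiRegionFreeFlow`'s source `src`; in Part 7 it is `−[negLap]_{Ω₁,Ω₁ᶜ}φ_{Ω₁ᶜ}` (`Δ =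
−(−Δ)`; the mass is diagonal and contributes nothing off the diagonal).  (v) `a′ = aNext a_k aL` IS `L⁻²a_{k+1}` by the
definition of `a_{k+1}` ((stringy2), `FreeFlowSingleStep.aNext`'s docstring); hypothesis `ha` of `lumpy`∕`oooo` only NAMES
`a_{k+1}`.  (vi) LOCATED PRECISION (INFO, records only — an outside reader's, cell journal l.25141): II L932 prints
*"G⁰_{k,L𝛀⁺}f_L = L²[G_{k,𝛀⁺}f]_L"* with the index `k` where (eddie1) L755 and (lumpy) L936 carry `k+1`; quoted verbatim above,
immaterial for the kernel (`GkO_scale` is level-agnostic).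

**What is NOT claimed.**  LEMMA `tiny` (understand), LEMMA `tungsten`, THEOREM 2.1, LEMMA 2.3 themselves — they are
gen 30's `GaussianSingleStep`∕`FreeFlowSingleStep` and `MultiRegionFreeFlow`, USED BY NAME (v1.2's Part 11 took LEMMA `tiny`'s
output shape as a hypothesis; v1.4's Part 13 removes that hypothesis by invoking `integral_exp_neg_J_minimizer'` inside gen
43's `blockDensity`, so LEMMA 5 holds for `rgStep` with no assumption on `ρ̃_{k+1}`); the GEOMETRY — that `y ↦ Ly` commutes with
the shifts (`ht`), transports `Q_{k+1} = QQ_k` (`hQn`) and that blocks have `L³` sites (`hb`, `hN`) — stays hypothesis, as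
in Parts 6–7; the multi-region (part II) version of Part 13 (layers `Φ_{j,δΩ_j}` and the source `[Δ]_{Ω₁,Ω₁ᶜ}φ_{Ω₁ᶜ}` ride as
parameters of gen 30's `J`; only the no-layer, source-`0` instance is assembled here); the torus instance of
the successor maps (`King1986.TorusBlockForm`∕`TorusBlockAveraging` by name — the carriers here are abstract finite
types); bounds of any kind (Lemmas 2.4–2.7, random walks); anything of B1–B16 (TEMPLATE.md §4.2 row «D2 §2.3 Lemmas 2.3,
2.5» ↔ B6 §A ∕ B9 Thms 3.1–3.3 ∕ B10 (52), §4.5 ↔ B11 §D (the scaling of Bałaban's variational problem is non-linear and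
gauge-covariant; grade P) — untouched).  NOT summit progress; NOT a statement about any Bałaban paper; NOT continuum; NOT
Clay.  Unit `b2b-balaban-template` gen 44 (journal CLAIM D1D2-MINIMIZER-SCALING-KERNEL).

**Version.**  v1.5 — ADDITIVE to v1.4 (p247792, commit 1d3e64c97d94; every v1.4 declaration byte-identical; no import
added): Part 14 (`kth_exponent_eq`, `blockKernel_mul_gaussianStart`, `rgStep_gaussianStart`, `freeFlow_densitySeq`) appended
after Part 13; header extended (Part 14 bullet).  v1.4 — ADDITIVE to v1.3 (p245390, commit 82a54cfa59b1; every v1.3 declaration byte-identical; no import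
added): Part 13 (`freeDensity`, `freeDensity_apply`, `freeDensity_eq_energy`, `energy_emptyLayers`, `GkO_smul_one`,
`minimizer_smul_one`, `minimizer_emptyLayers`, `blockKernel_mul_freeDensity`, `blockDensity_freeDensity`, `lemma5_rgStep`,
`lemma5_rgStep_lattice`, `lemma5_rgStep_avg`, `aNext_aK_div`, `lemma5_printed`; private `dotProduct_of_isEmpty'`,
`transpose_mulVec_of_isEmpty`, `restE_of_isEmpty`, `sqrt_pow_three`) appended after Part 12; header extended (Part 13
bullet, NOT-claimed paragraph rewritten: LEMMA `tiny` is now used by name, not assumed).  v1.3 — ADDITIVE to v1.2 (p244542, commit 8f50c87b9d93; every v1.2 declaration byte-identical; no import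
added) + DOCFIX: Part 12 (`dirichlet_negLap_add_mass_posDef`, `dirichlet_negLap_posSemidef`, `nonoCross_comm`) appended after
Part 11; the two OUTSIDE READS of v1.1 folded (cell journal l.25141, beta-lit1-g32: ok CONSISTENT 5∕5, DOCFIX 1 = the TeX
locator of `phik_scale`'s docstring «L809–811» ↦ «L800–803», INFO 4 — INFO-1 recorded as reading (vi), INFO-2 as
`nonoCross_comm` and `nonoExponent`'s docstring; l.25445, carver-g18: ok, INFO-carver-x1 = the gloss in
`reindex_mulVec_scaleField`'s docstring); four further TeX-locator slips in docstring prose corrected (`gkInv_scale`,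
`gkInv_mulVec_scaleField`, `negLap_scale`: «L816–818» ↦ «L816–819», «II L927–931» ↦ «II L923–929»; `phik_lattice`: «L812–828» ↦
«L814–828») — statements and proofs of every v1.2 declaration unchanged.  v1.2 — ADDITIVE to v1.1 (p244379, commit 25dd0460b19f; every v1.1 declaration byte-identical; ONE import
added: gen 43's `RGStepNormalization` — no cycle, it imports `LocalizedStepAssembly` and `GaussianSingleStep` only): Part 11
(`frame_smul_scaleField`, `lemma5_scaledDensity`, `lemma5_scaledDensity_Z`, `lemma5_scaledDensity_partI`) appended after
Part 10; header extended (Part 11 bullet, NOT-claimed paragraph rewritten for LEMMA 5's first claim).  v1.1 — ADDITIVE to v1 (p244245, 2026-08-21, commit 3ae6021d35e0; every v1 declaration byte-identical; no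
import added): Part 9 «the same index set» (`scaleField_refl`, `negLap_scale_self`, `negLap_add_mass_scale_self`, `Gk_self`,
`phik_self`, `lumpy_self`) and Part 10 «the other terms in the exponent scale similarly» (`nonoExponent`,
`nonoExponent_scale`, `nonoExponent_scale_eq`, `nonoExponent_minimizer_scale_eq`), appended after Part 8; header extended
accordingly.  v1 — Parts 1–8.
-/

namespace Literature.MathematicalPhysics.QuantumFieldTheory.Dimock2011to13.MinimizerScaling

open Matrix
open scoped Matrix
open Literature.MathematicalPhysics.QuantumFieldTheory.Dimock2011to13.FluctuationCovarianceIdentity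
open Literature.MathematicalPhysics.QuantumFieldTheory.Dimock2011to13.MultiRegionFreeFlow
open Literature.MathematicalPhysics.QuantumFieldTheory.Dimock2011to13.FreeFlowSingleStep
open Literature.MathematicalPhysics.QuantumFieldTheory.Dimock2011to13.LocalizedStepAssembly

/-! ## Part 1 — Scaling as a change of frame on the matrix carrier -/

section Frame

variable {S₀ S₁ S₀' S₁' : Type*}

/-- `φ_c = c·(φ ∘ σ⁻¹)` for gen 42's `scaleField c σ` (*"f_L(x) = L^{−1/2}f(x/L)"*). [cite: Dimock2013, Lemma 5 (scaling) proof (arXiv:1108.1335v2 TeX L814)] -/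
theorem scaleField_eq_smul_comp (c : ℝ) (σ : S₁ ≃ S₀) (φ : S₁ → ℝ) :
    scaleField c σ φ = c • (φ ∘ σ.symm) := by
  funext x; simp [scaleField]

/-- scaling is additive. [cite: Dimock2013, Lemma 5 (scaling) proof (arXiv:1108.1335v2 TeX L814)] -/
theorem scaleField_add (c : ℝ) (σ : S₁ ≃ S₀) (φ ψ : S₁ → ℝ) :
    scaleField c σ (φ + ψ) = scaleField c σ φ + scaleField c σ ψ := by
  funext x; simp [scaleField, mul_add]

/-- scaling is subtractive. [cite: Dimock2013, Lemma 5 (scaling) proof (arXiv:1108.1335v2 TeX L814)] -/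
theorem scaleField_sub' (c : ℝ) (σ : S₁ ≃ S₀) (φ ψ : S₁ → ℝ) :
    scaleField c σ (φ - ψ) = scaleField c σ φ - scaleField c σ ψ := by
  funext x; simp [scaleField, mul_sub]

/-- `(−φ)_c = −φ_c`. [cite: Dimock2013, Lemma 5 (scaling) proof (arXiv:1108.1335v2 TeX L814)] -/
theorem scaleField_neg (c : ℝ) (σ : S₁ ≃ S₀) (φ : S₁ → ℝ) :
    scaleField c σ (-φ) = -scaleField c σ φ := by
  funext x; simp [scaleField]

/-- `s·φ_c = φ_{sc}`. [cite: Dimock2013, Lemma 5 (scaling) proof (arXiv:1108.1335v2 TeX L814)] -/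
theorem smul_scaleField (s c : ℝ) (σ : S₁ ≃ S₀) (φ : S₁ → ℝ) :
    s • scaleField c σ φ = scaleField (s * c) σ φ := by
  funext x; simp [scaleField, mul_assoc]

/-- `(s·φ)_c = s·φ_c`. [cite: Dimock2013, Lemma 5 (scaling) proof (arXiv:1108.1335v2 TeX L814)] -/
theorem scaleField_smul (s c : ℝ) (σ : S₁ ≃ S₀) (φ : S₁ → ℝ) :
    scaleField c σ (s • φ) = s • scaleField c σ φ := by
  funext x; simp [scaleField]; ring

/-- `0_c = 0`. [cite: Dimock2013, Lemma 5 (scaling) proof (arXiv:1108.1335v2 TeX L814)] -/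
@[simp] theorem scaleField_zero (c : ℝ) (σ : S₁ ≃ S₀) : scaleField c σ (0 : S₁ → ℝ) = 0 := by
  funext x; simp [scaleField]

/-- composing two scalings is one scaling (`(φ_{c'})_c = φ_{cc'}` along the composed relabelling — *"φ_{L^k}"*). [cite: Dimock2013, Lemma 5 (scaling) proof (arXiv:1108.1335v2 TeX L814)] -/
theorem scaleField_scaleField {S₂ : Type*} (c c' : ℝ) (σ : S₁ ≃ S₀) (σ' : S₂ ≃ S₁) (φ : S₂ → ℝ) :
    scaleField c σ (scaleField c' σ' φ) = scaleField (c * c') (σ'.trans σ) φ := by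
  funext x; simp [scaleField, mul_assoc]

/-- scaling is injective in the field for `c ≠ 0`. [cite: Dimock2013, Lemma 5 (scaling) proof (arXiv:1108.1335v2 TeX L814)] -/
theorem scaleField_injective {c : ℝ} (hc : c ≠ 0) (σ : S₁ ≃ S₀) :
    Function.Injective (scaleField c σ : (S₁ → ℝ) → (S₀ → ℝ)) := by
  intro φ ψ h
  funext y
  have := congrFun h (σ y)
  simp only [scaleField_apply] at this
  exact mul_left_cancel₀ hc this

variable [Fintype S₀] [Fintype S₁]

/-- **A transported matrix acts on scaled fields by scaling its action**: `M^{σ'σ} φ_c = (Mφ)_c` — the algebraic content of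
*"Q is scale invariant: Qφ_L = (Qφ)_L"*.  (v1.3, an outside reader's gloss, cell journal l.25445: the identity holds for EVERY
matrix `M`; what singles `Q` out in Part 2 is the POWER OF `s` with which each datum enters the scaled problem — `Q` as the bare
transport `Q^{τσ}` (power `s⁰`: one formula `L⁻³Σ_{x∈B(y)}` at every level), `−Δ + μ̄` and `𝐚` as `s·(·)^σ` (power `s¹`, `s =
L⁻²`).) [cite: Dimock2013, §2.1 (arXiv:1108.1335v2 TeX L318–320, L411) and Lemma 5 (scaling) proof (TeX L814); Dimock2013BalabanII, §2.3 (arXiv:1212.5562v2 TeX L920–922)] -/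
theorem reindex_mulVec_scaleField (M : Matrix S₁' S₁ ℝ) (σ' : S₁' ≃ S₀') (σ : S₁ ≃ S₀) (c : ℝ) (φ : S₁ → ℝ) :
    Matrix.reindex σ' σ M *ᵥ scaleField c σ φ = scaleField c σ' (M *ᵥ φ) := by
  rw [Matrix.reindex_apply, scaleField_eq_smul_comp, scaleField_eq_smul_comp, mulVec_smul,
    Matrix.submatrix_mulVec_equiv]
  have h : (φ ∘ ⇑σ.symm) ∘ ⇑σ.symm.symm = φ := by
    funext y; simp
  rw [h]

/-- dot products of scaled fields: `φ_c · ψ_{c'} = cc'·(φ · ψ)` (the frame factor of reading (ii)). [cite: Dimock2013, Lemma 5 (scaling) proof (arXiv:1108.1335v2 TeX L814)] -/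
theorem scaleField_dotProduct (c c' : ℝ) (σ : S₁ ≃ S₀) (φ ψ : S₁ → ℝ) :
    scaleField c σ φ ⬝ᵥ scaleField c' σ ψ = (c * c') * (φ ⬝ᵥ ψ) := by
  simp only [dotProduct, scaleField_eq_smul_comp, Pi.smul_apply, Function.comp_apply, smul_eq_mul]
  rw [Finset.mul_sum, ← Equiv.sum_comp σ]
  refine Finset.sum_congr rfl fun y _ => ?_
  simp only [Equiv.symm_apply_apply]
  ring

end Frame

/-! ## Part 2 — The operator scaling on the carrier of `MultiRegionFreeFlow` -/

section Operators

variable {κ₀ κ₁ m₀ m₁ : Type*}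
variable (σ : κ₁ ≃ κ₀) (τ : m₁ ≃ m₀)

/-- transposes commute with transport. [folklore] -/
private theorem transpose_reindex' (M : Matrix m₁ κ₁ ℝ) : (Matrix.reindex τ σ M)ᵀ = Matrix.reindex σ τ Mᵀ := by
  rfl

/-- products commute with transport. [folklore] -/
private theorem reindex_mul_reindex {n₀ n₁ : Type*} [Fintype n₁] [Fintype n₀] (ρ : n₁ ≃ n₀)
    (M : Matrix m₁ n₁ ℝ) (N : Matrix n₁ κ₁ ℝ) :
    Matrix.reindex τ ρ M * Matrix.reindex ρ σ N = Matrix.reindex τ σ (M * N) := by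
  simp only [Matrix.reindex_apply]
  exact Matrix.submatrix_mul_equiv M N τ.symm ρ.symm σ.symm

/-- sums commute with transport. [folklore] -/
private theorem reindex_finset_sum {β : Type*} (s : Finset β) (M : β → Matrix m₁ κ₁ ℝ) :
    Matrix.reindex τ σ (∑ b ∈ s, M b) = ∑ b ∈ s, Matrix.reindex τ σ (M b) := by
  ext i j
  simp [Matrix.reindex_apply, Matrix.sum_apply]

/-- scalars commute with transport. [folklore] -/
private theorem reindex_smul' (r : ℝ) (M : Matrix m₁ κ₁ ℝ) : Matrix.reindex τ σ (r • M) = r • Matrix.reindex τ σ M := by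
  rfl

/-- differences commute with transport. [folklore] -/
private theorem reindex_sub' (M N : Matrix m₁ κ₁ ℝ) :
    Matrix.reindex τ σ (M - N) = Matrix.reindex τ σ M - Matrix.reindex τ σ N := by
  rfl

/-- over a field, `(s·M)⁻¹ = s⁻¹·M⁻¹` for `s ≠ 0`, whether or not `M` is invertible. [folklore] -/
private theorem inv_smul_of_ne_zero {n : Type*} [Fintype n] [DecidableEq n] {s : ℝ} (hs : s ≠ 0) (M : Matrix n n ℝ) :
    (s • M)⁻¹ = s⁻¹ • M⁻¹ := by
  by_cases hM : IsUnit M.det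
  · refine Matrix.inv_eq_left_inv ?_
    rw [Matrix.smul_mul, Matrix.mul_smul, Matrix.nonsing_inv_mul M hM, smul_smul, inv_mul_cancel₀ hs, one_smul]
  · have h' : ¬IsUnit (s • M).det := by
      rw [det_smul, isUnit_iff_ne_zero, mul_ne_zero_iff, not_and_or]
      right
      rwa [isUnit_iff_ne_zero] at hM
    rw [nonsing_inv_apply_not_isUnit _ hM, nonsing_inv_apply_not_isUnit _ h', smul_zero]

variable [Fintype m₀] [Fintype m₁]

/-- **THE BRACKET SCALES**: `[D + QᵀaQ]` with `D ↦ s·D^σ`, `a ↦ s·a^τ`, `Q ↦ Q^{τσ}` is `s·[D + QᵀaQ]^σ` — *"Since μ̄_k =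
L^{−2}μ̄_{k+1} and a^{(k)}_j = L^{−2}a^{(k+1)}_j and Q_j is scale invariant we have (−Δ + μ̄_k + L^{−2}Qᵀ𝐚^{(k+1)}Q)f_L =
L^{−2}((−Δ + μ̄_{k+1} + Qᵀ𝐚^{(k+1)}Q)f)_L"* as a matrix identity. [cite: Dimock2013, Lemma 5 (scaling) proof (arXiv:1108.1335v2 TeX L816–819); Dimock2013BalabanII, §2.3 (arXiv:1212.5562v2 TeX L923–929)] -/
theorem gInvO_scale (D : Matrix κ₁ κ₁ ℝ) (a : Matrix m₁ m₁ ℝ) (Qm : Matrix m₁ κ₁ ℝ) (s : ℝ) :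
    gInvO (s • Matrix.reindex σ σ D) (s • Matrix.reindex τ τ a) (Matrix.reindex τ σ Qm)
      = s • Matrix.reindex σ σ (gInvO D a Qm) := by
  unfold gInvO
  simp only [Matrix.reindex_apply, Matrix.transpose_submatrix, Matrix.mul_smul, Matrix.smul_mul,
    Matrix.submatrix_mul_equiv, Matrix.submatrix_add, Pi.add_apply, smul_add]

variable [Fintype κ₀] [Fintype κ₁]

/-- **THE PRINTED OPERATOR IDENTITY ON FIELDS** — *"(−Δ + μ̄_k + L⁻²Qᵀ_{k+1,𝛀⁺}𝐚^{(k+1)}Q_{k+1,𝛀⁺})f_L = L⁻²((−Δ + μ̄_{k+1} +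
Qᵀ_{k+1,𝛀⁺}𝐚^{(k+1)}Q_{k+1,𝛀⁺})f)_L"* (II L923–929; I L816–819): with `D ↦ s·D^σ`, `𝐚 ↦ s·𝐚^τ`, `Q ↦ Q^{τσ}`, the bracket applied
to a scaled field is `s` times the scaled image of the bracket applied to the field. [cite: Dimock2013BalabanII, §2.3
(arXiv:1212.5562v2 TeX L923–929); Dimock2013, Lemma 5 (scaling) proof (arXiv:1108.1335v2 TeX L816–819)] -/
theorem gInvO_mulVec_scaleField (D : Matrix κ₁ κ₁ ℝ) (a : Matrix m₁ m₁ ℝ) (Qm : Matrix m₁ κ₁ ℝ) (s c : ℝ)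
    (f : κ₁ → ℝ) :
    gInvO (s • Matrix.reindex σ σ D) (s • Matrix.reindex τ τ a) (Matrix.reindex τ σ Qm) *ᵥ scaleField c σ f
      = s • scaleField c σ (gInvO D a Qm *ᵥ f) := by
  rw [gInvO_scale, Matrix.smul_mulVec, reindex_mulVec_scaleField]

variable [DecidableEq κ₀] [DecidableEq κ₁]

omit [Fintype m₀] [Fintype m₁] in
/-- inverses commute with transport. [folklore] -/
private theorem inv_reindex (M : Matrix κ₁ κ₁ ℝ) : (Matrix.reindex σ σ M)⁻¹ = Matrix.reindex σ σ M⁻¹ := by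
  simp only [Matrix.reindex_apply]
  exact Matrix.inv_submatrix_equiv M σ.symm σ.symm

/-- **THE GREEN'S FUNCTION SCALES**: `G⁰ f_L = L²[G f]_L` as the matrix identity
`(s·[D + QᵀaQ]^σ)⁻¹ = s⁻¹·([D + QᵀaQ]⁻¹)^σ`.
[cite: Dimock2013, Lemma 5 (scaling) proof (arXiv:1108.1335v2 TeX L820); Dimock2013BalabanII, §2.3 (arXiv:1212.5562v2 TeX L930–933)] -/
theorem GkO_scale (D : Matrix κ₁ κ₁ ℝ) (a : Matrix m₁ m₁ ℝ) (Qm : Matrix m₁ κ₁ ℝ) {s : ℝ} (hs : s ≠ 0) :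
    GkO (s • Matrix.reindex σ σ D) (s • Matrix.reindex τ τ a) (Matrix.reindex τ σ Qm)
      = s⁻¹ • Matrix.reindex σ σ (GkO D a Qm) := by
  unfold GkO
  rw [gInvO_scale, inv_smul_of_ne_zero hs, inv_reindex]

/-- **`G⁰f_L = L²[Gf]_L`** on fields: `G(scaled)f_c = s⁻¹·[Gf]_c`. [cite: Dimock2013, Lemma 5 (scaling) proof (arXiv:1108.1335v2 TeX L820); Dimock2013BalabanII, §2.3 (arXiv:1212.5562v2 TeX L930–933)] -/
theorem GkO_mulVec_scaleField (D : Matrix κ₁ κ₁ ℝ) (a : Matrix m₁ m₁ ℝ) (Qm : Matrix m₁ κ₁ ℝ) {s : ℝ}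
    (hs : s ≠ 0) (c : ℝ) (f : κ₁ → ℝ) :
    GkO (s • Matrix.reindex σ σ D) (s • Matrix.reindex τ τ a) (Matrix.reindex τ σ Qm) *ᵥ scaleField c σ f
      = s⁻¹ • scaleField c σ (GkO D a Qm *ᵥ f) := by
  rw [GkO_scale σ τ D a Qm hs, Matrix.smul_mulVec, reindex_mulVec_scaleField]

/-- **(lumpy) — THE MINIMIZER IS SCALE COVARIANT**: with the operator data scaled as above and the source scaled
with the extra factor `s` (it is `[Δ]_{Ω₁,Ω₁ᶜ}φ_{Ω₁ᶜ}`, and `Δ` scales with `s = L⁻²`), the minimizer of the scaled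
problem at the scaled block field is the scaled minimizer: `φ⁰(Φ_c, src_{sc}) = [φ(Φ, src)]_c`.
[cite: Dimock2013BalabanII, §2.3 eq. (lumpy) (arXiv:1212.5562v2 TeX L930–938); Dimock2013, Lemma 5 (scaling) (arXiv:1108.1335v2 TeX L800–803, L820–828)] -/
theorem minimizer_scale (D : Matrix κ₁ κ₁ ℝ) (a : Matrix m₁ m₁ ℝ) (Qm : Matrix m₁ κ₁ ℝ) {s : ℝ} (hs : s ≠ 0)
    (c : ℝ) (Φ : m₁ → ℝ) (src : κ₁ → ℝ) :
    minimizer (s • Matrix.reindex σ σ D) (s • Matrix.reindex τ τ a) (Matrix.reindex τ σ Qm)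
        (scaleField c τ Φ) (scaleField (s * c) σ src)
      = scaleField c σ (minimizer D a Qm Φ src) := by
  unfold minimizer
  have h1 : (s • Matrix.reindex τ τ a) *ᵥ scaleField c τ Φ = scaleField (s * c) τ (a *ᵥ Φ) := by
    rw [Matrix.smul_mulVec, reindex_mulVec_scaleField, smul_scaleField]
  rw [GkO_scale σ τ D a Qm hs, transpose_reindex', h1, reindex_mulVec_scaleField, ← scaleField_add,
    Matrix.smul_mulVec, reindex_mulVec_scaleField, smul_scaleField, inv_mul_cancel_left₀ hs]

/-- **`Δ_{k,𝛀}` SCALES LIKE THE WEIGHTS**: `Δ_{k,𝛀}(scaled) = s·Δ_{k,𝛀}^τ` (LEMMA 2.2 (rain)'s operator under the scaling of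
§2.3). [cite: Dimock2013BalabanII, Lemma 2.2 (rain) (arXiv:1212.5562v2 TeX L672–681) and §2.3 (TeX L920–943)] -/
theorem DeltakO_scale (D : Matrix κ₁ κ₁ ℝ) (a : Matrix m₁ m₁ ℝ) (Qm : Matrix m₁ κ₁ ℝ) {s : ℝ} (hs : s ≠ 0) :
    DeltakO (s • Matrix.reindex σ σ D) (s • Matrix.reindex τ τ a) (Matrix.reindex τ σ Qm)
      = s • Matrix.reindex τ τ (DeltakO D a Qm) := by
  unfold DeltakO
  rw [GkO_scale σ τ D a Qm hs]
  simp only [Matrix.reindex_apply, Matrix.transpose_submatrix, Matrix.mul_smul, Matrix.smul_mul,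
    Matrix.submatrix_mul_equiv, Matrix.submatrix_sub, Pi.sub_apply, smul_sub, smul_smul, inv_mul_cancel₀ hs,
    mul_one]

end Operators

/-! ## Part 3 — (oooo): the action and the exponent are scale INVARIANT (`s·c² = 1`) -/

section Action

variable {κ₀ κ₁ m₀ m₁ : Type*} [Fintype κ₀] [Fintype κ₁] [Fintype m₀] [Fintype m₁]
variable (σ : κ₁ ≃ κ₀) (τ : m₁ ≃ m₀)

/-- **A transported bilinear form on scaled fields**: `ψ_c · (s·M^{ρσ}) φ_c = s·c²·(ψ · Mφ)` — the scaling of every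
quadratic∕bilinear term of the exponent (*"The other terms in the exponent in (cloudy3) scale similarly"*).
[cite: Dimock2013BalabanII, §2.3 eq. (oooo) and L944–951 (arXiv:1212.5562v2 TeX L940–951); Dimock2013, Lemma 5 (scaling) eq. (71) (arXiv:1108.1335v2 TeX L831–842)] -/
theorem bilinear_scale {n₀ n₁ : Type*} [Fintype n₀] [Fintype n₁] (ρ : n₁ ≃ n₀) (M : Matrix n₁ κ₁ ℝ) (s c : ℝ)
    (ψ : n₁ → ℝ) (φ : κ₁ → ℝ) :
    scaleField c ρ ψ ⬝ᵥ ((s • Matrix.reindex ρ σ M) *ᵥ scaleField c σ φ) = (s * c ^ 2) * (ψ ⬝ᵥ (M *ᵥ φ)) := by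
  rw [Matrix.smul_mulVec, reindex_mulVec_scaleField, smul_scaleField, scaleField_dotProduct]
  ring

/-- **THE ACTION SCALES BY `s·c²`**: `S(scaled data; Φ_c, φ_c) = s·c²·S(data; Φ, φ)` for `MultiRegionFreeFlow.action` =
`S_k(Ω₁, Φ, φ) = ½‖𝐚^{1/2}(Φ − Qφ)‖² + ½⟨φ, [−Δ + μ̄_k]φ⟩`. [cite: Dimock2013BalabanII, §2.3 eq. (oooo) and L944–951 (arXiv:1212.5562v2 TeX L940–951); Dimock2013, Lemma 5 (scaling) eq. (71) (arXiv:1108.1335v2 TeX L831–842)] -/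
theorem action_scale (D : Matrix κ₁ κ₁ ℝ) (a : Matrix m₁ m₁ ℝ) (Qm : Matrix m₁ κ₁ ℝ) (s c : ℝ)
    (Φ : m₁ → ℝ) (φ : κ₁ → ℝ) :
    action (s • Matrix.reindex σ σ D) (s • Matrix.reindex τ τ a) (Matrix.reindex τ σ Qm)
        (scaleField c τ Φ) (scaleField c σ φ)
      = (s * c ^ 2) * action D a Qm Φ φ := by
  unfold action
  rw [reindex_mulVec_scaleField, ← scaleField_sub', Matrix.smul_mulVec, reindex_mulVec_scaleField,
    smul_scaleField, scaleField_dotProduct, Matrix.smul_mulVec, reindex_mulVec_scaleField, smul_scaleField,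
    scaleField_dotProduct]
  ring

/-- **(oooo)** `S⁰_{k+1}(LΩ₁, [Φ]_L, [φ]_L) = S_{k+1}(Ω₁, Φ, φ)`: with `s·c² = 1` (print: `s = L⁻²` on the operators and
weights, `c² = L²` the field scaling of the unweighted frame) the action is INVARIANT.
[cite: Dimock2013BalabanII, §2.3 eq. (oooo) and L944–951 (arXiv:1212.5562v2 TeX L940–951); Dimock2013, Lemma 5 (scaling) eq. (71) (arXiv:1108.1335v2 TeX L831–842)] -/
theorem action_scale_eq (D : Matrix κ₁ κ₁ ℝ) (a : Matrix m₁ m₁ ℝ) (Qm : Matrix m₁ κ₁ ℝ) {s c : ℝ}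
    (hsc : s * c ^ 2 = 1) (Φ : m₁ → ℝ) (φ : κ₁ → ℝ) :
    action (s • Matrix.reindex σ σ D) (s • Matrix.reindex τ τ a) (Matrix.reindex τ σ Qm)
        (scaleField c τ Φ) (scaleField c σ φ)
      = action D a Qm Φ φ := by
  rw [action_scale, hsc, one_mul]

/-- **THE EXPONENT WITH ITS BOUNDARY SOURCE SCALES BY `s·c²`**: `E(scaled; Φ_c, src_{sc}, φ_c) = s·c²·E(Φ, src, φ)`.
[cite: Dimock2013BalabanII, §2.3 eq. (oooo) and L944–951 (arXiv:1212.5562v2 TeX L940–951); Dimock2013, Lemma 5 (scaling) eq. (71) (arXiv:1108.1335v2 TeX L831–842)] -/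
theorem energy_scale (D : Matrix κ₁ κ₁ ℝ) (a : Matrix m₁ m₁ ℝ) (Qm : Matrix m₁ κ₁ ℝ) (s c : ℝ)
    (Φ : m₁ → ℝ) (src φ : κ₁ → ℝ) :
    energy (s • Matrix.reindex σ σ D) (s • Matrix.reindex τ τ a) (Matrix.reindex τ σ Qm)
        (scaleField c τ Φ) (scaleField (s * c) σ src) (scaleField c σ φ)
      = (s * c ^ 2) * energy D a Qm Φ src φ := by
  unfold energy
  rw [action_scale, scaleField_dotProduct]
  ring

/-- … hence INVARIANT for `s·c² = 1`. [cite: Dimock2013BalabanII, §2.3 eq. (oooo) and L944–951 (arXiv:1212.5562v2 TeX L940–951); Dimock2013, Lemma 5 (scaling) eq. (71) (arXiv:1108.1335v2 TeX L831–842)] -/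
theorem energy_scale_eq (D : Matrix κ₁ κ₁ ℝ) (a : Matrix m₁ m₁ ℝ) (Qm : Matrix m₁ κ₁ ℝ) {s c : ℝ}
    (hsc : s * c ^ 2 = 1) (Φ : m₁ → ℝ) (src φ : κ₁ → ℝ) :
    energy (s • Matrix.reindex σ σ D) (s • Matrix.reindex τ τ a) (Matrix.reindex τ σ Qm)
        (scaleField c τ Φ) (scaleField (s * c) σ src) (scaleField c σ φ)
      = energy D a Qm Φ src φ := by
  rw [energy_scale, hsc, one_mul]

variable [DecidableEq κ₀] [DecidableEq κ₁]

/-- **THE MINIMUM VALUE IS INVARIANT**: the exponent of the scaled problem at ITS minimizer equals the exponent of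
the original problem at its minimizer (`s·c² = 1`, `s ≠ 0`) — (lumpy) inside (oooo).
[cite: Dimock2013BalabanII, §2.3 eq. (oooo) and L944–951 (arXiv:1212.5562v2 TeX L940–951); Dimock2013, Lemma 5 (scaling) eq. (71) (arXiv:1108.1335v2 TeX L831–842)]  -/
theorem energy_minimizer_scale_eq (D : Matrix κ₁ κ₁ ℝ) (a : Matrix m₁ m₁ ℝ) (Qm : Matrix m₁ κ₁ ℝ) {s c : ℝ}
    (hs : s ≠ 0) (hsc : s * c ^ 2 = 1) (Φ : m₁ → ℝ) (src : κ₁ → ℝ) :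
    energy (s • Matrix.reindex σ σ D) (s • Matrix.reindex τ τ a) (Matrix.reindex τ σ Qm)
        (scaleField c τ Φ) (scaleField (s * c) σ src)
        (minimizer (s • Matrix.reindex σ σ D) (s • Matrix.reindex τ τ a) (Matrix.reindex τ σ Qm)
          (scaleField c τ Φ) (scaleField (s * c) σ src))
      = energy D a Qm Φ src (minimizer D a Qm Φ src) := by
  rw [minimizer_scale σ τ D a Qm hs, energy_scale_eq σ τ D a Qm hsc]

/-- **`⟨Φ_c, Δ⁰Φ_c⟩ = s·c²·⟨Φ, ΔΦ⟩`** for the Schur complement `Δ_{k,Ω}` (LEMMA 2.2 (rain)'s first term), hence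
invariant for `s·c² = 1`.
[cite: Dimock2013BalabanII, Lemma 2.2 (rain) (arXiv:1212.5562v2 TeX L672–681) and §2.3 (TeX L940–943)] -/
theorem dot_DeltakO_scale (D : Matrix κ₁ κ₁ ℝ) (a : Matrix m₁ m₁ ℝ) (Qm : Matrix m₁ κ₁ ℝ) {s : ℝ} (hs : s ≠ 0)
    (c : ℝ) (Φ : m₁ → ℝ) :
    scaleField c τ Φ ⬝ᵥ (DeltakO (s • Matrix.reindex σ σ D) (s • Matrix.reindex τ τ a) (Matrix.reindex τ σ Qm)
        *ᵥ scaleField c τ Φ)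
      = (s * c ^ 2) * (Φ ⬝ᵥ (DeltakO D a Qm *ᵥ Φ)) := by
  rw [DeltakO_scale σ τ D a Qm hs, bilinear_scale]

end Action

/-! ## Part 4 — Part I's single-region objects: `G_k`, `φ_k = a_kG_kQ_kᵀΦ_k`, `Δ_k`; LEMMA 5 (scaling) part 2 -/

section PartOne

variable {κ₀ κ₁ ι₀ ι₁ : Type*} [Fintype ι₀] [Fintype ι₁]
variable (σ : κ₁ ≃ κ₀) (τ : ι₁ ≃ ι₀)

/-- the bracket of `G_k` scales: `(s·D^σ) + (s·a_k)(Q_k^{τσ})ᵀQ_k^{τσ} = s·(D + a_kQ_kᵀQ_k)^σ` — I L816–819 *"(−Δ + μ̄_k +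
a_{k+1}L⁻²Qᵀ_{k+1}Q_{k+1}) f_L = L⁻²[(−Δ + μ̄_{k+1} + a_{k+1}Qᵀ_{k+1}Q_{k+1}) f]_L"* as a matrix identity.
[cite: Dimock2013, Lemma 5 (scaling) proof (arXiv:1108.1335v2 TeX L816–819); Dimock2013BalabanII, §2.3 (arXiv:1212.5562v2 TeX L923–929)] -/
theorem gkInv_scale (D : Matrix κ₁ κ₁ ℝ) (Qk : Matrix ι₁ κ₁ ℝ) (ak s : ℝ) :
    s • Matrix.reindex σ σ D + (s * ak) • ((Matrix.reindex τ σ Qk)ᵀ * Matrix.reindex τ σ Qk)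
      = s • Matrix.reindex σ σ (D + ak • (Qkᵀ * Qk)) := by
  simp only [Matrix.reindex_apply, Matrix.transpose_submatrix, Matrix.submatrix_mul_equiv, Matrix.submatrix_add,
    Matrix.submatrix_smul, Pi.add_apply, Pi.smul_apply, smul_add, smul_smul]

variable [Fintype κ₀] [Fintype κ₁]

/-- the bracket acting on a scaled field (I L816–819 on fields): `(s·D^σ + s·a_kQ̂ᵀQ̂) f_c = s·[(D + a_kQ_kᵀQ_k) f]_c`.
[cite: Dimock2013, Lemma 5 (scaling) proof (arXiv:1108.1335v2 TeX L816–819); Dimock2013BalabanII, §2.3 (arXiv:1212.5562v2 TeX L923–929)] -/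
theorem gkInv_mulVec_scaleField (D : Matrix κ₁ κ₁ ℝ) (Qk : Matrix ι₁ κ₁ ℝ) (ak s c : ℝ) (f : κ₁ → ℝ) :
    (s • Matrix.reindex σ σ D + (s * ak) • ((Matrix.reindex τ σ Qk)ᵀ * Matrix.reindex τ σ Qk)) *ᵥ scaleField c σ f
      = s • scaleField c σ ((D + ak • (Qkᵀ * Qk)) *ᵥ f) := by
  rw [gkInv_scale, Matrix.smul_mulVec, reindex_mulVec_scaleField]

variable [DecidableEq κ₀] [DecidableEq κ₁]

/-- **`G⁰_{k+1} = L²·G_{k+1}^σ`** (I L820 *"It follows that the inverses satisfy G⁰_{k+1}f_L = L²[G_{k+1}f]_L"*):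
`G_k(s·D^σ, Q_k^{τσ}, s·a_k) = s⁻¹·G_k(D, Q_k, a_k)^σ`.
[cite: Dimock2013, Lemma 5 (scaling) proof (arXiv:1108.1335v2 TeX L820); Dimock2013BalabanII, §2.3 (arXiv:1212.5562v2 TeX L930–933)] -/
theorem Gk_scale (D : Matrix κ₁ κ₁ ℝ) (Qk : Matrix ι₁ κ₁ ℝ) (ak : ℝ) {s : ℝ} (hs : s ≠ 0) :
    Gk (s • Matrix.reindex σ σ D) (Matrix.reindex τ σ Qk) (s * ak) = s⁻¹ • Matrix.reindex σ σ (Gk D Qk ak) := by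
  unfold Gk
  rw [gkInv_scale, inv_smul_of_ne_zero hs, inv_reindex]

/-- **`G⁰_{k+1}f_L = L²[G_{k+1}f]_L`** on fields (I L820).
[cite: Dimock2013, Lemma 5 (scaling) proof (arXiv:1108.1335v2 TeX L820); Dimock2013BalabanII, §2.3 (arXiv:1212.5562v2 TeX L930–933)] -/
theorem Gk_mulVec_scaleField (D : Matrix κ₁ κ₁ ℝ) (Qk : Matrix ι₁ κ₁ ℝ) (ak : ℝ) {s : ℝ} (hs : s ≠ 0) (c : ℝ)
    (f : κ₁ → ℝ) :
    Gk (s • Matrix.reindex σ σ D) (Matrix.reindex τ σ Qk) (s * ak) *ᵥ scaleField c σ f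
      = s⁻¹ • scaleField c σ (Gk D Qk ak *ᵥ f) := by
  rw [Gk_scale σ τ D Qk ak hs, Matrix.smul_mulVec, reindex_mulVec_scaleField]

/-- **LEMMA 5 (scaling), second claim — `φ⁰_{k+1}(Φ_{k+1,L}) = [φ_{k+1}(Φ_{k+1})]_L`** (I L800–803, L823–828 *"φ⁰_{k+1}(Φ_{k+1,L})
= L⁻²a_{k+1}G⁰_{k+1}Qᵀ_{k+1}Φ_{k+1,L} = [a_{k+1}G_{k+1}Qᵀ_{k+1}Φ_{k+1}]_L = [φ_{k+1}(Φ_{k+1})]_L"*): for part I's minimizer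
`φ_k(Φ_k) = a_kG_kQ_kᵀΦ_k` (L590–592), scaling the operator data by `s` and transporting `Q_k`,
`(s·a_k)·G_k(scaled)(Q_k^{τσ})ᵀΦ_c = [a_kG_kQ_kᵀΦ]_c` — every `c`, every `s ≠ 0`.
[cite: Dimock2013, Lemma 5 (scaling) (arXiv:1108.1335v2 TeX L800–803) and its proof (TeX L814–828); Dimock2013, §2.2 (TeX L598–602)] -/
theorem phik_scale (D : Matrix κ₁ κ₁ ℝ) (Qk : Matrix ι₁ κ₁ ℝ) (ak : ℝ) {s : ℝ} (hs : s ≠ 0) (c : ℝ) (Φ : ι₁ → ℝ) :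
    (s * ak) • (Gk (s • Matrix.reindex σ σ D) (Matrix.reindex τ σ Qk) (s * ak)
        *ᵥ ((Matrix.reindex τ σ Qk)ᵀ *ᵥ scaleField c τ Φ))
      = scaleField c σ (ak • (Gk D Qk ak *ᵥ (Qkᵀ *ᵥ Φ))) := by
  rw [transpose_reindex', reindex_mulVec_scaleField, Gk_mulVec_scaleField σ τ D Qk ak hs, smul_smul,
    show s * ak * s⁻¹ = ak by field_simp, ← scaleField_smul]

/-- **`Δ_k` SCALES LIKE `a_k`**: `Δ_k(s·D^σ, Q_k^{τσ}, s·a_k) = s·Δ_k(D, Q_k, a_k)^τ` — so `½⟨Φ_{k,L}, Δ⁰Φ_{k,L}⟩ = ½⟨Φ_k, Δ_kΦ_k⟩`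
for `s·c² = 1` ((spiffy) under LEMMA 5's scaling).
[cite: Dimock2013, §2.2 (spiffy) (arXiv:1108.1335v2 TeX L623–636) and Lemma 5 (scaling) (TeX L797–848)] -/
theorem Deltak_scale [DecidableEq ι₀] [DecidableEq ι₁] (D : Matrix κ₁ κ₁ ℝ) (Qk : Matrix ι₁ κ₁ ℝ) (ak : ℝ) {s : ℝ}
    (hs : s ≠ 0) :
    Deltak (s • Matrix.reindex σ σ D) (Matrix.reindex τ σ Qk) (s * ak) = s • Matrix.reindex τ τ (Deltak D Qk ak) := by
  unfold Deltak
  rw [Gk_scale σ τ D Qk ak hs]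
  simp only [Matrix.reindex_apply, Matrix.transpose_submatrix, Matrix.mul_smul, Matrix.smul_mul,
    Matrix.submatrix_mul_equiv, Matrix.submatrix_sub, Matrix.submatrix_smul, Matrix.submatrix_one_equiv,
    Pi.sub_apply, Pi.smul_apply, smul_sub, smul_smul]
  congr 1
  rw [mul_pow, show s ^ 2 * ak ^ 2 * s⁻¹ = s * ak ^ 2 by field_simp]

/-- `⟨Φ_c, Δ_k(scaled)Φ_c⟩ = s·c²·⟨Φ, Δ_kΦ⟩`. [cite: Dimock2013, §2.2 (spiffy) (arXiv:1108.1335v2 TeX L623–636) and Lemma 5 (scaling) (TeX L797–848)] -/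
theorem dot_Deltak_scale [DecidableEq ι₀] [DecidableEq ι₁] (D : Matrix κ₁ κ₁ ℝ) (Qk : Matrix ι₁ κ₁ ℝ) (ak : ℝ)
    {s : ℝ} (hs : s ≠ 0) (c : ℝ) (Φ : ι₁ → ℝ) :
    scaleField c τ Φ ⬝ᵥ (Deltak (s • Matrix.reindex σ σ D) (Matrix.reindex τ σ Qk) (s * ak) *ᵥ scaleField c τ Φ)
      = (s * c ^ 2) * (Φ ⬝ᵥ (Deltak D Qk ak *ᵥ Φ)) := by
  rw [Deltak_scale σ τ D Qk ak hs, bilinear_scale]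

end PartOne

/-! ## Part 5 — (lumpy) and (oooo) AS PRINTED: part II LEMMA 2.3's `φ⁰_{k+1,𝛀⁺}` versus `φ_{k+1,𝛀⁺}` -/

section Lumpy

variable {κ₀ κ₁ ι₀ σ₀ σ₁ τ₀ τ₁ : Type*}

/-- the split weight transports blockwise: `(s·a′) ⊕ (s·𝐚_τ^ρ) = s·(a′ ⊕ 𝐚_τ)^{ν⊕ρ}` (*"a^{(k)}_j = L^{−2}a^{(k+1)}_j"*).
[cite: Dimock2013BalabanII, §2.3 (arXiv:1212.5562v2 TeX L921–922)] -/
theorem weightO_scale [Fintype σ₀] [Fintype σ₁] [Fintype τ₀] [Fintype τ₁] [DecidableEq σ₀] [DecidableEq σ₁]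
    (ν : σ₁ ≃ σ₀) (ρ : τ₁ ≃ τ₀) (a1 s : ℝ) (aτ : Matrix τ₁ τ₁ ℝ) :
    weightO (ι := σ₀) (s * a1) (s • Matrix.reindex ρ ρ aτ)
      = s • Matrix.reindex (ν.sumCongr ρ) (ν.sumCongr ρ) (weightO (ι := σ₁) a1 aτ) := by
  ext (i | i) (j | j)
  · simp only [weightO, Matrix.fromBlocks_apply₁₁, Matrix.smul_apply, Matrix.reindex_apply, Matrix.submatrix_apply,
      Equiv.sumCongr_symm, Equiv.sumCongr_apply, Sum.map_inl, Matrix.one_apply, smul_eq_mul,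
      EmbeddingLike.apply_eq_iff_eq, mul_ite, mul_one, mul_zero]
  · simp [weightO, Matrix.reindex_apply]
  · simp [weightO, Matrix.reindex_apply]
  · simp [weightO, Matrix.reindex_apply]

/-- the rows transport blockwise (*"Q_j is scale invariant"*, `Q_{k+1,𝛀⁺} = (Q_τ, Q_{k+1})`). [cite: Dimock2013BalabanII, §2.3
(arXiv:1212.5562v2 TeX L921–922)] -/
theorem rowsO_scale [Fintype κ₀] [Fintype κ₁] [Fintype σ₀] [Fintype σ₁] [Fintype τ₀] [Fintype τ₁] [DecidableEq κ₀]
    [DecidableEq κ₁] [DecidableEq σ₀] [DecidableEq σ₁] (ν : σ₁ ≃ σ₀) (ρ : τ₁ ≃ τ₀) (σ : κ₁ ≃ κ₀)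
    (Qn : Matrix σ₁ κ₁ ℝ) (Qτ : Matrix τ₁ κ₁ ℝ) :
    rowsO (Matrix.reindex ν σ Qn) (Matrix.reindex ρ σ Qτ) = Matrix.reindex (ν.sumCongr ρ) σ (rowsO Qn Qτ) := by
  ext (i | i) j <;> simp [rowsO, Matrix.reindex_apply]

/-- scaling the two components is scaling the pair (*"each field like Φ_{j,δΩ_j} by [Φ_{j,L}]_{LδΩ_j} = [Φ_{j,δΩ_j}]_L"*).
[cite: Dimock2013BalabanII, §2.3 (arXiv:1212.5562v2 TeX L920–921)] -/
theorem sumElim_scaleField (ν : σ₁ ≃ σ₀) (ρ : τ₁ ≃ τ₀) (c : ℝ) (Φ' : σ₁ → ℝ) (Φτ : τ₁ → ℝ) :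
    Sum.elim (scaleField c ν Φ') (scaleField c ρ Φτ) = scaleField c (ν.sumCongr ρ) (Sum.elim Φ' Φτ) := by
  funext i
  rcases i with i | i <;> simp [scaleField]

variable [Fintype κ₀] [Fintype κ₁] [Fintype ι₀] [Fintype σ₀] [Fintype σ₁] [Fintype τ₀] [Fintype τ₁]
  [DecidableEq κ₀] [DecidableEq κ₁] [DecidableEq σ₀] [DecidableEq σ₁]
variable (σ : κ₁ ≃ κ₀) (ν : σ₁ ≃ σ₀) (ρ : τ₁ ≃ τ₀)

/-- **(lumpy) — `φ⁰_{k+1,L𝛀⁺}([φ_{Ω₁ᶜ}]_L, [Φ_{k+1,𝛀⁺}]_L) = [φ_{k+1,𝛀⁺}(φ_{Ω₁ᶜ}, Φ_{k+1,𝛀⁺})]_L`** (II L934–937), for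
`FreeFlowSingleStep.phi0` (= (eddie) `φ⁰_{k+1,𝛀⁺} = G⁰_{k+1,𝛀⁺}(L⁻²Qᵀ_{k+1,𝛀⁺}𝐚^{(k+1)}Φ_{k+1,𝛀⁺} + [Δ]_{Ω₁,Ω₁ᶜ}φ_{Ω₁ᶜ})`
with `G⁰_{k+1,𝛀⁺} = [−Δ + μ̄_k + L⁻²Qᵀ_{k+1,𝛀⁺}𝐚^{(k+1)}Q_{k+1,𝛀⁺}]⁻¹_{Ω₁}`) against the next-level minimizer
`φ_{k+1,𝛀⁺} = G_{k+1,𝛀⁺}(Qᵀ_{k+1,𝛀⁺}𝐚^{(k+1)}Φ + [Δ]φᶜ)`, `G_{k+1,𝛀⁺} = [−Δ + μ̄_{k+1} + Qᵀ𝐚^{(k+1)}Q]⁻¹` (=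
`MultiRegionFreeFlow.minimizer` with the weight `a_{k+1} ⊕ 𝐚^{(k+1)}_τ`).  HYPOTHESES = the print's sentence *"Since μ̄_k =
L⁻²μ̄_{k+1} and a^{(k)}_j = L⁻²a^{(k+1)}_j and Q_j is scale invariant"* (L924–926): `hD` (the operator `[−Δ + μ̄_k]_{LΩ₁}` is
`s = L⁻²` times the transported `[−Δ + μ̄_{k+1}]_{Ω₁}` — DISCHARGED for the lattice operators in Part 6), `ha` (`a_{k+1}L⁻² =
aNext a_k aL`, i.e. `a′ = s·a_{k+1}`), `haτ` (`𝐚^{(k)}_τ = s·(𝐚^{(k+1)}_τ)^ρ`), `hQn`∕`hQτ` (`Q_{k+1} = QQ_k` and the layer rows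
are transported); the source scales with the extra `s` (it is `[Δ]_{Ω₁,Ω₁ᶜ}φ_{Ω₁ᶜ}`).
[cite: Dimock2013BalabanII, §2.3 eq. (lumpy) (arXiv:1212.5562v2 TeX L920–938) and Lemma 2.3 (eddie)–(eddie1) (TeX L746–756), Thm 2.1 (unknown) (TeX L603–613)] -/
theorem lumpy {s : ℝ} (hs : s ≠ 0) {D₀ : Matrix κ₀ κ₀ ℝ} {D₁ : Matrix κ₁ κ₁ ℝ}
    (hD : D₀ = s • Matrix.reindex σ σ D₁) {ak aL a1 : ℝ} (ha : aNext ak aL = s * a1)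
    {aτ₀ : Matrix τ₀ τ₀ ℝ} {aτ₁ : Matrix τ₁ τ₁ ℝ} (haτ : aτ₀ = s • Matrix.reindex ρ ρ aτ₁)
    {Qk₀ : Matrix ι₀ κ₀ ℝ} {Q₀ : Matrix σ₀ ι₀ ℝ} {Qτ₀ : Matrix τ₀ κ₀ ℝ} {Qn₁ : Matrix σ₁ κ₁ ℝ} {Qτ₁ : Matrix τ₁ κ₁ ℝ}
    (hQn : Q₀ * Qk₀ = Matrix.reindex ν σ Qn₁) (hQτ : Qτ₀ = Matrix.reindex ρ σ Qτ₁)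
    (c : ℝ) (Φ' : σ₁ → ℝ) (Φτ : τ₁ → ℝ) (src : κ₁ → ℝ) :
    phi0 D₀ ak aτ₀ Qk₀ Qτ₀ Q₀ aL (scaleField c ν Φ') (scaleField c ρ Φτ) (scaleField (s * c) σ src)
      = scaleField c σ (minimizer D₁ (weightO a1 aτ₁) (rowsO Qn₁ Qτ₁) (Sum.elim Φ' Φτ) src) := by
  unfold phi0
  rw [ha, haτ, hQn, hQτ, hD, weightO_scale ν ρ, rowsO_scale ν ρ σ, sumElim_scaleField ν ρ]
  exact minimizer_scale σ (ν.sumCongr ρ) D₁ (weightO a1 aτ₁) (rowsO Qn₁ Qτ₁) hs c (Sum.elim Φ' Φτ) src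

/-- **(oooo) — `S⁰_{k+1}(LΩ₁, [Φ_{k+1,𝛀⁺}]_L, [φ_{k+1,𝛀⁺}]_L) = S_{k+1}(Ω₁, Φ_{k+1,𝛀⁺}, φ_{k+1,𝛀⁺})`** (II L939–943) for
`FreeFlowSingleStep.energyNext` (= `E′(φ) = S⁰_{k+1}(Ω₁, Φ_{k+1,𝛀⁺}, φ) − ⟨φ, [Δ]_{Ω₁,Ω₁ᶜ}φ_{Ω₁ᶜ}⟩`, the source included:
*"The other terms in the exponent in (cloudy3) scale similarly"* L944) against the next-level exponent, under the same
hypotheses and the frame relation `s·c² = 1` — for EVERY fine field `φ`, in particular at the two minimizers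
(`lumpy`).
[cite: Dimock2013BalabanII, §2.3 eq. (oooo) and L944–951 (arXiv:1212.5562v2 TeX L940–951); Dimock2013, Lemma 5 (scaling) eq. (71) (arXiv:1108.1335v2 TeX L831–842)] -/
theorem oooo {s : ℝ} {D₀ : Matrix κ₀ κ₀ ℝ} {D₁ : Matrix κ₁ κ₁ ℝ}
    (hD : D₀ = s • Matrix.reindex σ σ D₁) {ak aL a1 : ℝ} (ha : aNext ak aL = s * a1)
    {aτ₀ : Matrix τ₀ τ₀ ℝ} {aτ₁ : Matrix τ₁ τ₁ ℝ} (haτ : aτ₀ = s • Matrix.reindex ρ ρ aτ₁)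
    {Qk₀ : Matrix ι₀ κ₀ ℝ} {Q₀ : Matrix σ₀ ι₀ ℝ} {Qτ₀ : Matrix τ₀ κ₀ ℝ} {Qn₁ : Matrix σ₁ κ₁ ℝ} {Qτ₁ : Matrix τ₁ κ₁ ℝ}
    (hQn : Q₀ * Qk₀ = Matrix.reindex ν σ Qn₁) (hQτ : Qτ₀ = Matrix.reindex ρ σ Qτ₁)
    {c : ℝ} (hsc : s * c ^ 2 = 1) (Φ' : σ₁ → ℝ) (Φτ : τ₁ → ℝ) (src φ : κ₁ → ℝ) :
    energyNext D₀ ak aτ₀ Qk₀ Qτ₀ Q₀ aL (scaleField c ν Φ') (scaleField c ρ Φτ) (scaleField (s * c) σ src)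
        (scaleField c σ φ)
      = energy D₁ (weightO a1 aτ₁) (rowsO Qn₁ Qτ₁) (Sum.elim Φ' Φτ) src φ := by
  unfold energyNext
  rw [ha, haτ, hQn, hQτ, hD, weightO_scale ν ρ, rowsO_scale ν ρ σ, sumElim_scaleField ν ρ]
  exact energy_scale_eq σ (ν.sumCongr ρ) D₁ (weightO a1 aτ₁) (rowsO Qn₁ Qτ₁) hsc (Sum.elim Φ' Φτ) src φ

end Lumpy

/-! ## Part 6 — DISCHARGE for the lattice operators: `−Δ_η` from successor maps, the mass, Dirichlet restriction to
transported regions, the boundary coupling, the block averages -/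

section Lattice

variable {S : Type*} [DecidableEq S]

/-- the pull-back by a site map as a matrix: `(P_t)_{yx} = 1` iff `x = t(y)`, so `P_tφ = φ ∘ t` (for `t = (· + ηe_μ)` the
forward shift of the lattice derivative *"(∂_μf)(x) = (f(x + ηe_μ) − f(x))/η"*).
[cite: Dimock2013, §1.2 eqs. (three0), (lattice1) (arXiv:1108.1335v2 TeX L205–215)] -/
def shiftMat (t : S → S) : Matrix S S ℝ := Matrix.of fun y x => if x = t y then 1 else 0

variable [Fintype S]

/-- `P_tφ = φ ∘ t`. [cite: Dimock2013, §1.2 eqs. (three0), (lattice1) (arXiv:1108.1335v2 TeX L205–215)] -/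
theorem shiftMat_mulVec (t : S → S) (φ : S → ℝ) : shiftMat t *ᵥ φ = φ ∘ t := by
  funext y
  simp [shiftMat, Matrix.mulVec, dotProduct]

/-- `(1 − P_t)φ = φ − φ ∘ t` (`η·∂_μφ`). [cite: Dimock2013, §1.2 eqs. (three0), (lattice1) (arXiv:1108.1335v2 TeX L205–215)] -/
theorem one_sub_shiftMat_mulVec (t : S → S) (φ : S → ℝ) : (1 - shiftMat t) *ᵥ φ = φ - φ ∘ t := by
  rw [Matrix.sub_mulVec, Matrix.one_mulVec, shiftMat_mulVec]

variable {E : Type*} [Fintype E]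

/-- **minus the lattice Laplacian of spacing `η`** from the successor maps `t_e : S → S` (`e` the directions), in the
UNWEIGHTED frame of this lineage's matrix carriers: `−Δ_η = η⁻²Σ_e(1 − P_{t_e})ᵀ(1 − P_{t_e})`, i.e. `⟨φ, (−Δ_η)φ⟩ =
η⁻²Σ_eΣ_y(φ(t_ey) − φ(y))² = Σ_eΣ_y((∂_eφ)(y))²` (the print's `‖∂φ‖² = ∫|∂φ|²` carries the extra `η³` of (three0) — the frame
factor, `sum_gradsq_eq` below). [cite: Dimock2013, §1.2 eqs. (three0), (lattice1) (arXiv:1108.1335v2 TeX L205–215)] -/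
noncomputable def negLap (t : E → S → S) (η : ℝ) : Matrix S S ℝ :=
  (η ^ 2)⁻¹ • ∑ e, (1 - shiftMat (t e))ᵀ * (1 - shiftMat (t e))

omit [DecidableEq S] in
/-- `⟨φ, MᵀMφ⟩ = |Mφ|²`. [folklore] -/
private theorem dot_transpose_mul_self_mulVec (M : Matrix S S ℝ) (φ : S → ℝ) :
    φ ⬝ᵥ ((Mᵀ * M) *ᵥ φ) = (M *ᵥ φ) ⬝ᵥ (M *ᵥ φ) := by
  rw [← Matrix.mulVec_mulVec, Matrix.dotProduct_mulVec, Matrix.vecMul_transpose]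

/-- **THE QUADRATIC FORM OF `−Δ_η`**: `⟨φ, (−Δ_η)φ⟩ = η⁻²Σ_eΣ_y(φ(t_ey) − φ(y))²` (`= Σ_μ|∂_μφ|²`, `Δ = −∂*∂`). [cite: Dimock2013, §1.2 eqs. (three0), (lattice1) (arXiv:1108.1335v2 TeX L205–215)] -/
theorem dot_negLap_mulVec (t : E → S → S) (η : ℝ) (φ : S → ℝ) :
    φ ⬝ᵥ (negLap t η *ᵥ φ) = (η ^ 2)⁻¹ * ∑ e, ∑ y, (φ (t e y) - φ y) ^ 2 := by
  unfold negLap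
  rw [Matrix.smul_mulVec, dotProduct_smul, smul_eq_mul, Matrix.sum_mulVec, dotProduct_sum]
  congr 1
  refine Finset.sum_congr rfl fun e _ => ?_
  rw [dot_transpose_mul_self_mulVec, one_sub_shiftMat_mulVec]
  simp only [dotProduct, Pi.sub_apply, Function.comp_apply]
  refine Finset.sum_congr rfl fun y _ => ?_
  ring

/-- `−Δ_η` is symmetric. [cite: Dimock2013, §1.2 eqs. (three0), (lattice1) (arXiv:1108.1335v2 TeX L205–215)] -/
theorem negLap_transpose (t : E → S → S) (η : ℝ) : (negLap t η)ᵀ = negLap t η := by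
  unfold negLap
  rw [Matrix.transpose_smul, Matrix.transpose_sum]
  simp only [Matrix.transpose_mul, Matrix.transpose_transpose]

/-- `−Δ_η` is positive semidefinite. [cite: Dimock2013, §1.2 eqs. (three0), (lattice1) (arXiv:1108.1335v2 TeX L205–215)] -/
theorem negLap_posSemidef (t : E → S → S) (η : ℝ) : (negLap t η).PosSemidef := by
  refine Matrix.PosSemidef.of_dotProduct_mulVec_nonneg ?_ fun φ => ?_
  · rw [Matrix.IsHermitian, Matrix.conjTranspose_eq_transpose_of_trivial, negLap_transpose]
  · rw [star_trivial, dot_negLap_mulVec]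
    exact mul_nonneg (inv_nonneg.mpr (sq_nonneg _))
      (Finset.sum_nonneg fun _ _ => Finset.sum_nonneg fun _ _ => sq_nonneg _)

/-- `−Δ_η + μ̄` is positive definite for `μ̄ > 0` — the hypothesis `D > 0` of `MultiRegionFreeFlow` for the massive
free operator.
[cite: Dimock2013, §1.2 (arXiv:1108.1335v2 TeX L205–216: "The parameter μ̄ > 0 is a fixed mass-squared"); Dimock2013BalabanII, Thm 2.1 (arXiv:1212.5562v2 TeX L594–614)] -/
theorem negLap_add_mass_posDef (t : E → S → S) (η : ℝ) {μ : ℝ} (hμ : 0 < μ) :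
    (negLap t η + μ • (1 : Matrix S S ℝ)).PosDef := by
  have h1 : (μ • (1 : Matrix S S ℝ)).PosDef := by
    have := Matrix.PosDef.one (n := S) (R := ℝ)
    exact this.smul hμ
  exact Matrix.PosDef.posSemidef_add (negLap_posSemidef t η) h1

/-- **FRAME CHECK**: the print's weighted `‖∂φ‖² = Σ_μ∫(∂_μφ)² = η³Σ_μΣ_y((φ(y + ηe_μ) − φ(y))/η)²` — this lineage's
`LocalizedStepAssembly.gradsq` summed over the directions — is `η³` times the unweighted form `⟨φ, (−Δ_η)φ⟩`.
[cite: Dimock2013, §1.2 eqs. (three0), (lattice1) (arXiv:1108.1335v2 TeX L205–215)] -/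
theorem sum_gradsq_eq (t : E → S → S) {η : ℝ} (hη : η ≠ 0) (φ : S → ℝ) :
    ∑ e, gradsq (t e) η Finset.univ φ = η ^ 3 * (φ ⬝ᵥ (negLap t η *ᵥ φ)) := by
  rw [dot_negLap_mulVec, Finset.mul_sum, Finset.mul_sum]
  refine Finset.sum_congr rfl fun e _ => ?_
  unfold gradsq latDeriv
  rw [Finset.mul_sum, Finset.mul_sum]
  refine Finset.sum_congr rfl fun y _ => ?_
  field_simp

variable {S₀ S₁ : Type*} [DecidableEq S₀] [DecidableEq S₁] (σ : S₁ ≃ S₀)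

/-- **THE SCALED LATTICE IS THE SAME GRAPH**: successor maps intertwined by the relabelling `σ` (`σ(t₁y) = t₀(σy)`:
`L·(y + η₁e) = Ly + η₀e` for `η₀ = Lη₁`) have transported pull-back matrices.
[cite: Dimock2013, Lemma 5 (scaling) proof (arXiv:1108.1335v2 TeX L816–819); Dimock2013BalabanII, §2.3 (arXiv:1212.5562v2 TeX L923–929)] -/
theorem shiftMat_scale {t₀ : S₀ → S₀} {t₁ : S₁ → S₁} (h : ∀ y, σ (t₁ y) = t₀ (σ y)) :
    shiftMat t₀ = Matrix.reindex σ σ (shiftMat t₁) := by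
  ext y x
  simp only [shiftMat, Matrix.of_apply, Matrix.reindex_apply, Matrix.submatrix_apply]
  have : x = t₀ y ↔ σ.symm x = t₁ (σ.symm y) := by
    constructor
    · intro hx
      apply σ.injective
      rw [h, Equiv.apply_symm_apply, Equiv.apply_symm_apply, hx]
    · intro hx
      rw [← σ.apply_symm_apply x, hx, h, Equiv.apply_symm_apply]
  simp only [this]

/-- … and so do the forward differences `1 − P_t`. [cite: Dimock2013, Lemma 5 (scaling) proof (arXiv:1108.1335v2 TeX L816–819); Dimock2013BalabanII, §2.3 (arXiv:1212.5562v2 TeX L923–929)] -/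
theorem one_sub_shiftMat_scale {t₀ : S₀ → S₀} {t₁ : S₁ → S₁} (h : ∀ y, σ (t₁ y) = t₀ (σ y)) :
    (1 : Matrix S₀ S₀ ℝ) - shiftMat t₀ = Matrix.reindex σ σ (1 - shiftMat t₁) := by
  rw [shiftMat_scale σ h]
  ext y x
  simp [Matrix.reindex_apply, Matrix.one_apply]

omit [DecidableEq S₀] [DecidableEq S₁] in
/-- **RESTRICTION TO TRANSPORTED REGIONS** `[·]_{LΩ}`: for regions related by the relabelling (`Ω₀ = σ(Ω₁)`, as
predicates `p₀ ∘ σ = p₁`, and likewise `q`), the block of the scaled-and-transported operator between the transported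
regions is the scaled-and-transported block — Dirichlet restriction `[·]_{Ω₁}` (`p = q`) and the couplings `[·]_{Ω₁,Ω₁ᶜ}`
(`q = ¬p`) alike.
[cite: Dimock2013BalabanII, §2.2 (arXiv:1212.5562v2 TeX L588–590); Dimock2013BalabanII, §2.3 (TeX L920–922)] -/
theorem block_scale (M : Matrix S₁ S₁ ℝ) (s : ℝ) {p₀ q₀ : S₀ → Prop} {p₁ q₁ : S₁ → Prop}
    (hp : ∀ y, p₁ y ↔ p₀ (σ y)) (hq : ∀ y, q₁ y ↔ q₀ (σ y)) :
    (s • Matrix.reindex σ σ M).submatrix (Subtype.val : {x // p₀ x} → S₀) (Subtype.val : {x // q₀ x} → S₀)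
      = s • Matrix.reindex (σ.subtypeEquiv hp) (σ.subtypeEquiv hq)
          (M.submatrix (Subtype.val : {y // p₁ y} → S₁) (Subtype.val : {y // q₁ y} → S₁)) := by
  ext ⟨x, hx⟩ ⟨y, hy⟩
  simp [Matrix.reindex_apply, Matrix.submatrix_apply, Equiv.subtypeEquiv_symm, Equiv.subtypeEquiv_apply]

omit [DecidableEq S₀] [DecidableEq S₁] in
/-- **THE BOUNDARY SOURCE SCALES WITH THE OPERATOR**: `[s·M^σ]_{p₀,q₀}(ψ_c) = (s·c)`-scaling of `[M]_{p₁,q₁}ψ` — for `M =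
Δ`, `s = L⁻²`: the source `[Δ]_{Ω₁,Ω₁ᶜ}φ_{Ω₁ᶜ}` of the scaled problem at the scaled outside field is the `(s·c)`-scaled
source, exactly the input of `minimizer_scale`∕`lumpy`.
[cite: Dimock2013BalabanII, §2.2 (arXiv:1212.5562v2 TeX L588–590); Dimock2013BalabanII, §2.3 (TeX L920–922)] -/
theorem source_scale (M : Matrix S₁ S₁ ℝ) (s c : ℝ) {p₀ q₀ : S₀ → Prop} {p₁ q₁ : S₁ → Prop}
    [Fintype {x // q₀ x}] [Fintype {y // q₁ y}]
    (hp : ∀ y, p₁ y ↔ p₀ (σ y)) (hq : ∀ y, q₁ y ↔ q₀ (σ y)) (ψ : {y // q₁ y} → ℝ) :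
    (s • Matrix.reindex σ σ M).submatrix (Subtype.val : {x // p₀ x} → S₀) (Subtype.val : {x // q₀ x} → S₀)
        *ᵥ scaleField c (σ.subtypeEquiv hq) ψ
      = scaleField (s * c) (σ.subtypeEquiv hp)
          (M.submatrix (Subtype.val : {y // p₁ y} → S₁) (Subtype.val : {y // q₁ y} → S₁) *ᵥ ψ) := by
  rw [block_scale σ M s hp hq, Matrix.smul_mulVec, reindex_mulVec_scaleField, smul_scaleField]

variable [Fintype S₀] [Fintype S₁]

/-- **`−Δ_{η₀} = L⁻²·(−Δ_{η₁})^σ` FOR `η₀ = Lη₁`** — the Laplacian part of I L816–819 ∕ II L923–929 *"(−Δ + μ̄_k + …)f_L =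
L⁻²((−Δ + μ̄_{k+1} + …)f)_L"*, DISCHARGED: scaling produces `L⁻²` on the second-order difference operator.
[cite: Dimock2013, Lemma 5 (scaling) proof (arXiv:1108.1335v2 TeX L816–819); Dimock2013BalabanII, §2.3 (arXiv:1212.5562v2 TeX L923–929)] -/
theorem negLap_scale {t₀ : E → S₀ → S₀} {t₁ : E → S₁ → S₁} (h : ∀ e y, σ (t₁ e y) = t₀ e (σ y)) {L η₀ η₁ : ℝ}
    (hη : η₀ = L * η₁) :
    negLap t₀ η₀ = (L ^ 2)⁻¹ • Matrix.reindex σ σ (negLap t₁ η₁) := by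
  unfold negLap
  have hA : ∀ e, (1 : Matrix S₀ S₀ ℝ) - shiftMat (t₀ e) = Matrix.reindex σ σ (1 - shiftMat (t₁ e)) :=
    fun e => one_sub_shiftMat_scale σ (h e)
  simp only [hA, transpose_reindex', reindex_mul_reindex, ← reindex_finset_sum, reindex_smul', smul_smul, hη,
    mul_pow, mul_inv]

/-- **`[−Δ_{η₀} + μ̄_k] = L⁻²·[−Δ_{η₁} + μ̄_{k+1}]^σ`** — *"Since μ̄_k = L⁻²μ̄_{k+1}"* (II L924, I L815): the massive free operator
scales with `L⁻²`; this is the hypothesis `hD` of `lumpy`∕`oooo` (and the `D`-data of Parts 2–4), DISCHARGED.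
[cite: Dimock2013, Lemma 5 (scaling) proof (arXiv:1108.1335v2 TeX L814–819); Dimock2013BalabanII, §2.3 (arXiv:1212.5562v2 TeX L921–929)] -/
theorem negLap_add_mass_scale {t₀ : E → S₀ → S₀} {t₁ : E → S₁ → S₁} (h : ∀ e y, σ (t₁ e y) = t₀ e (σ y))
    {L η₀ η₁ μ₀ μ₁ : ℝ} (hη : η₀ = L * η₁) (hμ : μ₀ = (L ^ 2)⁻¹ * μ₁) :
    negLap t₀ η₀ + μ₀ • (1 : Matrix S₀ S₀ ℝ) = (L ^ 2)⁻¹ • Matrix.reindex σ σ (negLap t₁ η₁ + μ₁ • 1) := by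
  rw [negLap_scale σ h hη, hμ]
  ext i j
  simp only [Matrix.add_apply, Matrix.smul_apply, Matrix.reindex_apply, Matrix.submatrix_apply, Matrix.one_apply,
    smul_eq_mul, EmbeddingLike.apply_eq_iff_eq]
  split_ifs <;> ring

variable {S₀' S₁' : Type*}

omit [Fintype S] in
/-- gen 42's block average `LocalizedStepAssembly.blockAvg B w` as a matrix: `(Q_B)_{yx} = w·1_{x ∈ B(y)}` (*"(Qf)(y) =
L^{−3}Σ_{x∈B(y)}f(x)"*). [cite: Dimock2013, §2.1 (arXiv:1108.1335v2 TeX L318–320, L411) and Lemma 5 (scaling) proof (TeX L814); Dimock2013BalabanII, §2.3 (arXiv:1212.5562v2 TeX L920–922)] -/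
def blockAvgMat {S' : Type*} (B : S' → Finset S) (w : ℝ) : Matrix S' S ℝ :=
  Matrix.of fun y x => if x ∈ B y then w else 0

/-- `Q_B φ = blockAvg B w φ`. [cite: Dimock2013, §2.1 (arXiv:1108.1335v2 TeX L318–320, L411) and Lemma 5 (scaling) proof (TeX L814); Dimock2013BalabanII, §2.3 (arXiv:1212.5562v2 TeX L920–922)] -/
theorem blockAvgMat_mulVec {S' : Type*} (B : S' → Finset S) (w : ℝ) (φ : S → ℝ) :
    blockAvgMat B w *ᵥ φ = blockAvg B w φ := by
  funext y
  simp only [Matrix.mulVec, dotProduct, blockAvgMat, Matrix.of_apply, blockAvg, ite_mul, zero_mul]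
  rw [Finset.sum_ite_mem, Finset.univ_inter, Finset.mul_sum]

omit [Fintype S₀] [Fintype S₁] in
/-- **«Q IS SCALE INVARIANT» AS A MATRIX IDENTITY**: blocks transported by the relabellings (`B₀(σ′y) = σ(B₁y)`, the
hypothesis of gen 42's `LocalizedStepAssembly.blockAvg_scale`) give transported averaging matrices `Q_{B₀} = Q_{B₁}^{σ′σ}` —
the hypothesis `hQn`∕`hQτ` of `lumpy`∕`oooo` for block averages, DISCHARGED.
[cite: Dimock2013, §2.1 (arXiv:1108.1335v2 TeX L318–320, L411) and Lemma 5 (scaling) proof (TeX L814); Dimock2013BalabanII, §2.3 (arXiv:1212.5562v2 TeX L920–922)] -/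
theorem blockAvgMat_scale (σ' : S₁' ≃ S₀') {B₀ : S₀' → Finset S₀} {B₁ : S₁' → Finset S₁}
    (hB : ∀ y, B₀ (σ' y) = (B₁ y).map σ.toEmbedding) (w : ℝ) :
    blockAvgMat B₀ w = Matrix.reindex σ' σ (blockAvgMat B₁ w) := by
  ext y x
  obtain ⟨y', rfl⟩ := σ'.surjective y
  simp only [blockAvgMat, Matrix.of_apply, Matrix.reindex_apply, Matrix.submatrix_apply, Equiv.symm_apply_apply, hB,
    Finset.mem_map_equiv]

end Lattice

/-! ## Part 7 — THE PRINTED STATEMENTS WITH EVERY SCALING HYPOTHESIS DISCHARGED FROM THE LATTICE GEOMETRY -/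

section Assembly

variable {S₀ S₁ : Type*} [Fintype S₀] [Fintype S₁] [DecidableEq S₀] [DecidableEq S₁] {E : Type*} [Fintype E]
variable (σ : S₁ ≃ S₀)

/-- **I LEMMA 5 (scaling), `φ⁰_{k+1}(Φ_{k+1,L}) = [φ_{k+1}(Φ_{k+1})]_L`, ON THE LATTICE OPERATORS** (I L814–828): with
`−Δ + μ̄` the forward-difference operator of Part 6 on two lattices that are the same graph (`ht`), spacings `η₀ = Lη₁`,
masses `μ̄_k = L⁻²μ̄_{k+1}`, and the averaging operator transported (`Q_{k+1}` *"is scale invariant"* — for block averages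
`blockAvgMat_scale`): `L⁻²a_{k+1}·G⁰_{k+1}Qᵀ_{k+1}Φ_{k+1,L} = [a_{k+1}G_{k+1}Qᵀ_{k+1}Φ_{k+1}]_L` with `G⁰_{k+1} = (−Δ_{η₀} +
μ̄_k + a_{k+1}L⁻²QᵀQ)⁻¹`, `G_{k+1} = (−Δ_{η₁} + μ̄_{k+1} + a_{k+1}QᵀQ)⁻¹` — no hypothesis left but the geometry.
[cite: Dimock2013, Lemma 5 (scaling) (arXiv:1108.1335v2 TeX L800–803) and its proof (TeX L814–828)] -/
theorem phik_lattice {t₀ : E → S₀ → S₀} {t₁ : E → S₁ → S₁} (ht : ∀ e y, σ (t₁ e y) = t₀ e (σ y))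
    {L η₀ η₁ μ₀ μ₁ : ℝ} (hL : L ≠ 0) (hη : η₀ = L * η₁) (hμ : μ₀ = (L ^ 2)⁻¹ * μ₁)
    {ι₀ ι₁ : Type*} [Fintype ι₀] [Fintype ι₁] (τ : ι₁ ≃ ι₀) (Qk : Matrix ι₁ S₁ ℝ) (a1 c : ℝ) (Φ : ι₁ → ℝ) :
    ((L ^ 2)⁻¹ * a1) • (Gk (negLap t₀ η₀ + μ₀ • 1) (Matrix.reindex τ σ Qk) ((L ^ 2)⁻¹ * a1)
        *ᵥ ((Matrix.reindex τ σ Qk)ᵀ *ᵥ scaleField c τ Φ))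
      = scaleField c σ (a1 • (Gk (negLap t₁ η₁ + μ₁ • 1) Qk a1 *ᵥ (Qkᵀ *ᵥ Φ))) := by
  rw [negLap_add_mass_scale σ ht hη hμ]
  exact phik_scale σ τ _ Qk a1 (inv_ne_zero (pow_ne_zero 2 hL)) c Φ

/-- **`G⁰_{k+1}f_L = L²[G_{k+1}f]_L` ON THE LATTICE OPERATORS** (I L820), every hypothesis discharged but the geometry. [cite: Dimock2013, Lemma 5 (scaling) proof (arXiv:1108.1335v2 TeX L820); Dimock2013BalabanII, §2.3 (arXiv:1212.5562v2 TeX L930–933)] -/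
theorem Gk_lattice {t₀ : E → S₀ → S₀} {t₁ : E → S₁ → S₁} (ht : ∀ e y, σ (t₁ e y) = t₀ e (σ y))
    {L η₀ η₁ μ₀ μ₁ : ℝ} (hL : L ≠ 0) (hη : η₀ = L * η₁) (hμ : μ₀ = (L ^ 2)⁻¹ * μ₁)
    {ι₀ ι₁ : Type*} [Fintype ι₀] [Fintype ι₁] (τ : ι₁ ≃ ι₀) (Qk : Matrix ι₁ S₁ ℝ) (a1 c : ℝ) (f : S₁ → ℝ) :
    Gk (negLap t₀ η₀ + μ₀ • 1) (Matrix.reindex τ σ Qk) ((L ^ 2)⁻¹ * a1) *ᵥ scaleField c σ f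
      = L ^ 2 • scaleField c σ (Gk (negLap t₁ η₁ + μ₁ • 1) Qk a1 *ᵥ f) := by
  rw [negLap_add_mass_scale σ ht hη hμ, Gk_mulVec_scaleField σ τ _ Qk a1 (inv_ne_zero (pow_ne_zero 2 hL)), inv_inv]

/-- **II (lumpy), `φ⁰_{k+1,L𝛀⁺}([φ_{Ω₁ᶜ}]_L, [Φ_{k+1,𝛀⁺}]_L) = [φ_{k+1,𝛀⁺}(φ_{Ω₁ᶜ}, Φ_{k+1,𝛀⁺})]_L`, ON THE LATTICE OPERATORS**
(II L920–937) for `MultiRegionFreeFlow.minimizer` (= (unknown)∕(eddie)): the fine lattices are the same graph (`ht`),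
`η₀ = Lη₁`, *"μ̄_k = L⁻²μ̄_{k+1}"* (`hμ`), the region `Ω₁` and its complement transported by the relabelling (`hp`), the
weights *"a^{(k)}_j = L⁻²a^{(k+1)}_j"* and the averaging rows transported (*"Q_j is scale invariant"*) — given literally
as `L⁻²·𝐚^τ` and `Q^{τσ}`; the Dirichlet operator `[−Δ + μ̄]_{Ω₁}` and the boundary source `[Δ]_{Ω₁,Ω₁ᶜ}φ_{Ω₁ᶜ}` are the
blocks of Part 6's lattice operator, and their scalings are DISCHARGED (`negLap_add_mass_scale`, `block_scale`,
`source_scale`): the minimizer of the scaled problem at the scaled data IS the scaled minimizer, for every frame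
constant `c`.
[cite: Dimock2013BalabanII, §2.3 eq. (lumpy) (arXiv:1212.5562v2 TeX L920–938), §2.2 (TeX L588–590), Thm 2.1 (unknown) (TeX L603–613)] -/
theorem lumpy_lattice {t₀ : E → S₀ → S₀} {t₁ : E → S₁ → S₁} (ht : ∀ e y, σ (t₁ e y) = t₀ e (σ y))
    {L η₀ η₁ μ₀ μ₁ : ℝ} (hL : L ≠ 0) (hη : η₀ = L * η₁) (hμ : μ₀ = (L ^ 2)⁻¹ * μ₁)
    {p₀ : S₀ → Prop} {p₁ : S₁ → Prop} [DecidablePred p₀] [DecidablePred p₁] (hp : ∀ y, p₁ y ↔ p₀ (σ y))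
    {m₀ m₁ : Type*} [Fintype m₀] [Fintype m₁] (τ : m₁ ≃ m₀) (a : Matrix m₁ m₁ ℝ) (Qm : Matrix m₁ {y // p₁ y} ℝ)
    (c : ℝ) (Φ : m₁ → ℝ) (φc : {y // ¬p₁ y} → ℝ) :
    minimizer ((negLap t₀ η₀ + μ₀ • 1).submatrix (Subtype.val : {x // p₀ x} → S₀) Subtype.val)
        ((L ^ 2)⁻¹ • Matrix.reindex τ τ a) (Matrix.reindex τ (σ.subtypeEquiv hp) Qm) (scaleField c τ Φ)
        (-((negLap t₀ η₀).submatrix (Subtype.val : {x // p₀ x} → S₀) (Subtype.val : {x // ¬p₀ x} → S₀)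
            *ᵥ scaleField c (σ.subtypeEquiv fun y => not_congr (hp y)) φc))
      = scaleField c (σ.subtypeEquiv hp)
          (minimizer ((negLap t₁ η₁ + μ₁ • 1).submatrix (Subtype.val : {y // p₁ y} → S₁) Subtype.val) a Qm Φ
            (-((negLap t₁ η₁).submatrix (Subtype.val : {y // p₁ y} → S₁) (Subtype.val : {y // ¬p₁ y} → S₁)
                *ᵥ φc))) := by
  rw [negLap_add_mass_scale σ ht hη hμ, block_scale σ _ _ hp hp, negLap_scale σ ht hη,
    source_scale σ _ _ _ hp (fun y => not_congr (hp y)), ← scaleField_neg]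
  exact minimizer_scale (σ.subtypeEquiv hp) τ _ a Qm (inv_ne_zero (pow_ne_zero 2 hL)) c Φ _

/-- **II (oooo) ON THE LATTICE OPERATORS, AT THE TWO MINIMIZERS**: with the frame relation `L⁻²c² = 1` the exponent
`S_k(Ω₁, Φ, φ) − ⟨φ, [Δ]_{Ω₁,Ω₁ᶜ}φ_{Ω₁ᶜ}⟩` of the scaled problem at its minimizer equals that of the unscaled problem at
its minimizer.
[cite: Dimock2013BalabanII, §2.3 eq. (oooo) and L944–951 (arXiv:1212.5562v2 TeX L940–951); Dimock2013, Lemma 5 (scaling) eq. (71) (arXiv:1108.1335v2 TeX L831–842)] -/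
theorem oooo_lattice {t₀ : E → S₀ → S₀} {t₁ : E → S₁ → S₁} (ht : ∀ e y, σ (t₁ e y) = t₀ e (σ y))
    {L η₀ η₁ μ₀ μ₁ : ℝ} (hL : L ≠ 0) (hη : η₀ = L * η₁) (hμ : μ₀ = (L ^ 2)⁻¹ * μ₁)
    {p₀ : S₀ → Prop} {p₁ : S₁ → Prop} [DecidablePred p₀] [DecidablePred p₁] (hp : ∀ y, p₁ y ↔ p₀ (σ y))
    {m₀ m₁ : Type*} [Fintype m₀] [Fintype m₁] (τ : m₁ ≃ m₀) (a : Matrix m₁ m₁ ℝ) (Qm : Matrix m₁ {y // p₁ y} ℝ)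
    {c : ℝ} (hc : (L ^ 2)⁻¹ * c ^ 2 = 1) (Φ : m₁ → ℝ) (φc : {y // ¬p₁ y} → ℝ) :
    let D₀ := (negLap t₀ η₀ + μ₀ • 1).submatrix (Subtype.val : {x // p₀ x} → S₀) Subtype.val
    let src₀ := -((negLap t₀ η₀).submatrix (Subtype.val : {x // p₀ x} → S₀) (Subtype.val : {x // ¬p₀ x} → S₀)
            *ᵥ scaleField c (σ.subtypeEquiv fun y => not_congr (hp y)) φc)
    let D₁ := (negLap t₁ η₁ + μ₁ • 1).submatrix (Subtype.val : {y // p₁ y} → S₁) Subtype.val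
    let src₁ := -((negLap t₁ η₁).submatrix (Subtype.val : {y // p₁ y} → S₁) (Subtype.val : {y // ¬p₁ y} → S₁) *ᵥ φc)
    energy D₀ ((L ^ 2)⁻¹ • Matrix.reindex τ τ a) (Matrix.reindex τ (σ.subtypeEquiv hp) Qm) (scaleField c τ Φ) src₀
        (minimizer D₀ ((L ^ 2)⁻¹ • Matrix.reindex τ τ a) (Matrix.reindex τ (σ.subtypeEquiv hp) Qm) (scaleField c τ Φ)
          src₀)
      = energy D₁ a Qm Φ src₁ (minimizer D₁ a Qm Φ src₁) := by
  intro D₀ src₀ D₁ src₁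
  have hD : D₀ = (L ^ 2)⁻¹ • Matrix.reindex (σ.subtypeEquiv hp) (σ.subtypeEquiv hp) D₁ := by
    simp only [D₀, D₁]
    rw [negLap_add_mass_scale σ ht hη hμ, block_scale σ _ _ hp hp]
  have hsrc : src₀ = scaleField ((L ^ 2)⁻¹ * c) (σ.subtypeEquiv hp) src₁ := by
    simp only [src₀, src₁]
    rw [negLap_scale σ ht hη, source_scale σ _ _ _ hp (fun y => not_congr (hp y)), ← scaleField_neg]
  rw [hD, hsrc]
  exact energy_minimizer_scale_eq (σ.subtypeEquiv hp) τ D₁ a Qm (inv_ne_zero (pow_ne_zero 2 hL)) hc Φ src₁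

end Assembly

/-! ## Part 8 — Non-vacuity: one-site and two-site instances -/

section Examples

/-- one site, one direction, the identity as successor: `−Δ_η = 0`. -/
example : negLap (fun (_ : Unit) (x : Unit) => x) (2 : ℝ) = 0 := by
  have h : shiftMat (fun x : Unit => x) = (1 : Matrix Unit Unit ℝ) := by
    ext i j
    simp [shiftMat]
  simp [negLap, h]

/-- two sites `Fin 2` with the swap as successor and `η = 1`: `⟨φ, (−Δ)φ⟩ = 2(φ₀ − φ₁)²`. -/
example (φ : Fin 2 → ℝ) :
    φ ⬝ᵥ (negLap (fun (_ : Unit) (x : Fin 2) => x + 1) (1 : ℝ) *ᵥ φ) = 2 * (φ 0 - φ 1) ^ 2 := by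
  rw [dot_negLap_mulVec]
  simp [Fin.sum_univ_two]
  ring

/-- `minimizer_scale` on one site per lattice along the identity relabelling, `s = c = 1`: both sides are the same
minimizer. -/
example (D a Qm : Matrix Unit Unit ℝ) (Φ src : Unit → ℝ) :
    minimizer ((1 : ℝ) • Matrix.reindex (Equiv.refl Unit) (Equiv.refl Unit) D)
        ((1 : ℝ) • Matrix.reindex (Equiv.refl Unit) (Equiv.refl Unit) a)
        (Matrix.reindex (Equiv.refl Unit) (Equiv.refl Unit) Qm) (scaleField 1 (Equiv.refl Unit) Φ)
        (scaleField (1 * 1) (Equiv.refl Unit) src)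
      = scaleField 1 (Equiv.refl Unit) (minimizer D a Qm Φ src) :=
  minimizer_scale (Equiv.refl Unit) (Equiv.refl Unit) D a Qm one_ne_zero 1 Φ src

end Examples

/-! ## Part 9 (v1.1) — THE SAME INDEX SET: on the torus both lattices ARE one index set (`𝕋^{−k}_{M+N−k}` and
`𝕋^{−(k+1)}_{M+N−k−1}` have `L^{M+N}` sites per direction, `y ↦ Ly` is the identity of `(ℤ/L^{M+N}ℤ)³` and the successor
maps coincide), so every transport is `rfl` and scaling is pure bookkeeping of `η`, `μ̄`, `𝐚`, `c` -/

section SameIndex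

variable {S : Type*}

/-- along the identity relabelling the scaled field is `c·φ`. [cite: Dimock2013, Lemma 5 (scaling) proof (arXiv:1108.1335v2
TeX L814)] -/
theorem scaleField_refl (c : ℝ) (φ : S → ℝ) : scaleField c (Equiv.refl S) φ = c • φ := by
  funext x; simp [scaleField]

variable [Fintype S] [DecidableEq S] {E : Type*} [Fintype E]

/-- **`−Δ_{Lη} = L⁻²·(−Δ_η)` ON ONE INDEX SET** — the Laplacian's `L⁻²` with the same successor maps (I L816–819).
[cite: Dimock2013, Lemma 5 (scaling) proof (arXiv:1108.1335v2 TeX L816–819); Dimock2013BalabanII, §2.3 (arXiv:1212.5562v2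
TeX L923–929)] -/
theorem negLap_scale_self (t : E → S → S) {L η₀ η₁ : ℝ} (hη : η₀ = L * η₁) :
    negLap t η₀ = (L ^ 2)⁻¹ • negLap t η₁ := by
  rw [negLap_scale (Equiv.refl S) (t₀ := t) (t₁ := t) (fun _ _ => rfl) hη, Matrix.reindex_refl_refl]

/-- **`[−Δ_{Lη} + μ̄_k] = L⁻²·[−Δ_η + μ̄_{k+1}]` ON ONE INDEX SET** for `μ̄_k = L⁻²μ̄_{k+1}`. [cite: Dimock2013, Lemma 5 (scaling)
proof (arXiv:1108.1335v2 TeX L814–819); Dimock2013BalabanII, §2.3 (arXiv:1212.5562v2 TeX L921–929)] -/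
theorem negLap_add_mass_scale_self (t : E → S → S) {L η₀ η₁ μ₀ μ₁ : ℝ} (hη : η₀ = L * η₁)
    (hμ : μ₀ = (L ^ 2)⁻¹ * μ₁) :
    negLap t η₀ + μ₀ • (1 : Matrix S S ℝ) = (L ^ 2)⁻¹ • (negLap t η₁ + μ₁ • 1) := by
  rw [negLap_add_mass_scale (Equiv.refl S) (t₀ := t) (t₁ := t) (fun _ _ => rfl) hη hμ, Matrix.reindex_refl_refl]

/-- **«G⁰_{k+1} = L²G_{k+1}» AS MATRICES ON ONE INDEX SET** (I L820 *"G⁰_{k+1}f_L = L²[G_{k+1}f]_L"* with `f_L = L^{−1/2}f`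
a scalar multiple): `(−Δ_{η₀} + μ̄_k + a_{k+1}L⁻²QᵀQ)⁻¹ = L²·(−Δ_{η₁} + μ̄_{k+1} + a_{k+1}QᵀQ)⁻¹`. [cite: Dimock2013, Lemma 5
(scaling) proof (arXiv:1108.1335v2 TeX L816–820)] -/
theorem Gk_self (t : E → S → S) {L η₀ η₁ μ₀ μ₁ : ℝ} (hL : L ≠ 0) (hη : η₀ = L * η₁) (hμ : μ₀ = (L ^ 2)⁻¹ * μ₁)
    {ι : Type*} [Fintype ι] (Qk : Matrix ι S ℝ) (a1 : ℝ) :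
    Gk (negLap t η₀ + μ₀ • 1) Qk ((L ^ 2)⁻¹ * a1) = L ^ 2 • Gk (negLap t η₁ + μ₁ • 1) Qk a1 := by
  have h := Gk_scale (Equiv.refl S) (Equiv.refl ι) (negLap t η₁ + μ₁ • 1) Qk a1 (inv_ne_zero (pow_ne_zero 2 hL))
  rw [Matrix.reindex_refl_refl, Matrix.reindex_refl_refl, Matrix.reindex_refl_refl, inv_inv,
    ← negLap_add_mass_scale_self t hη hμ] at h
  exact h

/-- **LEMMA 5's second claim ON ONE INDEX SET**: `L⁻²a_{k+1}·G⁰_{k+1}Qᵀ_{k+1}(cΦ) = c·(a_{k+1}G_{k+1}Qᵀ_{k+1}Φ)` (I L823–828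
with `Φ_{k+1,L}`, `[·]_L` read as the scalar multiples they are on a common index set). [cite: Dimock2013, Lemma 5 (scaling)
(arXiv:1108.1335v2 TeX L800–803, L823–828)] -/
theorem phik_self (t : E → S → S) {L η₀ η₁ μ₀ μ₁ : ℝ} (hL : L ≠ 0) (hη : η₀ = L * η₁) (hμ : μ₀ = (L ^ 2)⁻¹ * μ₁)
    {ι : Type*} [Fintype ι] (Qk : Matrix ι S ℝ) (a1 c : ℝ) (Φ : ι → ℝ) :
    ((L ^ 2)⁻¹ * a1) • (Gk (negLap t η₀ + μ₀ • 1) Qk ((L ^ 2)⁻¹ * a1) *ᵥ (Qkᵀ *ᵥ (c • Φ)))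
      = c • (a1 • (Gk (negLap t η₁ + μ₁ • 1) Qk a1 *ᵥ (Qkᵀ *ᵥ Φ))) := by
  have h := phik_lattice (Equiv.refl S) (t₀ := t) (t₁ := t) (fun _ _ => rfl) hL hη hμ (Equiv.refl ι) Qk a1 c Φ
  simpa only [Matrix.reindex_refl_refl, scaleField_refl] using h

/-- **(lumpy) ON ONE INDEX SET**: passing from spacing `η₁` to `η₀ = Lη₁` with `μ̄ ↦ L⁻²μ̄`, `𝐚 ↦ L⁻²𝐚` (same rows `Q`,
same region `Ω₁`, same successor maps), the minimizer at `cΦ`, `cφ_{Ω₁ᶜ}` is `c` times the minimizer.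
[cite: Dimock2013BalabanII, §2.3 eq. (lumpy) (arXiv:1212.5562v2 TeX L920–938)] -/
theorem lumpy_self (t : E → S → S) {L η₀ η₁ μ₀ μ₁ : ℝ} (hL : L ≠ 0) (hη : η₀ = L * η₁) (hμ : μ₀ = (L ^ 2)⁻¹ * μ₁)
    (p : S → Prop) [DecidablePred p] {m : Type*} [Fintype m] (a : Matrix m m ℝ) (Qm : Matrix m {y // p y} ℝ)
    (c : ℝ) (Φ : m → ℝ) (φc : {y // ¬p y} → ℝ) :
    minimizer ((negLap t η₀ + μ₀ • 1).submatrix (Subtype.val : {x // p x} → S) Subtype.val) ((L ^ 2)⁻¹ • a) Qm (c • Φ)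
        (-((negLap t η₀).submatrix (Subtype.val : {x // p x} → S) (Subtype.val : {x // ¬p x} → S) *ᵥ (c • φc)))
      = c • minimizer ((negLap t η₁ + μ₁ • 1).submatrix (Subtype.val : {x // p x} → S) Subtype.val) a Qm Φ
          (-((negLap t η₁).submatrix (Subtype.val : {x // p x} → S) (Subtype.val : {x // ¬p x} → S) *ᵥ φc)) := by
  have h := lumpy_lattice (Equiv.refl S) (t₀ := t) (t₁ := t) (fun _ _ => rfl) hL hη hμ (p₀ := p) (p₁ := p)
    (fun _ => Iff.rfl) (Equiv.refl m) a Qm c Φ φc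
  simpa only [Matrix.reindex_refl_refl, Equiv.subtypeEquiv_refl, scaleField_refl] using h

end SameIndex

/-! ## Part 10 (v1.1) — *"The other terms in the exponent in (cloudy3) scale similarly, and thus they become …"* (II
L944–951): the THREE-TERM exponent of (nono)∕(cloudy3) — `½⟨φ_{Ω₁ᶜ}, [−Δ + μ̄_k]_{Ω₁ᶜ}φ_{Ω₁ᶜ}⟩ + ⟨φ_{Ω₁ᶜ}, [−Δ]_{Ω₁ᶜ,Ω₁}φ⟩ +
S_k(Ω₁, Φ, φ)` — on the lattice operators, and its scaling in one statement -/

section Nono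

variable {S : Type*} [Fintype S] [DecidableEq S] {E : Type*} [Fintype E]

/-- **the three-term exponent of (nono)∕(cloudy3)** as a function of the outside field `φ_{Ω₁ᶜ}`, the block variables `Φ`
and the inside field `φ` (at `φ = φ⁰` it is (nono); the Gaussian `Z`-integral of (cloudy3) is a constant not represented):
`½⟨φᶜ, [−Δ_η + μ̄]_{Ωᶜ}φᶜ⟩ + ⟨φᶜ, [−Δ_η]_{Ωᶜ,Ω}φ⟩ + S(Ω, Φ, φ)` with `S = MultiRegionFreeFlow.action` for the Dirichlet operator
`[−Δ_η + μ̄]_Ω` (the print writes the cross term as `⟨φ_{Ω₁ᶜ}, [−Δ]_{Ω₁,Ω₁ᶜ}φ⟩` with `[−Δ]_{Ω₁,Ω₁ᶜ} ≡ 1_{Ω₁}[−Δ]1_{Ω₁ᶜ}` (L590); the block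
used here is the transposed one, mapping `Ω`-fields to `Ωᶜ`-fields, and the two pairings agree by the symmetry of `−Δ_η` —
`nonoCross_comm`, v1.3). [cite: Dimock2013BalabanII, Lemma 2.3 (nono) (arXiv:1212.5562v2 TeX L777–792) and (cloudy3) (TeX
L911–918)] -/
noncomputable def nonoExponent (t : E → S → S) (η μ : ℝ) (p : S → Prop) [DecidablePred p] {m : Type*} [Fintype m]
    (a : Matrix m m ℝ) (Qm : Matrix m {y // p y} ℝ) (φc : {y // ¬p y} → ℝ) (Φ : m → ℝ) (φ : {y // p y} → ℝ) : ℝ :=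
  (1 / 2) * (φc ⬝ᵥ ((negLap t η + μ • 1).submatrix (Subtype.val : {x // ¬p x} → S)
      (Subtype.val : {x // ¬p x} → S) *ᵥ φc))
    + φc ⬝ᵥ ((negLap t η).submatrix (Subtype.val : {x // ¬p x} → S) (Subtype.val : {x // p x} → S) *ᵥ φ)
    + action ((negLap t η + μ • 1).submatrix (Subtype.val : {x // p x} → S) Subtype.val) a Qm Φ φ

variable {S₀ S₁ : Type*} [Fintype S₀] [Fintype S₁] [DecidableEq S₀] [DecidableEq S₁] (σ : S₁ ≃ S₀)

/-- **THE WHOLE EXPONENT SCALES BY `L⁻²c²`** (II L944–951): with the lattices the same graph, `η₀ = Lη₁`, `μ̄_k = L⁻²μ̄_{k+1}`,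
the region and its complement transported, the weights `L⁻²𝐚^τ` and rows `Q^{τσ}`: the three-term exponent of the scaled
problem at the scaled fields `([φᶜ]_c, [Φ]_c, [φ]_c)` is `L⁻²c²` times the unscaled exponent — hence EQUAL in the frame
`L⁻²c² = 1`, *"as expected"*. [cite: Dimock2013BalabanII, §2.3 (arXiv:1212.5562v2 TeX L944–951) and eq. (oooo) (TeX
L940–943)] -/
theorem nonoExponent_scale {t₀ : E → S₀ → S₀} {t₁ : E → S₁ → S₁} (ht : ∀ e y, σ (t₁ e y) = t₀ e (σ y))
    {L η₀ η₁ μ₀ μ₁ : ℝ} (hη : η₀ = L * η₁) (hμ : μ₀ = (L ^ 2)⁻¹ * μ₁)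
    {p₀ : S₀ → Prop} {p₁ : S₁ → Prop} [DecidablePred p₀] [DecidablePred p₁] (hp : ∀ y, p₁ y ↔ p₀ (σ y))
    {m₀ m₁ : Type*} [Fintype m₀] [Fintype m₁] (τ : m₁ ≃ m₀) (a : Matrix m₁ m₁ ℝ) (Qm : Matrix m₁ {y // p₁ y} ℝ)
    (c : ℝ) (φc : {y // ¬p₁ y} → ℝ) (Φ : m₁ → ℝ) (φ : {y // p₁ y} → ℝ) :
    nonoExponent t₀ η₀ μ₀ p₀ ((L ^ 2)⁻¹ • Matrix.reindex τ τ a) (Matrix.reindex τ (σ.subtypeEquiv hp) Qm)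
        (scaleField c (σ.subtypeEquiv fun y => not_congr (hp y)) φc) (scaleField c τ Φ)
        (scaleField c (σ.subtypeEquiv hp) φ)
      = ((L ^ 2)⁻¹ * c ^ 2) * nonoExponent t₁ η₁ μ₁ p₁ a Qm φc Φ φ := by
  unfold nonoExponent
  rw [negLap_add_mass_scale σ ht hη hμ, negLap_scale σ ht hη,
    block_scale σ _ _ (fun y => not_congr (hp y)) (fun y => not_congr (hp y)),
    block_scale σ _ _ (fun y => not_congr (hp y)) hp, block_scale σ _ _ hp hp, bilinear_scale, bilinear_scale,
    action_scale]
  ring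

/-- … and is INVARIANT in the frame `L⁻²c² = 1`. [cite: Dimock2013BalabanII, §2.3 (arXiv:1212.5562v2 TeX L944–951)] -/
theorem nonoExponent_scale_eq {t₀ : E → S₀ → S₀} {t₁ : E → S₁ → S₁} (ht : ∀ e y, σ (t₁ e y) = t₀ e (σ y))
    {L η₀ η₁ μ₀ μ₁ : ℝ} (hη : η₀ = L * η₁) (hμ : μ₀ = (L ^ 2)⁻¹ * μ₁)
    {p₀ : S₀ → Prop} {p₁ : S₁ → Prop} [DecidablePred p₀] [DecidablePred p₁] (hp : ∀ y, p₁ y ↔ p₀ (σ y))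
    {m₀ m₁ : Type*} [Fintype m₀] [Fintype m₁] (τ : m₁ ≃ m₀) (a : Matrix m₁ m₁ ℝ) (Qm : Matrix m₁ {y // p₁ y} ℝ)
    {c : ℝ} (hc : (L ^ 2)⁻¹ * c ^ 2 = 1) (φc : {y // ¬p₁ y} → ℝ) (Φ : m₁ → ℝ) (φ : {y // p₁ y} → ℝ) :
    nonoExponent t₀ η₀ μ₀ p₀ ((L ^ 2)⁻¹ • Matrix.reindex τ τ a) (Matrix.reindex τ (σ.subtypeEquiv hp) Qm)
        (scaleField c (σ.subtypeEquiv fun y => not_congr (hp y)) φc) (scaleField c τ Φ)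
        (scaleField c (σ.subtypeEquiv hp) φ)
      = nonoExponent t₁ η₁ μ₁ p₁ a Qm φc Φ φ := by
  rw [nonoExponent_scale σ ht hη hμ hp, hc, one_mul]

/-- **… IN PARTICULAR AT THE TWO MINIMIZERS** (`φ = φ⁰_{k+1,L𝛀⁺}` on the left, `φ = φ_{k+1,𝛀⁺}` on the right, related by
(lumpy)): (nono)'s value for the scaled problem equals the next-level value L946–949 — the exponential prefactor of
(cloudy3) *"becomes … as expected"*. [cite: Dimock2013BalabanII, §2.3 (arXiv:1212.5562v2 TeX L935–951)] -/
theorem nonoExponent_minimizer_scale_eq {t₀ : E → S₀ → S₀} {t₁ : E → S₁ → S₁} (ht : ∀ e y, σ (t₁ e y) = t₀ e (σ y))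
    {L η₀ η₁ μ₀ μ₁ : ℝ} (hL : L ≠ 0) (hη : η₀ = L * η₁) (hμ : μ₀ = (L ^ 2)⁻¹ * μ₁)
    {p₀ : S₀ → Prop} {p₁ : S₁ → Prop} [DecidablePred p₀] [DecidablePred p₁] (hp : ∀ y, p₁ y ↔ p₀ (σ y))
    {m₀ m₁ : Type*} [Fintype m₀] [Fintype m₁] (τ : m₁ ≃ m₀) (a : Matrix m₁ m₁ ℝ) (Qm : Matrix m₁ {y // p₁ y} ℝ)
    {c : ℝ} (hc : (L ^ 2)⁻¹ * c ^ 2 = 1) (φc : {y // ¬p₁ y} → ℝ) (Φ : m₁ → ℝ) :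
    let D₀ := (negLap t₀ η₀ + μ₀ • 1).submatrix (Subtype.val : {x // p₀ x} → S₀) Subtype.val
    let src₀ := -((negLap t₀ η₀).submatrix (Subtype.val : {x // p₀ x} → S₀) (Subtype.val : {x // ¬p₀ x} → S₀)
            *ᵥ scaleField c (σ.subtypeEquiv fun y => not_congr (hp y)) φc)
    let D₁ := (negLap t₁ η₁ + μ₁ • 1).submatrix (Subtype.val : {y // p₁ y} → S₁) Subtype.val
    let src₁ := -((negLap t₁ η₁).submatrix (Subtype.val : {y // p₁ y} → S₁) (Subtype.val : {y // ¬p₁ y} → S₁) *ᵥ φc)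
    nonoExponent t₀ η₀ μ₀ p₀ ((L ^ 2)⁻¹ • Matrix.reindex τ τ a) (Matrix.reindex τ (σ.subtypeEquiv hp) Qm)
        (scaleField c (σ.subtypeEquiv fun y => not_congr (hp y)) φc) (scaleField c τ Φ)
        (minimizer D₀ ((L ^ 2)⁻¹ • Matrix.reindex τ τ a) (Matrix.reindex τ (σ.subtypeEquiv hp) Qm) (scaleField c τ Φ)
          src₀)
      = nonoExponent t₁ η₁ μ₁ p₁ a Qm φc Φ (minimizer D₁ a Qm Φ src₁) := by
  intro D₀ src₀ D₁ src₁
  have h := lumpy_lattice σ ht hL hη hμ hp τ a Qm c Φ φc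
  simp only [D₀, src₀, D₁, src₁]
  rw [h]
  exact nonoExponent_scale_eq σ ht hη hμ hp τ a Qm hc φc Φ _

end Nono

/-! ## Part 11 (v1.2) — LEMMA 5 (scaling), FIRST claim: `ρ_{k+1}(Φ_{k+1}) = Z_{k+1}exp(−S_{k+1}(Φ_{k+1}, φ_{k+1}))` — the
density bookkeeping of gen 43's `RGStepNormalization` ((scaleddensity), (Ziterate)) composed with (lumpy)∕(oooo) -/

section Lemma5

open Literature.MathematicalPhysics.QuantumFieldTheory.Dimock2011to13.RGStepNormalization

variable {κ₀ κ₁ ι₀ ι₁ : Type*}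
variable (σ : κ₁ ≃ κ₀) (τ : ι₁ ≃ ι₀)

/-- the frame factor `L·√L = L^{3/2}` between the print's `Φ_{1,L} = L^{−1/2}Φ(·/L)` on `𝕋¹` (gen 43's
`scaledDensity` ∕ gen 42's `scaleConst L = (√L)⁻¹`) and the isometric coordinates of this module (reading (ii)):
`(L√L)·Φ_{L^{−1/2}} = Φ_L`, i.e. `c = L`. [cite: Dimock2013, §2.1 (arXiv:1108.1335v2 TeX L350–355, L377–381) and Lemma 5
(scaling) proof (TeX L814)] -/
theorem frame_smul_scaleField {L : ℝ} (hL : 0 < L) (Φ : ι₁ → ℝ) :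
    (L * Real.sqrt L) • scaleField (scaleConst L) τ Φ = scaleField L τ Φ := by
  rw [smul_scaleField, scaleConst, mul_assoc, mul_inv_cancel₀ (Real.sqrt_pos.mpr hL).ne', mul_one]

variable [Fintype κ₀] [Fintype κ₁] [Fintype ι₀] [Fintype ι₁] [DecidableEq κ₀] [DecidableEq κ₁]

/-- **LEMMA 5 (scaling), FIRST CLAIM, for (scaleddensity)** (I L797–799, proof L831–848 *"Now in ρ_{k+1}(Φ_{k+1}) we have
S⁰_{k+1}(Φ_{k+1,L}, φ_{k+1,L}) = … = S_{k+1}(Φ_{k+1}, φ_{k+1})  Thus ρ_{k+1}(Φ_{k+1}) = Z_k𝒩^{−1}_{a,𝕋¹}(2π)^{|𝕋⁰|/2}(det C_k)^{1/2}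
exp(−S_{k+1}(Φ_{k+1}, φ_{k+1}))"*): if `ρ̃_{k+1}(Ψ) = K·exp(−E⁰(Ψ, φ⁰(Ψ)))` with `E⁰` the exponent of the SCALED problem
(`MultiRegionFreeFlow.energy` with `D ↦ L⁻²D^σ`, `𝐚 ↦ L⁻²𝐚^τ`, `Q ↦ Q^{τσ}`, source `0`, read at the isometric coordinates
`(L√L)·Ψ` of the `𝕋¹`-field `Ψ` — reading (ii)) at ITS minimizer `φ⁰` (the form LEMMA `tiny` (understand) delivers —
`GaussianSingleStep.integral_exp_neg_J_minimizer` by name), then gen 43's `scaledDensity L τ ρ̃` — `ρ_{k+1}(Φ) =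
ρ̃(Φ_L)L^{−|𝕋¹|/2}` — IS `K·L^{−|𝕋¹|/2}·exp(−E(Φ, φ(Φ)))` with `E` the exponent of the UNSCALED problem at ITS minimizer:
`lumpy` + `oooo` under `exp` (frame `c = L`, `s = L⁻²`, `s·c² = 1`). [cite: Dimock2013, Lemma 5 (scaling) (arXiv:1108.1335v2
TeX L797–808) and its proof (TeX L814–848); Dimock2013, §2.1 eq. (scaleddensity) (TeX L425–429)] -/
theorem lemma5_scaledDensity {L : ℝ} (hL : 0 < L) (D : Matrix κ₁ κ₁ ℝ) (a : Matrix ι₁ ι₁ ℝ) (Qm : Matrix ι₁ κ₁ ℝ)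
    (K : ℝ) (Φ : ι₁ → ℝ) :
    scaledDensity L τ (fun Ψ => K * Real.exp (-(energy ((L ^ 2)⁻¹ • Matrix.reindex σ σ D)
        ((L ^ 2)⁻¹ • Matrix.reindex τ τ a) (Matrix.reindex τ σ Qm) ((L * Real.sqrt L) • Ψ) 0
        (minimizer ((L ^ 2)⁻¹ • Matrix.reindex σ σ D) ((L ^ 2)⁻¹ • Matrix.reindex τ τ a) (Matrix.reindex τ σ Qm)
          ((L * Real.sqrt L) • Ψ) 0)))) Φ
      = (K * jac L (Fintype.card ι₀)) * Real.exp (-(energy D a Qm Φ 0 (minimizer D a Qm Φ 0))) := by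
  rw [scaledDensity_apply, frame_smul_scaleField τ hL]
  have hs : (L ^ 2)⁻¹ ≠ 0 := inv_ne_zero (pow_ne_zero 2 hL.ne')
  have hsc : (L ^ 2)⁻¹ * L ^ 2 = 1 := inv_mul_cancel₀ (pow_ne_zero 2 hL.ne')
  have h0 : scaleField ((L ^ 2)⁻¹ * L) σ (0 : κ₁ → ℝ) = 0 := scaleField_zero _ _
  rw [← h0, energy_minimizer_scale_eq σ τ D a Qm hs hsc Φ 0]
  ring

/-- **… WITH THE CONSTANT (Ziterate)** (I L805–807 *"Z_{k+1} = Z_k𝒩^{−1}_{a,𝕋¹_{M+N−k}}(2π)^{|𝕋⁰_{M+N−k}|/2}(det C_k)^{1/2}"*, L848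
*"and the constant is identified as Z_{k+1}"*): with LEMMA `tiny`'s constant `K = Z⁰_{k+1} = 𝒩^{−1}_{aL,n}·g·Z_k` (`g` the
Gaussian factor `(2π)^{|𝕋⁰|/2}(det C_k)^{1/2}` — gen 43's `Z0next`) the scaled density is `Z_{k+1}·exp(−E(Φ, φ(Φ)))` with
`Z_{k+1} = Z_k·(𝒩^{−1}_{a,n}·g)` — gen 43's `Ziterate` BY NAME (`n = |𝕋¹_{M+N−k}| = |𝕋⁰_{M+N−k−1}|` as `Fintype.card ι₀`).
[cite: Dimock2013, Lemma 5 (scaling) eq. (Ziterate) (arXiv:1108.1335v2 TeX L805–807) and proof (TeX L843–848); Dimock2013,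
§2.1 (TeX L394)] -/
theorem lemma5_scaledDensity_Z {aw L : ℝ} (haw : 0 < aw) (hL : 0 < L) (D : Matrix κ₁ κ₁ ℝ) (a : Matrix ι₁ ι₁ ℝ)
    (Qm : Matrix ι₁ κ₁ ℝ) (g Zk : ℝ) (Φ : ι₁ → ℝ) :
    scaledDensity L τ (fun Ψ => Z0next aw L (Fintype.card ι₀) g Zk * Real.exp (-(energy
        ((L ^ 2)⁻¹ • Matrix.reindex σ σ D) ((L ^ 2)⁻¹ • Matrix.reindex τ τ a) (Matrix.reindex τ σ Qm)
        ((L * Real.sqrt L) • Ψ) 0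
        (minimizer ((L ^ 2)⁻¹ • Matrix.reindex σ σ D) ((L ^ 2)⁻¹ • Matrix.reindex τ τ a) (Matrix.reindex τ σ Qm)
          ((L * Real.sqrt L) • Ψ) 0)))) Φ
      = (Zk * ((normConst aw (Fintype.card ι₀))⁻¹ * g)) * Real.exp (-(energy D a Qm Φ 0 (minimizer D a Qm Φ 0))) := by
  rw [lemma5_scaledDensity σ τ hL, Ziterate haw hL]

/-- **PART I'S FORM** (single region, whole torus, scalar weight): with `𝐚 = a_{k+1}·1` the exponent at source `0` is
`S_{k+1}(Φ_{k+1}, φ) = ½a_{k+1}‖Φ_{k+1} − Q_{k+1}φ‖² + ½⟨φ, (−Δ + μ̄_{k+1})φ⟩` ((norton) L577–580, one level up) and its minimizer is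
`φ_{k+1}(Φ_{k+1}) = a_{k+1}G_{k+1}Qᵀ_{k+1}Φ_{k+1}` (L598–602): the scaled density of `K·exp(−S⁰_{k+1}(Ψ, φ⁰_{k+1}(Ψ)))` (S⁰ with
the weight `a_{k+1}L⁻²`, (hunger)'s `φ⁰_{k+1} = L⁻²a_{k+1}G⁰_{k+1}Qᵀ_{k+1}Ψ`) is `K·L^{−n/2}·exp(−S_{k+1}(Φ, φ_{k+1}(Φ)))`.
[cite: Dimock2013, Lemma 5 (scaling) (arXiv:1108.1335v2 TeX L797–803, L831–848); Dimock2013, §2.2 (TeX L577–602) and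
Lemma tungsten (hunger) (TeX L683–685)] -/
theorem lemma5_scaledDensity_partI [DecidableEq ι₀] [DecidableEq ι₁] {L : ℝ} (hL : 0 < L) (D : Matrix κ₁ κ₁ ℝ)
    (Qk : Matrix ι₁ κ₁ ℝ) (a1 K : ℝ) (Φ : ι₁ → ℝ) :
    scaledDensity L τ (fun Ψ => K * Real.exp (-(action ((L ^ 2)⁻¹ • Matrix.reindex σ σ D)
        (((L ^ 2)⁻¹ * a1) • (1 : Matrix ι₀ ι₀ ℝ)) (Matrix.reindex τ σ Qk) ((L * Real.sqrt L) • Ψ)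
        (((L ^ 2)⁻¹ * a1) • (Gk ((L ^ 2)⁻¹ • Matrix.reindex σ σ D) (Matrix.reindex τ σ Qk) ((L ^ 2)⁻¹ * a1)
          *ᵥ ((Matrix.reindex τ σ Qk)ᵀ *ᵥ ((L * Real.sqrt L) • Ψ))))))) Φ
      = (K * jac L (Fintype.card ι₀)) * Real.exp (-(action D (a1 • (1 : Matrix ι₁ ι₁ ℝ)) Qk Φ
          (a1 • (Gk D Qk a1 *ᵥ (Qkᵀ *ᵥ Φ))))) := by
  rw [scaledDensity_apply, frame_smul_scaleField τ hL]
  have hs : (L ^ 2)⁻¹ ≠ 0 := inv_ne_zero (pow_ne_zero 2 hL.ne')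
  have hsc : (L ^ 2)⁻¹ * L ^ 2 = 1 := inv_mul_cancel₀ (pow_ne_zero 2 hL.ne')
  have ha : ((L ^ 2)⁻¹ * a1) • (1 : Matrix ι₀ ι₀ ℝ) = (L ^ 2)⁻¹ • Matrix.reindex τ τ (a1 • (1 : Matrix ι₁ ι₁ ℝ)) := by
    rw [reindex_smul', Matrix.reindex_apply, Matrix.submatrix_one_equiv, smul_smul]
  rw [phik_scale σ τ D Qk a1 hs L Φ, ha, action_scale_eq σ τ D _ Qk hsc]
  ring

end Lemma5

/-! ## Part 12 (v1.3) — THE DIRICHLET OPERATOR IS POSITIVE DEFINITE: the hypothesis `D > 0` of `MultiRegionFreeFlow` ∕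
`FreeFlowSingleStep` (THEOREM 2.1's `G_{k,𝛀} = [−Δ + μ̄_k + …]⁻¹_{Ω₁}` exists) MET by `[−Δ_η + μ̄]_{Ω₁}`, `μ̄ > 0` -/

section Dirichlet

variable {S : Type*} [Fintype S] [DecidableEq S] {E : Type*} [Fintype E]

/-- **`[−Δ_η + μ̄]_{Ω₁} > 0`** — *"[−Δ]_Ω ≡ 1_Ω[−Δ]1_Ω is the Laplacian with Dirichlet boundary conditions"* (II L588–590) plus the
mass *"μ̄ > 0 is a fixed mass-squared"* (I L216): the principal block of the positive-definite `−Δ_η + μ̄`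
(`negLap_add_mass_posDef`) on any region is positive definite — the standing hypothesis `hD : D.PosDef` of
`MultiRegionFreeFlow.gInvO_posDef`∕`variational_eq`∕`energy_minimizer_lt`, `FreeFlowSingleStep.phi0_eq`∕`J_joint_min` and of
`GaussianSingleStep` DISCHARGED for the operator the print means. [cite: Dimock2013BalabanII, §2.2 (arXiv:1212.5562v2 TeX
L588–590) and Thm 2.1 (sinsin) (TeX L610–613); Dimock2013, §1.2 (arXiv:1108.1335v2 TeX L216)] -/
theorem dirichlet_negLap_add_mass_posDef (t : E → S → S) (η : ℝ) {μ : ℝ} (hμ : 0 < μ) (p : S → Prop) :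
    ((negLap t η + μ • (1 : Matrix S S ℝ)).submatrix (Subtype.val : {x // p x} → S) Subtype.val).PosDef :=
  (negLap_add_mass_posDef t η hμ).submatrix Subtype.val_injective

/-- without the mass the Dirichlet block `[−Δ_η]_{Ω₁}` is positive SEMIdefinite for every region (on the whole torus the
constants are in the kernel; definiteness on a proper region is a statement about the geometry not made here).
[cite: Dimock2013BalabanII, §2.2 (arXiv:1212.5562v2 TeX L588–590)] -/
theorem dirichlet_negLap_posSemidef (t : E → S → S) (η : ℝ) (p : S → Prop) :
    ((negLap t η).submatrix (Subtype.val : {x // p x} → S) Subtype.val).PosSemidef :=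
  (negLap_posSemidef t η).submatrix _

/-- **THE TWO ORIENTATIONS OF THE CROSS TERM AGREE** (an outside reader's INFO, cell journal l.25141): `⟨φᶜ, [−Δ_η]_{Ωᶜ,Ω}φ⟩ =
⟨φ, [−Δ_η]_{Ω,Ωᶜ}φᶜ⟩` by the symmetry of `−Δ_η` — (nono)'s `⟨φ_{Ω₁ᶜ}, [−Δ]_{Ω₁,Ω₁ᶜ}φ⟩` (L780, L947) read with either block.
[cite: Dimock2013BalabanII, §2.2 (arXiv:1212.5562v2 TeX L588–590) and Lemma 2.3 (nono) (TeX L777–783)] -/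
theorem nonoCross_comm (t : E → S → S) (η : ℝ) (p : S → Prop) [Fintype {x // p x}] [Fintype {x // ¬p x}]
    (φc : {x // ¬p x} → ℝ) (φ : {x // p x} → ℝ) :
    φc ⬝ᵥ ((negLap t η).submatrix (Subtype.val : {x // ¬p x} → S) (Subtype.val : {x // p x} → S) *ᵥ φ)
      = φ ⬝ᵥ ((negLap t η).submatrix (Subtype.val : {x // p x} → S) (Subtype.val : {x // ¬p x} → S) *ᵥ φc) := by
  rw [Matrix.dotProduct_mulVec, ← Matrix.mulVec_transpose, Matrix.transpose_submatrix, negLap_transpose,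
    dotProduct_comm]

end Dirichlet


/-! ## Part 13 (v1.4) — LEMMA 5 ASSEMBLED: THE FREE-FLOW RG STEP ON DENSITIES, *"ρ_k(Φ_k) = Z_k exp(−S_k(Φ_k, φ_k)) ⟹
ρ_{k+1}(Φ_{k+1}) = Z_{k+1}exp(−S_{k+1}(Φ_{k+1}, φ_{k+1}))"* for gen 43's `rgStep` ((kth) then (scaleddensity)) — I §2.3
L641–848 END TO END: (manx) → LEMMA `tiny` (gen 30's `GaussianSingleStep.integral_exp_neg_J_minimizer'`, BY NAME) →
(scaleddensity) (gen 43) → LEMMA 5 (scaling) (Parts 2–4, 11) -/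

section EmptyLayers

variable {κ ι T : Type*} [Fintype T] [IsEmpty T]

/-- a dot product over an empty index type vanishes. [folklore] -/
private theorem dotProduct_of_isEmpty' (v w : T → ℝ) : v ⬝ᵥ w = 0 := by
  simp [dotProduct]

/-- `Q_τᵀv = 0` when there are no layers `τ`. [folklore] -/
private theorem transpose_mulVec_of_isEmpty (Qτ : Matrix T κ ℝ) (v : T → ℝ) : Qτᵀ *ᵥ v = 0 := by
  ext i
  simp [Matrix.mulVec, dotProduct]

/-- `E = Q_τᵀ𝐚_τQ_τ = 0` when there are no layers `τ`. [folklore] -/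
private theorem restE_of_isEmpty (aτ : Matrix T T ℝ) (Qτ : Matrix T κ ℝ) : restE aτ Qτ = (0 : Matrix κ κ ℝ) := by
  ext i j
  simp [restE, Matrix.mul_apply]

variable [Fintype κ] [Fintype ι] [DecidableEq κ] [DecidableEq ι]

omit [DecidableEq κ] in
/-- **PART I INSIDE PART II's CARRIER — the exponent**: with NO small-field layers (`τ` empty: the whole torus is `Ω_{k+1}`,
I §2.3) the multi-region exponent `E((Φ_{k,Ω_{k+1}}, Φ_{k,δΩ}), φ)` of `MultiRegionFreeFlow` IS the single-region one with the
scalar weight `a_k`: `E = (a_k/2)‖Φ_k − Q_kφ‖² + ½⟨φ, (−Δ + μ̄_k)φ⟩ − ⟨φ, src⟩` ((norton) L577–580 with a source).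
[cite: Dimock2013, §2.2 (norton) (arXiv:1108.1335v2 TeX L577–580); Dimock2013BalabanII, §2.2 (sun) (arXiv:1212.5562v2 TeX
L666–669)] -/
theorem energy_emptyLayers (D : Matrix κ κ ℝ) (ak : ℝ) (aτ : Matrix T T ℝ) (Qk : Matrix ι κ ℝ) (Qτ : Matrix T κ ℝ)
    (Φι : ι → ℝ) (Φτ : T → ℝ) (src φ : κ → ℝ) :
    energy D (weightO ak aτ) (rowsO Qk Qτ) (Sum.elim Φι Φτ) src φ
      = energy D (ak • (1 : Matrix ι ι ℝ)) Qk Φι src φ := by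
  rw [energy_block]
  unfold energy action
  rw [dotProduct_of_isEmpty' (Φτ - Qτ *ᵥ φ), Matrix.smul_mulVec, Matrix.one_mulVec, dotProduct_smul, smul_eq_mul]
  ring

/-- **`G_{k,𝛀}` with the scalar weight `a_k·1` IS `G_k = (−Δ + μ̄_k + a_kQ_kᵀQ_k)⁻¹`** (L590–596;
`FluctuationCovarianceIdentity.Gk`). [cite: Dimock2013, §2.2 (arXiv:1108.1335v2 TeX L590–596)] -/
theorem GkO_smul_one (D : Matrix κ κ ℝ) (Qk : Matrix ι κ ℝ) (ak : ℝ) :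
    GkO D (ak • (1 : Matrix ι ι ℝ)) Qk = Gk D Qk ak := by
  unfold GkO gInvO Gk
  rw [Matrix.mul_smul, Matrix.mul_one, Matrix.smul_mul]

/-- **THE MINIMIZER WITH THE SCALAR WEIGHT IS `φ_k(Φ_k) = a_kG_kQ_kᵀΦ_k`** (L597–602). [cite: Dimock2013, §2.2
(arXiv:1108.1335v2 TeX L586–602)] -/
theorem minimizer_smul_one (D : Matrix κ κ ℝ) (Qk : Matrix ι κ ℝ) (ak : ℝ) (Φ : ι → ℝ) :
    minimizer D (ak • (1 : Matrix ι ι ℝ)) Qk Φ 0 = ak • (Gk D Qk ak *ᵥ (Qkᵀ *ᵥ Φ)) := by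
  unfold minimizer
  rw [GkO_smul_one, add_zero, Matrix.smul_mulVec, Matrix.one_mulVec, Matrix.mulVec_smul, Matrix.mulVec_smul]

/-- **PART I INSIDE PART II's CARRIER — the minimizer**: with no layers the multi-region minimizer
`φ_{k,𝛀}(Φ_{k,𝛀}, src)` IS the single-region one with the scalar weight. [cite: Dimock2013, §2.2 (arXiv:1108.1335v2 TeX
L586–602); Dimock2013BalabanII, Thm 2.1 (sinsin) (arXiv:1212.5562v2 TeX L610–613)] -/
theorem minimizer_emptyLayers (D : Matrix κ κ ℝ) (ak : ℝ) (aτ : Matrix T T ℝ) (Qk : Matrix ι κ ℝ) (Qτ : Matrix T κ ℝ)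
    (Φι : ι → ℝ) (Φτ : T → ℝ) (src : κ → ℝ) :
    minimizer D (weightO ak aτ) (rowsO Qk Qτ) (Sum.elim Φι Φτ) src = minimizer D (ak • (1 : Matrix ι ι ℝ)) Qk Φι src := by
  unfold minimizer
  rw [GkO_block, restE_of_isEmpty, add_zero, GkO_smul_one]
  congr 1
  unfold weightO rowsO
  rw [Matrix.transpose_fromRows, Matrix.fromBlocks_mulVec, Matrix.fromCols_mulVec_sumElim]
  simp only [Sum.elim_comp_inl, Sum.elim_comp_inr, Matrix.zero_mulVec, add_zero, zero_add,
    transpose_mulVec_of_isEmpty]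

end EmptyLayers

section FreeFlowStep

open MeasureTheory
open Literature.MathematicalPhysics.QuantumFieldTheory.Dimock2011to13.RGStepNormalization
open Literature.MathematicalPhysics.QuantumFieldTheory.Dimock2011to13.GaussianSingleStep
  (integral_exp_neg_J_minimizer')

variable {κ β ι₀ : Type*} [Fintype κ] [Fintype β] [Fintype ι₀] [DecidableEq κ] [DecidableEq β] [DecidableEq ι₀]

/-- **(only)'s FORM OF THE DENSITY**: `ρ_k(Φ_k) = Z_k exp(−S_k(Φ_k, φ_k))` with `S_k(Φ_k, φ) = (a_k/2)‖Φ_k − Q_kφ‖² + ½⟨φ, (−Δ +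
μ̄_k)φ⟩` ((norton), `MultiRegionFreeFlow.action` with the scalar weight `a_k·1`) at its minimizer `φ_k(Φ_k) = a_kG_kQ_kᵀΦ_k`
(L597–602), for an abstract operator `D` (print: `−Δ + μ̄_k`), rows `Q_k`, weight `a_k` and constant `Z_k`.
[cite: Dimock2013, §2.2 eqs. (norton), (only) (arXiv:1108.1335v2 TeX L577–580, L610–620)] -/
noncomputable def freeDensity (D : Matrix κ κ ℝ) (Qk : Matrix β κ ℝ) (ak Zk : ℝ) : (β → ℝ) → ℝ :=
  fun Φ => Zk * Real.exp (-(action D (ak • (1 : Matrix β β ℝ)) Qk Φ (ak • (Gk D Qk ak *ᵥ (Qkᵀ *ᵥ Φ)))))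

/-- (only) unfolded. [cite: Dimock2013, §2.2 eq. (only) (arXiv:1108.1335v2 TeX L610–613)] -/
theorem freeDensity_apply (D : Matrix κ κ ℝ) (Qk : Matrix β κ ℝ) (ak Zk : ℝ) (Φ : β → ℝ) :
    freeDensity D Qk ak Zk Φ
      = Zk * Real.exp (-(action D (ak • (1 : Matrix β β ℝ)) Qk Φ (ak • (Gk D Qk ak *ᵥ (Qkᵀ *ᵥ Φ))))) := rfl

/-- the same with `MultiRegionFreeFlow.energy` at source `0` and `MultiRegionFreeFlow.minimizer` (the shape of Part 11).
[cite: Dimock2013, §2.2 eqs. (norton), (only) (arXiv:1108.1335v2 TeX L577–580, L610–620)] -/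
theorem freeDensity_eq_energy (D : Matrix κ κ ℝ) (Qk : Matrix β κ ℝ) (ak Zk : ℝ) (Φ : β → ℝ) :
    freeDensity D Qk ak Zk Φ
      = Zk * Real.exp (-(energy D (ak • (1 : Matrix β β ℝ)) Qk Φ 0
          (minimizer D (ak • (1 : Matrix β β ℝ)) Qk Φ 0))) := by
  unfold freeDensity energy
  rw [dotProduct_zero, sub_zero, minimizer_smul_one]

omit [DecidableEq ι₀] in
/-- **(manx) — THE INTEGRAND OF (kth) AGAINST `ρ_k = Z_ke^{−S_k(Φ_k, φ_k)}` IS `Z_ke^{−J(Φ_{k+1}, Φ_k, φ_k(Φ_k))}`** (L651–662: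
*"ρ̃_{k+1}(Φ_{k+1}) = 𝒩^{−1}_{aL,𝕋¹}Z_k∫exp(−(a/2L²)‖Φ_{k+1} − QΦ_k‖² − S_k(Φ_k, φ_k))dΦ_k = 𝒩^{−1}_{aL,𝕋¹}Z_k∫exp(−J(Φ_{k+1}, Φ_k,
φ_k))dΦ_k"*), with gen 30's `FreeFlowSingleStep.J` (no layers, source `0`) and the frames of reading (ii): (kth)'s second
line has the unweighted width `aL` and the LITERAL averaging `Q = L⁻³Σ_{x∈B(y)} = (L√L)⁻¹·Q̂` (`Q̂Q̂ᵀ = 1` the isometric one),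
and `½aL|Ψ − (L√L)⁻¹Q̂Φ_k|² = ½(a/L²)|(L√L)Ψ − Q̂Φ_k|²` — `J`'s first term at the isometric coordinates `(L√L)Ψ` of the
`𝕋¹`-field with `aL ↦ a/L²`. [cite: Dimock2013, §2.3 eq. (manx) (arXiv:1108.1335v2 TeX L651–662) and §2.1 (kth) (TeX
L414–421, L350–355)] -/
theorem blockKernel_mul_freeDensity {L : ℝ} (hL : 0 < L) (D : Matrix κ κ ℝ) (Qk : Matrix β κ ℝ) (Qh : Matrix ι₀ β ℝ)
    (a ak Zk : ℝ) (Ψ : ι₀ → ℝ) (Φι : β → ℝ) :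
    Real.exp (-(a * L / 2) * sqNorm (Ψ - ((L * Real.sqrt L)⁻¹ • Qh) *ᵥ Φι)) * freeDensity D Qk ak Zk Φι
      = Zk * Real.exp (-FreeFlowSingleStep.J D ak (0 : Matrix PEmpty.{1} PEmpty.{1} ℝ) Qk (0 : Matrix PEmpty.{1} κ ℝ) Qh (a / L ^ 2)
          ((L * Real.sqrt L) • Ψ) 0 0 Φι
          (minimizer D (weightO ak (0 : Matrix PEmpty.{1} PEmpty.{1} ℝ)) (rowsO Qk (0 : Matrix PEmpty.{1} κ ℝ))
            (Sum.elim Φι 0) 0)) := by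
  rw [minimizer_emptyLayers, minimizer_smul_one]
  unfold FreeFlowSingleStep.J freeDensity
  rw [energy_emptyLayers]
  unfold energy
  rw [dotProduct_zero, sub_zero]
  have hc : L * Real.sqrt L ≠ 0 := mul_ne_zero hL.ne' (Real.sqrt_pos.mpr hL).ne'
  have h1 : Ψ - ((L * Real.sqrt L)⁻¹ • Qh) *ᵥ Φι = (L * Real.sqrt L)⁻¹ • ((L * Real.sqrt L) • Ψ - Qh *ᵥ Φι) := by
    rw [smul_sub, smul_smul, inv_mul_cancel₀ hc, one_smul, Matrix.smul_mulVec]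
  have h2 : ((L * Real.sqrt L)⁻¹) ^ 2 = (L ^ 3)⁻¹ := by
    rw [inv_pow, mul_pow, Real.sq_sqrt hL.le]; ring
  rw [h1, sqNorm_smul, sqNorm_eq_dotProduct, h2]
  have h3 : -(a * L / 2) * ((L ^ 3)⁻¹ * (((L * Real.sqrt L) • Ψ - Qh *ᵥ Φι) ⬝ᵥ ((L * Real.sqrt L) • Ψ - Qh *ᵥ Φι)))
      = -((a / L ^ 2) / 2 * (((L * Real.sqrt L) • Ψ - Qh *ᵥ Φι) ⬝ᵥ ((L * Real.sqrt L) • Ψ - Qh *ᵥ Φι))) := by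
    field_simp
  rw [h3, mul_left_comm, ← Real.exp_add, neg_add]

/-- **LEMMA `tiny` (understand) FOR THE DENSITY (kth)**: *"Let ρ_k(Φ_k) = Z_k exp(−S_k(Φ_k, φ_k)). Then ρ̃_{k+1}(Φ_{k+1}) =
Z_k𝒩^{−1}_{aL,𝕋¹}(2π)^{|𝕋⁰|/2}(det C_k)^{1/2}exp(−S⁰_{k+1}(Φ_{k+1}, φ⁰_{k+1})) where C_k = (Δ_k + (a/L²)QᵀQ)⁻¹"* — gen 43's
`blockDensity (aL) Q ρ_k` COMPUTED by gen 30's `integral_exp_neg_J_minimizer'` (BY NAME, no layers, source 0): the value is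
`𝒩^{−1}_{aL,n}·Z_k·(2π)^{|𝕋⁰|/2}(det C_{k,0})^{1/2}·exp(−S⁰_{k+1}(Ψ̂, φ⁰_{k+1}(Ψ̂)))` with `S⁰_{k+1}` = the action with weight
`a′ = aNext a_k (a/L²)` (= `a_{k+1}L⁻²`, (ak)) and rows `Q_{k+1} = Q̂Q_k`, at ITS minimizer, read at the isometric coordinates
`Ψ̂ = (L√L)Ψ`; `C_{k,0} = FluctuationCovarianceIdentity.Ckr … 0 = (Δ_k + (a/L²)Q̂ᵀQ̂)⁻¹`. Hypotheses: `D > 0` (met by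
`negLap_add_mass_posDef`), `Q̂Q̂ᵀ = 1` (met by `BlockAveragingMatrix.Qmat_mul_transpose`), `a, a_k, L > 0`.
[cite: Dimock2013, §2.3 Lemma tiny (understand) (arXiv:1108.1335v2 TeX L748–759) with proof (TeX L762–794); Dimock2013,
§2.1 (kth) (TeX L414–421)] -/
theorem blockDensity_freeDensity {L a ak : ℝ} (hL : 0 < L) (ha : 0 < a) (hak : 0 < ak) {D : Matrix κ κ ℝ}
    (hD : D.PosDef) (Qk : Matrix β κ ℝ) {Qh : Matrix ι₀ β ℝ} (hQ : Qh * Qhᵀ = 1) (Zk : ℝ) (Ψ : ι₀ → ℝ) :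
    blockDensity (a * L) (fun Φι : β → ℝ => ((L * Real.sqrt L)⁻¹ • Qh) *ᵥ Φι) (freeDensity D Qk ak Zk) Ψ
      = (normConst (a * L) (Fintype.card ι₀))⁻¹
          * (Zk * (Real.sqrt (2 * Real.pi) ^ Fintype.card β * Real.sqrt (Ckr D Qk Qh ak (a / L ^ 2) 0).det))
          * Real.exp (-(energy D (aNext ak (a / L ^ 2) • (1 : Matrix ι₀ ι₀ ℝ)) (Qh * Qk) ((L * Real.sqrt L) • Ψ) 0
              (minimizer D (aNext ak (a / L ^ 2) • (1 : Matrix ι₀ ι₀ ℝ)) (Qh * Qk) ((L * Real.sqrt L) • Ψ) 0))) := by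
  rw [blockDensity_apply]
  simp_rw [blockKernel_mul_freeDensity hL D Qk Qh a ak Zk Ψ]
  have haL : (0 : ℝ) ≤ a / L ^ 2 := by positivity
  rw [integral_const_mul, integral_exp_neg_J_minimizer' hD Matrix.PosSemidef.zero hQ hak haL]
  unfold energyNext phi0
  rw [energy_emptyLayers, minimizer_emptyLayers, CkOr_eq_Ckr, restE_of_isEmpty, add_zero]
  ring

variable {κ₁ ι₁ : Type*} [Fintype κ₁] [Fintype ι₁] [DecidableEq κ₁] [DecidableEq ι₁]
variable (σ : κ₁ ≃ κ) (τ : ι₁ ≃ ι₀)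

/-- **LEMMA 5 (scaling), ASSEMBLED — THE FREE-FLOW RG STEP**: *"Let ρ_k(Φ_k) = Z_k exp(−S_k(Φ_k, φ_k)). Then ρ_{k+1}(Φ_{k+1}) =
Z_{k+1}exp(−S_{k+1}(Φ_{k+1}, φ_{k+1})) where Z_{k+1} = Z_k𝒩^{−1}_{a,𝕋¹_{M+N−k}}(2π)^{|𝕋⁰_{M+N−k}|/2}(det C_k)^{1/2}"* — for gen
43's `rgStep a L Q` ((kth) at width `aL` with the literal averaging `Q = (L√L)⁻¹Q̂`, then (scaleddensity)) applied to
(only)'s `freeDensity D Q_k a_k Z_k` on the level-`k` lattices (`κ` fine, `β` blocks, `ι₀` the next blocks `𝕋¹`), the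
result IS `freeDensity D₁ Q_{k+1} a_{k+1} Z_{k+1}` on the level-`(k+1)` lattices (`κ₁ ≃ κ` by `σ`, `ι₁ ≃ ι₀` by `τ`: *"y ↦ Ly"*)
whenever the level-`(k+1)` data are the scaled ones: `−Δ_{η_k} + μ̄_k = L⁻²(−Δ_{η_{k+1}} + μ̄_{k+1})^σ` (`hD1`, discharged for
the lattice operators by `negLap_add_mass_scale`), `Q̂Q_k = Q_{k+1}^{τσ}` (`hQn`: *"Q is scale invariant"*, `blockAvgMat_scale`),
`aNext a_k (a/L²) = a_{k+1}L⁻²` (`ha1`: (ak) L516–518, `BlockAveragingComposition.aNext_aK`). Chain: (manx) + LEMMA `tiny`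
(`blockDensity_freeDensity`) → (scaleddensity) + second claim + (Ziterate) (`lemma5_scaledDensity_Z`). NO hypothesis on
the form of `ρ̃_{k+1}` remains (v1.2's Part 11 took LEMMA `tiny`'s output shape as input).
[cite: Dimock2013, Lemma 5 (scaling) (arXiv:1108.1335v2 TeX L797–808) with proof (TeX L810–848); Dimock2013, §2.3
(manx) L651–662, Lemma tiny (understand) L748–759; Dimock2013, §2.1 (kth), (scaleddensity) (TeX L414–429)] -/
theorem lemma5_rgStep {L a ak a1 : ℝ} (hL : 0 < L) (ha : 0 < a) (hak : 0 < ak) {D : Matrix κ κ ℝ} (hD : D.PosDef)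
    {Qk : Matrix β κ ℝ} {Qh : Matrix ι₀ β ℝ} (hQ : Qh * Qhᵀ = 1) {D₁ : Matrix κ₁ κ₁ ℝ} {Qn₁ : Matrix ι₁ κ₁ ℝ}
    (hD1 : D = (L ^ 2)⁻¹ • Matrix.reindex σ σ D₁) (hQn : Qh * Qk = Matrix.reindex τ σ Qn₁)
    (ha1 : aNext ak (a / L ^ 2) = (L ^ 2)⁻¹ * a1) (Zk : ℝ) :
    rgStep a L (fun Φι : β → ℝ => ((L * Real.sqrt L)⁻¹ • Qh) *ᵥ Φι) τ (freeDensity D Qk ak Zk)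
      = freeDensity D₁ Qn₁ a1
          (Zk * ((normConst a (Fintype.card ι₀))⁻¹
            * (Real.sqrt (2 * Real.pi) ^ Fintype.card β * Real.sqrt (Ckr D Qk Qh ak (a / L ^ 2) 0).det))) := by
  funext Φ
  have hform : blockDensity (a * L) (fun Φι : β → ℝ => ((L * Real.sqrt L)⁻¹ • Qh) *ᵥ Φι) (freeDensity D Qk ak Zk)
      = fun Ψ => Z0next a L (Fintype.card ι₀)
          (Real.sqrt (2 * Real.pi) ^ Fintype.card β * Real.sqrt (Ckr D Qk Qh ak (a / L ^ 2) 0).det) Zk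
        * Real.exp (-(energy ((L ^ 2)⁻¹ • Matrix.reindex σ σ D₁)
            ((L ^ 2)⁻¹ • Matrix.reindex τ τ (a1 • (1 : Matrix ι₁ ι₁ ℝ))) (Matrix.reindex τ σ Qn₁)
            ((L * Real.sqrt L) • Ψ) 0
            (minimizer ((L ^ 2)⁻¹ • Matrix.reindex σ σ D₁) ((L ^ 2)⁻¹ • Matrix.reindex τ τ (a1 • (1 : Matrix ι₁ ι₁ ℝ)))
              (Matrix.reindex τ σ Qn₁) ((L * Real.sqrt L) • Ψ) 0))) := by
    funext Ψ
    have haw : aNext ak (a / L ^ 2) • (1 : Matrix ι₀ ι₀ ℝ)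
        = (L ^ 2)⁻¹ • Matrix.reindex τ τ (a1 • (1 : Matrix ι₁ ι₁ ℝ)) := by
      rw [ha1, reindex_smul', Matrix.reindex_apply, Matrix.submatrix_one_equiv, smul_smul]
    rw [blockDensity_freeDensity hL ha hak hD Qk hQ, Z0next, haw, hQn, ← hD1]
    ring
  rw [rgStep_eq, hform, lemma5_scaledDensity_Z σ τ ha hL, freeDensity_eq_energy]

/-- **LEMMA 5 WITH THE LATTICE OPERATORS** — `D = −Δ_{η_k} + μ̄_k`, `D₁ = −Δ_{η_{k+1}} + μ̄_{k+1}` on relabelled lattices with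
commuting shifts (`ht`), `η_k = Lη_{k+1}` ((lattice1)), `μ̄_k = L⁻²μ̄_{k+1}` (L583), `μ̄_k > 0` ((three0) L216): the
hypotheses `hD` (positivity, `negLap_add_mass_posDef`) and `hD1` (scaling, `negLap_add_mass_scale`) of `lemma5_rgStep`
DISCHARGED. [cite: Dimock2013, Lemma 5 (scaling) (arXiv:1108.1335v2 TeX L797–808, proof L810–848); Dimock2013, §1.2 eqs.
(three0), (lattice1) (TeX L205–216) and §2.2 (TeX L583)] -/
theorem lemma5_rgStep_lattice {E : Type*} [Fintype E] {t₀ : E → κ → κ} {t₁ : E → κ₁ → κ₁}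
    (ht : ∀ e y, σ (t₁ e y) = t₀ e (σ y)) {L η₀ η₁ μ₀ μ₁ a ak a1 : ℝ} (hL : 0 < L) (hη : η₀ = L * η₁)
    (hμ : μ₀ = (L ^ 2)⁻¹ * μ₁) (hμ₀ : 0 < μ₀) (ha : 0 < a) (hak : 0 < ak) {Qk : Matrix β κ ℝ} {Qh : Matrix ι₀ β ℝ}
    (hQ : Qh * Qhᵀ = 1) {Qn₁ : Matrix ι₁ κ₁ ℝ} (hQn : Qh * Qk = Matrix.reindex τ σ Qn₁)
    (ha1 : aNext ak (a / L ^ 2) = (L ^ 2)⁻¹ * a1) (Zk : ℝ) :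
    rgStep a L (fun Φι : β → ℝ => ((L * Real.sqrt L)⁻¹ • Qh) *ᵥ Φι) τ
        (freeDensity (negLap t₀ η₀ + μ₀ • (1 : Matrix κ κ ℝ)) Qk ak Zk)
      = freeDensity (negLap t₁ η₁ + μ₁ • (1 : Matrix κ₁ κ₁ ℝ)) Qn₁ a1
          (Zk * ((normConst a (Fintype.card ι₀))⁻¹
            * (Real.sqrt (2 * Real.pi) ^ Fintype.card β
              * Real.sqrt (Ckr (negLap t₀ η₀ + μ₀ • (1 : Matrix κ κ ℝ)) Qk Qh ak (a / L ^ 2) 0).det))) :=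
  lemma5_rgStep σ τ hL ha hak (negLap_add_mass_posDef t₀ η₀ hμ₀) hQ (negLap_add_mass_scale σ ht hη hμ) hQn ha1 Zk

/-- `√(L³) = L√L` (`L ≥ 0`). [folklore] -/
private theorem sqrt_pow_three {L : ℝ} (hL : 0 ≤ L) : Real.sqrt (L ^ 3) = L * Real.sqrt L := by
  rw [pow_succ, Real.sqrt_mul (sq_nonneg L), Real.sqrt_sq hL]

open BlockAveragingMatrix (fibre Qmat Qmat_mul_transpose) in
/-- **LEMMA 5 WITH THE PRINTED AVERAGING OPERATOR** *"(Qf)(y) = L⁻³Σ_{x∈B(y)}f(x) … B(y) is cubes of L³ sites"* (L317–324):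
gen 43's `avgMat b N` for a block map `b` with fibres of `N = L³` sites IS `(L√L)⁻¹·Q̂` with `Q̂ = BlockAveragingMatrix.Qmat b N`,
`Q̂Q̂ᵀ = 1` (`Qmat_mul_transpose`) — the hypothesis `hQ` of `lemma5_rgStep` DISCHARGED and (kth) taken with the literal `Q`.
[cite: Dimock2013, Lemma 5 (scaling) (arXiv:1108.1335v2 TeX L797–808); Dimock2013, §2.1 (TeX L317–336) and (kth) (TeX
L414–421)] -/
theorem lemma5_rgStep_avg {b : β → ι₀} {N : ℕ} (hb : ∀ y, (fibre b y).card = N) {L a ak a1 : ℝ} (hL : 0 < L)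
    (hN : (N : ℝ) = L ^ 3) (ha : 0 < a) (hak : 0 < ak) {D : Matrix κ κ ℝ} (hD : D.PosDef) {Qk : Matrix β κ ℝ}
    {D₁ : Matrix κ₁ κ₁ ℝ} {Qn₁ : Matrix ι₁ κ₁ ℝ} (hD1 : D = (L ^ 2)⁻¹ • Matrix.reindex σ σ D₁)
    (hQn : Qmat b N * Qk = Matrix.reindex τ σ Qn₁) (ha1 : aNext ak (a / L ^ 2) = (L ^ 2)⁻¹ * a1) (Zk : ℝ) :
    rgStep a L (fun Φι : β → ℝ => avgMat b N *ᵥ Φι) τ (freeDensity D Qk ak Zk)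
      = freeDensity D₁ Qn₁ a1
          (Zk * ((normConst a (Fintype.card ι₀))⁻¹
            * (Real.sqrt (2 * Real.pi) ^ Fintype.card β * Real.sqrt (Ckr D Qk (Qmat b N) ak (a / L ^ 2) 0).det))) := by
  have hNpos : 0 < N := by
    have h : (0 : ℝ) < N := by rw [hN]; positivity
    exact_mod_cast h
  have hs : (Real.sqrt (N : ℝ))⁻¹ = (L * Real.sqrt L)⁻¹ := by rw [hN, sqrt_pow_three hL.le]
  rw [avgMat_eq_smul_Qmat, hs]
  exact lemma5_rgStep σ τ hL ha hak hD (Qmat_mul_transpose hb hNpos) hD1 hQn ha1 Zk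

open Literature.MathematicalPhysics.QuantumFieldTheory.King1986 (aK) in
open BlockAveragingComposition (aNext_aK) in
/-- **(ak) FOR THE PRINTED WIDTHS**: with `a_k = aK a L k = a(1 − L⁻²)/(1 − L^{−2k})` (LEMMA `second`, L459–461; the tree's
`King1986.aK`) the hypothesis `ha1` of `lemma5_rgStep` holds with `a_{k+1} = aK a L (k+1)` — gen 30's
`BlockAveragingComposition.aNext_aK` (`L > 1`, `k ≥ 1`). [cite: Dimock2013, §2.1 Lemma second (arXiv:1108.1335v2 TeX
L459–461) and §2.2 eq. (ak) (TeX L516–518)] -/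
theorem aNext_aK_div {a L : ℝ} (ha : 0 < a) (hL : 1 < L) {k : ℕ} (hk : 1 ≤ k) :
    aNext (aK a L k) (a / L ^ 2) = (L ^ 2)⁻¹ * aK a L (k + 1) := by
  rw [div_eq_mul_inv, aNext_aK ha hL hk, mul_comm]

open Literature.MathematicalPhysics.QuantumFieldTheory.King1986 (aK aK_pos) in
open BlockAveragingMatrix (fibre Qmat) in
/-- **LEMMA 5 AS PRINTED — every analytic hypothesis discharged**: lattice operators `−Δ_{η_k} + μ̄_k` (`μ̄_k > 0`, `η_k =
Lη_{k+1}`, `μ̄_k = L⁻²μ̄_{k+1}`), the printed averaging `Q = L⁻³Σ_{B(y)}` over cubes of `L³` sites, the printed widths `a_k =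
aK a L k` (L459–461), `a > 0`, `L > 1`, `k ≥ 1`: *"ρ_k = Z_ke^{−S_k(Φ_k,φ_k)} ⟹ ρ_{k+1} = Z_{k+1}e^{−S_{k+1}(Φ_{k+1},φ_{k+1})}, Z_{k+1} =
Z_k𝒩^{−1}_{a,𝕋¹}(2π)^{|𝕋⁰|/2}(det C_k)^{1/2}"*. What stays hypothesis is GEOMETRY only: the relabellings `y ↦ Ly` commute with
the shifts (`ht`) and transport `Q_{k+1} = QQ_k` (`hQn`), and the blocks have `L³` sites (`hb`, `hN`).
[cite: Dimock2013, Lemma 5 (scaling) (arXiv:1108.1335v2 TeX L797–808) with proof (TeX L810–848); Dimock2013, §2.1–2.2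
(TeX L317–336, L414–429, L459–461, L516–518, L577–620)] -/
theorem lemma5_printed {E : Type*} [Fintype E] {t₀ : E → κ → κ} {t₁ : E → κ₁ → κ₁}
    (ht : ∀ e y, σ (t₁ e y) = t₀ e (σ y)) {b : β → ι₀} {N : ℕ} (hb : ∀ y, (fibre b y).card = N)
    {L η₀ η₁ μ₀ μ₁ a : ℝ} (hL : 1 < L) (hN : (N : ℝ) = L ^ 3) (hη : η₀ = L * η₁) (hμ : μ₀ = (L ^ 2)⁻¹ * μ₁)
    (hμ₀ : 0 < μ₀) (ha : 0 < a) {k : ℕ} (hk : 1 ≤ k) {Qk : Matrix β κ ℝ} {Qn₁ : Matrix ι₁ κ₁ ℝ}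
    (hQn : Qmat b N * Qk = Matrix.reindex τ σ Qn₁) (Zk : ℝ) :
    rgStep a L (fun Φι : β → ℝ => avgMat b N *ᵥ Φι) τ
        (freeDensity (negLap t₀ η₀ + μ₀ • (1 : Matrix κ κ ℝ)) Qk (aK a L k) Zk)
      = freeDensity (negLap t₁ η₁ + μ₁ • (1 : Matrix κ₁ κ₁ ℝ)) Qn₁ (aK a L (k + 1))
          (Zk * ((normConst a (Fintype.card ι₀))⁻¹
            * (Real.sqrt (2 * Real.pi) ^ Fintype.card β
              * Real.sqrt (Ckr (negLap t₀ η₀ + μ₀ • (1 : Matrix κ κ ℝ)) Qk (Qmat b N) (aK a L k)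
                  (a / L ^ 2) 0).det))) :=
  lemma5_rgStep_avg σ τ hb (lt_trans zero_lt_one hL) hN ha (aK_pos ha hL hk) (negLap_add_mass_posDef t₀ η₀ hμ₀)
    (negLap_add_mass_scale σ ht hη hμ) hQn (aNext_aK_div ha hL hk) Zk

end FreeFlowStep


/-! ## Part 14 (v1.5) — THE FREE FLOW ALONG THE WHOLE TRAJECTORY: *"ρ_k(Φ_k) = Z_k exp(−S_k(Φ_k, φ_k))"* ((only) L610–613)
FOR EVERY `k ≥ 1` of gen 43's `densitySeq` started at (def2) `ρ₀ = exp(−½⟨Φ₀, (−Δ + μ̄₀)Φ₀⟩)` (L562–565) — the base step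
((first) for the Gaussian start, gen 30's `integral_exp_neg_energy` BY NAME) and the induction of §2.3 (Part 13's
`lemma5_rgStep`), with `Z_k` = gen 42's `Zseq` of the one-step factors ((Ziterate); II THEOREM 3.1 item 1 «Z₀ = 1») -/

section FreeFlowTower

open MeasureTheory
open Literature.MathematicalPhysics.QuantumFieldTheory.Dimock2011to13.RGStepNormalization
open Literature.MathematicalPhysics.QuantumFieldTheory.Dimock2011to13.GaussianSingleStep
  (fineConst integral_exp_neg_energy)
open Literature.MathematicalPhysics.QuantumFieldTheory.King1986 (aK aK_one aK_pos)

section Base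

variable {β ι₀ κ₁ ι₁ : Type*} [Fintype β] [Fintype ι₀] [Fintype κ₁] [Fintype ι₁]
  [DecidableEq β] [DecidableEq ι₀] [DecidableEq κ₁] [DecidableEq ι₁]

omit [DecidableEq β] [DecidableEq ι₀] in
/-- the exponent of (kth)'s second line against the isometric one of (first)'s first line: `½aL|Ψ − (L√L)⁻¹Q̂Φ|² =
½(a/L²)|(L√L)Ψ − Q̂Φ|²` (L340–355: *"in the first expression norms are taken with the natural metric … In the second
expression we use an unweighted sum"*). [cite: Dimock2013, §2.1 eq. (first0) and the two frames (arXiv:1108.1335v2 TeX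
L340–355)] -/
theorem kth_exponent_eq {L : ℝ} (hL : 0 < L) (a : ℝ) (Qh : Matrix ι₀ β ℝ) (Ψ : ι₀ → ℝ) (Φ : β → ℝ) :
    (a * L / 2) * sqNorm (Ψ - ((L * Real.sqrt L)⁻¹ • Qh) *ᵥ Φ)
      = (a / L ^ 2) / 2 * (((L * Real.sqrt L) • Ψ - Qh *ᵥ Φ) ⬝ᵥ ((L * Real.sqrt L) • Ψ - Qh *ᵥ Φ)) := by
  have hc : L * Real.sqrt L ≠ 0 := mul_ne_zero hL.ne' (Real.sqrt_pos.mpr hL).ne'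
  have h1 : Ψ - ((L * Real.sqrt L)⁻¹ • Qh) *ᵥ Φ = (L * Real.sqrt L)⁻¹ • ((L * Real.sqrt L) • Ψ - Qh *ᵥ Φ) := by
    rw [smul_sub, smul_smul, inv_mul_cancel₀ hc, one_smul, Matrix.smul_mulVec]
  have h2 : ((L * Real.sqrt L)⁻¹) ^ 2 = (L ^ 3)⁻¹ := by
    rw [inv_pow, mul_pow, Real.sq_sqrt hL.le]; ring
  rw [h1, sqNorm_smul, sqNorm_eq_dotProduct, h2]
  field_simp

omit [DecidableEq β] in
/-- **the integrand of (first)∕(kth) against the Gaussian start (def2)** `ρ₀(Φ₀) = exp(−½⟨Φ₀, DΦ₀⟩)` IS `exp(−E(Ψ̂, Φ₀))` with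
`E = MultiRegionFreeFlow.energy D ((a/L²)·1) Q̂ Ψ̂ 0` — (third) at `k = 1` before the fine-field integration: `S(Ψ̂, φ) =
½(a/L²)|Ψ̂ − Q̂φ|² + ½⟨φ, Dφ⟩`. [cite: Dimock2013, §2.2 eqs. (def2), (third), (norton) (arXiv:1108.1335v2 TeX L562–580) and
§2.1 (first) (TeX L392–400)] -/
theorem blockKernel_mul_gaussianStart {L : ℝ} (hL : 0 < L) (a : ℝ) (D : Matrix β β ℝ) (Qh : Matrix ι₀ β ℝ)
    (Ψ : ι₀ → ℝ) (Φ : β → ℝ) :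
    Real.exp (-(a * L / 2) * sqNorm (Ψ - ((L * Real.sqrt L)⁻¹ • Qh) *ᵥ Φ))
        * Real.exp (-(1 / 2 : ℝ) * (Φ ⬝ᵥ D *ᵥ Φ))
      = Real.exp (-energy D ((a / L ^ 2) • (1 : Matrix ι₀ ι₀ ℝ)) Qh ((L * Real.sqrt L) • Ψ) 0 Φ) := by
  rw [← Real.exp_add, neg_mul, kth_exponent_eq hL a Qh Ψ Φ]
  unfold energy action
  rw [dotProduct_zero, sub_zero, Matrix.smul_mulVec, Matrix.one_mulVec, dotProduct_smul, smul_eq_mul]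
  ring_nf

variable (σ : κ₁ ≃ β) (τ : ι₁ ≃ ι₀)

/-- **THE FIRST STEP FROM THE GAUSSIAN START — (first) → (third) → (only) AT `k = 1`**: for `ρ₀(Φ₀) = exp(−½⟨Φ₀, D₀Φ₀⟩)`
((def2), `D₀ = −Δ + μ̄₀ > 0` on the unit lattice `𝕋⁰_{M+N}`, fine = block sites `β`), gen 43's `rgStep a L Q τ ρ₀` ((first0)
with the literal `Q = (L√L)⁻¹Q̂`, then the rescaling) IS (only)'s `freeDensity D₁ Q₁ a Z₁` on the level-1 lattices
(`κ₁ ≃ β` fine by `σ`, `ι₁ ≃ ι₀` blocks by `τ`) with `a₁ = a`, provided `D₀ = L⁻²D₁^σ` and `Q̂ = Q₁^{τσ}` (*"Q is scale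
invariant: Qφ_L = (Qφ)_L"* L400); the constant is `Z₁ = 𝒩^{−1}_{a,|𝕋¹|}·Z` with `Z = GaussianSingleStep.fineConst D₀ ((a/L²)·1)
Q̂ = ∫exp(−½⟨𝒵, (D₀ + (a/L²)Q̂ᵀQ̂)𝒵⟩)d𝒵` (gen 30's `integral_exp_neg_energy` BY NAME, then Part 11's
`lemma5_scaledDensity_Z`). [cite: Dimock2013, §2.1 eq. (first) (arXiv:1108.1335v2 TeX L392–410) and §2.2 eqs. (def2),
(third)–(only) (TeX L562–620)] -/
theorem rgStep_gaussianStart {L a : ℝ} (hL : 0 < L) (ha : 0 < a) {D₀ : Matrix β β ℝ} (hD : D₀.PosDef)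
    {Qh : Matrix ι₀ β ℝ} {D₁ : Matrix κ₁ κ₁ ℝ} {Qn₁ : Matrix ι₁ κ₁ ℝ}
    (hD1 : D₀ = (L ^ 2)⁻¹ • Matrix.reindex σ σ D₁) (hQn : Qh = Matrix.reindex τ σ Qn₁) :
    rgStep a L (fun Φ : β → ℝ => ((L * Real.sqrt L)⁻¹ • Qh) *ᵥ Φ) τ
        (fun Φ₀ : β → ℝ => Real.exp (-(1 / 2 : ℝ) * (Φ₀ ⬝ᵥ D₀ *ᵥ Φ₀)))
      = freeDensity D₁ Qn₁ a
          ((normConst a (Fintype.card ι₀))⁻¹ * fineConst D₀ ((a / L ^ 2) • (1 : Matrix ι₀ ι₀ ℝ)) Qh) := by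
  funext Φ
  have hA : ((a / L ^ 2) • (1 : Matrix ι₀ ι₀ ℝ)).PosSemidef :=
    Matrix.PosSemidef.one.smul (by positivity)
  have hform : blockDensity (a * L) (fun Φ : β → ℝ => ((L * Real.sqrt L)⁻¹ • Qh) *ᵥ Φ)
        (fun Φ₀ : β → ℝ => Real.exp (-(1 / 2 : ℝ) * (Φ₀ ⬝ᵥ D₀ *ᵥ Φ₀)))
      = fun Ψ => Z0next a L (Fintype.card ι₀) (fineConst D₀ ((a / L ^ 2) • (1 : Matrix ι₀ ι₀ ℝ)) Qh) 1
        * Real.exp (-(energy ((L ^ 2)⁻¹ • Matrix.reindex σ σ D₁)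
            ((L ^ 2)⁻¹ • Matrix.reindex τ τ (a • (1 : Matrix ι₁ ι₁ ℝ))) (Matrix.reindex τ σ Qn₁)
            ((L * Real.sqrt L) • Ψ) 0
            (minimizer ((L ^ 2)⁻¹ • Matrix.reindex σ σ D₁) ((L ^ 2)⁻¹ • Matrix.reindex τ τ (a • (1 : Matrix ι₁ ι₁ ℝ)))
              (Matrix.reindex τ σ Qn₁) ((L * Real.sqrt L) • Ψ) 0))) := by
    funext Ψ
    have haw : (a / L ^ 2) • (1 : Matrix ι₀ ι₀ ℝ) = (L ^ 2)⁻¹ • Matrix.reindex τ τ (a • (1 : Matrix ι₁ ι₁ ℝ)) := by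
      rw [reindex_smul', Matrix.reindex_apply, Matrix.submatrix_one_equiv, smul_smul, div_eq_inv_mul]
    rw [blockDensity_apply]
    simp_rw [blockKernel_mul_gaussianStart hL a D₀ Qh Ψ]
    rw [integral_exp_neg_energy hD hA, Z0next, haw, ← hQn, ← hD1]
    ring
  rw [rgStep_eq, hform, lemma5_scaledDensity_Z σ τ ha hL, freeDensity_eq_energy, one_mul]

end Base

section Tower

variable {κ S T : ℕ → Type*} [∀ k, Fintype (κ k)] [∀ k, Fintype (S k)] [∀ k, Fintype (T k)]
  [∀ k, DecidableEq (κ k)] [∀ k, DecidableEq (S k)] [∀ k, DecidableEq (T k)]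

/-- **THE FREE FLOW: `ρ_k(Φ_k) = Z_k exp(−S_k(Φ_k, φ_k))` FOR EVERY `k ≥ 1`** ((only) L610–613) along gen 43's tower
`densitySeq` ((kth) then (scaleddensity) at every level) started at (def2) `ρ₀(Φ₀) = exp(−½⟨Φ₀, (−Δ + μ̄₀)Φ₀⟩)` — *"Now we
rederive the identity ρ_k(Φ_k) = Z_k exp(−S_k(Φ_k, φ_k)) for the free case by an inductive procedure"* (L643–646): the base
`k = 1` is `rgStep_gaussianStart` ((first) → (only), `a₁ = a = aK a L 1`), the step is Part 13's `lemma5_rgStep` with the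
printed widths `a_k = aK a L k` ((ak), `aNext_aK_div`), and `Z_k` is gen 42's `Zseq` of the one-step factors: `z₀ =
𝒩^{−1}_{a,|𝕋¹_{M+N}|}·Z` (the first step's Gaussian constant) and `z_k = 𝒩^{−1}_{a,|𝕋¹_{M+N−k}|}(2π)^{|𝕋⁰_{M+N−k}|/2}(det C_k)^{1/2}`
((Ziterate); II THEOREM 3.1 item 1 *"Z₀ = 1, Z_{k+1} = Z_kz_k"*).  Data: block lattices `S k` (`𝕋⁰_{M+N−k}`) and `T k`
(`𝕋¹_{M+N−k}`) with `σ k : S (k+1) ≃ T k` as in `densitySeq`; fine lattices `κ k` (`𝕋^{−k}_{M+N−k}`, `k ≥ 1`) with `σf k :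
κ (k+1) ≃ κ k` and `σf₀ : κ 1 ≃ S 0`; operators `D₀` on `S 0` and `D k` on `κ k` scaling with `L⁻²` (`hD0s`, `hDs` —
`negLap_add_mass_scale`) and positive (`hD0`, `hDpos` — `negLap_add_mass_posDef`); isometric averaging `Q̂_k` (`hQ` —
`Qmat_mul_transpose`), the literal `Q = (L√L)⁻¹Q̂`; composite averaging `Q_k` on level `k` with `Q̂₀ = Q₁^{σ₀σf₀}` (`hQ0`) and
`Q̂_kQ_k = Q_{k+1}^{σσf}` (`hQn`: *"Q is scale invariant"*, `Q_{k+1} = QQ_k`); `a > 0`, `L > 1`.  Only this GEOMETRY is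
hypothesis. [cite: Dimock2013, §2.2 eqs. (def2), (third)–(only) (arXiv:1108.1335v2 TeX L560–620); §2.3 L641–662, Lemma tiny
L748–759, Lemma 5 (scaling) with (Ziterate) L797–848; §2.1 (first), (kth), (scaleddensity) (TeX L392–429), Lemma second
(TeX L459–461); Dimock2013BalabanII, Theorem 3.1 item 1 (arXiv:1212.5562v2 TeX L2393–2397)] -/
theorem freeFlow_densitySeq {a L : ℝ} (ha : 0 < a) (hL : 1 < L) (σ : ∀ k, S (k + 1) ≃ T k)
    (σf : ∀ k, κ (k + 1) ≃ κ k) (σf₀ : κ 1 ≃ S 0)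
    {D₀ : Matrix (S 0) (S 0) ℝ} (hD0 : D₀.PosDef) {D : ∀ k, Matrix (κ k) (κ k) ℝ}
    (hDpos : ∀ k, 1 ≤ k → (D k).PosDef) (hD0s : D₀ = (L ^ 2)⁻¹ • Matrix.reindex σf₀ σf₀ (D 1))
    (hDs : ∀ k, 1 ≤ k → D k = (L ^ 2)⁻¹ • Matrix.reindex (σf k) (σf k) (D (k + 1)))
    {Qh : ∀ k, Matrix (T k) (S k) ℝ} (hQ : ∀ k, 1 ≤ k → Qh k * (Qh k)ᵀ = 1)
    {Qk : ∀ k, Matrix (S k) (κ k) ℝ} (hQ0 : Qh 0 = Matrix.reindex (σ 0) σf₀ (Qk 1))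
    (hQn : ∀ k, 1 ≤ k → Qh k * Qk k = Matrix.reindex (σ k) (σf k) (Qk (k + 1)))
    (k : ℕ) (hk : 1 ≤ k) :
    densitySeq a L (fun k (Φ : S k → ℝ) => ((L * Real.sqrt L)⁻¹ • Qh k) *ᵥ Φ) σ
        (fun Φ₀ : S 0 → ℝ => Real.exp (-(1 / 2 : ℝ) * (Φ₀ ⬝ᵥ D₀ *ᵥ Φ₀))) k
      = freeDensity (D k) (Qk k) (aK a L k)
          (Zseq (fun j => if j = 0 then
              (normConst a (Fintype.card (T 0)))⁻¹ * fineConst D₀ ((a / L ^ 2) • (1 : Matrix (T 0) (T 0) ℝ)) (Qh 0)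
            else (normConst a (Fintype.card (T j)))⁻¹
              * (Real.sqrt (2 * Real.pi) ^ Fintype.card (S j)
                * Real.sqrt (Ckr (D j) (Qk j) (Qh j) (aK a L j) (a / L ^ 2) 0).det)) k) := by
  have hL0 : 0 < L := lt_trans zero_lt_one hL
  induction k, hk using Nat.le_induction with
  | base =>
    rw [densitySeq_succ, densitySeq_zero, rgStep_gaussianStart σf₀ (σ 0) hL0 ha hD0 hD0s hQ0, aK_one hL,
      Zseq_succ, Zseq_zero, one_mul, if_pos rfl]
  | succ k hk ih =>
    rw [densitySeq_succ, ih,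
      lemma5_rgStep (σf k) (σ k) hL0 ha (aK_pos ha hL hk) (hDpos k hk) (hQ k hk) (hDs k hk) (hQn k hk)
        (aNext_aK_div ha hL hk),
      Zseq_succ, if_neg (Nat.one_le_iff_ne_zero.mp hk)]

end Tower

end FreeFlowTower

end Literature.MathematicalPhysics.QuantumFieldTheory.Dimock2011to13.MinimizerScaling
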